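/-
`stub_switch` ROAD — ASSEMBLED (stub-ideation k = 1, GEN 12 merge; a crux WORKFILE, not a route/Theorems file).
  theorem StubSwitchK2G9.CDT_three_five_switch_of_cert_of_thm132 :
      StubSwitchK1G12.CuspCertificate →        -- k2 gen-6 kernel certificate `D_LL_MM_eq_zero`, PROVED (own workfile)
      thm132_geomTorsionFive_of_hesseFamily →  -- tree NAMED FACT (PUB) [Fisher2012Hessian Thm 13.2(i)]
      CDT_three_five_switch                    -- ≡ Sketch.stub_switch (Iff.rfl)
NO `sorry` in this file.  The FULL merge (this ⊕ `…_2g6_Cert.lean` inlined, `hcert` discharged) is kernel-checked: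
rc 0, 0 `sorry`, 486 s, axioms `propext, Classical.choice, Quot.sound` (374 KB > workfile cap ⇒ this split;
log attached as evidence `ROAD_merged.check.json`).  CONTENTS (imports merged, bodies verbatim, own namespaces):
`…_1g12_Sketch.lean` (A1, A2, squareSource, B6α-of-cert) · `…_1g10_Sketch.lean` (Piece C, B2, B3, §T) ·
`…_1g11_Sketch.lean` (I0, B5, B6β, B6γ, B7, B8a, B8b, B8d-of-syzygy, B9) · k2-g5 `hesse_syzygy_five_m1` (ns `StubSwitchK2G5x`) ·
`…_2g9_Sketch.lean` (k2: THE ROAD) patched ONLY by: its 14 `sorry`'d helpers given one-line bodies citing the above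
(statements untouched except the leading `hcert` on `helper_fixed_cusp_root`, threaded through `helper_D_root_mod_q`,
`cuspMemberSource_of_helpers`, `stubSwitch_of_helpers`); the 11 `sorry`'d §C helpers + `surjThreeOfCuspData_of_helpers`
deleted (superseded by k1-g10 `surjThreeOfCuspData`); final corollary added; sanity `example`s and module docstrings elided.
Credit: road/cut/certificates/joins — ideator k2 (gens 2–9); discharges — ideator k1 (gens 9–12).
PORTING = collapse the five namespaces (duplicated defs are character-identical copies; cross-namespace uses unfold by `rfl`).
-/
import Literature.NumberTheory.Automorphic.CDTTheorem712
import Literature.NumberTheory.GaloisRepresentations.ModNCyclotomicCharacter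
import Literature.NumberTheory.GaloisRepresentations.ImaginaryQuadraticCyclotomicProofs
import Literature.NumberTheory.EllipticCurves.ModFiveCongruenceHessePolynomials
import Literature.NumberTheory.EllipticCurves.TorsionCardinality
import HarnessLib
import Literature.NumberTheory.EllipticCurves.ReducibleModThreeFrobeniusTrace
import Literature.NumberTheory.EllipticCurves.OpenImageMazurCharacterProofs
import Literature.NumberTheory.EllipticCurves.OpenImageMazurFrobeniusProofs
import Literature.NumberTheory.EllipticCurves.OpenImageMazurTwistProofs
import Literature.NumberTheory.EllipticCurves.ModPImageTransvectionCriterionProofs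
import Literature.NumberTheory.EllipticCurves.MultiplicativeTransvectionPrimeToVProofs
import Literature.NumberTheory.EllipticCurves.TorsionStructureProofs
import Literature.NumberTheory.GaloisRepresentations.DirichletCharacterOfGaloisCharacter
import Literature.NumberTheory.DiophantineGeometry.MinimalDiscriminant
import Mathlib.NumberTheory.Basic
import Literature.NumberTheory.EllipticCurves.TorsionFrobenius
import Literature.NumberTheory.EllipticCurves.TateCurve.NumberFieldUniformizationTwistedTateJ
import Literature.NumberTheory.EllipticCurves.TateParametrisationTorsion
import Literature.NumberTheory.EllipticCurves.NeronOggShafarevichLocal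
import Literature.NumberTheory.EllipticCurves.MultiplicativeUnipotentTorsionProofs
import Literature.NumberTheory.EllipticCurves.SerreOpenImageDeterminantProofs
import Literature.NumberTheory.EllipticCurves.MatarNekovar2019.IrreducibleOverQuadraticFieldProofs
import Literature.NumberTheory.EllipticCurves.PeriodIndexLocalTriviality
import Literature.NumberTheory.EllipticCurves.Kato2004.SemilocalDecompositionProofs
import Literature.NumberTheory.GaloisRepresentations.DecompositionGroupOfCompletion
import Literature.NumberTheory.GaloisRepresentations.IntegralGaloisActionProofs
import Mathlib.NumberTheory.Padics.HeightOneSpectrum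
import Literature.NumberTheory.EllipticCurves.ModFiveCongruenceHesseFamily
import Literature.NumberTheory.EllipticCurves.TorsionFrobeniusChebotarevProofs
import Literature.NumberTheory.EllipticCurves.AdditiveReductionRamifiedTorsionLevelProofs
import Literature.NumberTheory.EllipticCurves.GoodReductionUnramifiedProofs
import Literature.NumberTheory.EllipticCurves.DivisionFieldRamificationPrimePowProofs
import Literature.NumberTheory.EllipticCurves.SzpiroLocalDataProofs
import Literature.NumberTheory.GaloisRepresentations.HeckeCharacterProofs
import Literature.NumberTheory.DiophantineGeometry.MinimalDiscriminantNormProofs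
import Literature.NumberTheory.DiophantineGeometry.LocalReductionFiniteBadPlacesProofs
import Literature.NumberTheory.DiophantineGeometry.LocalReductionHasMultiplicativeReductionAtProofs
import Literature.AlgebraicGeometry.Motives.ZetaFunctionProofs
import Mathlib.Algebra.Polynomial.Identities
import Mathlib.Algebra.Polynomial.Derivative
/-
Copyright: h21 programme. Stub-ideation companion (k = 1, GENERATION 12, HOME FAMILY 1 — RECOGNISE & IMPORT)
— NOT a route file, NOT a Theorems file.  Purpose: CLOSE THE LAST THREE OPEN LEAVES of the k2 road for
`stub_switch` — Piece A (`SquareSource`: A1 `negOneIsSquare : NegOneIsSquare`, A2 `helper_exists_tau_sq_eq_neg`,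
k2 statements verbatim) SORRY-FREE (§1–§6), and B6α `helper_fixed_cusp_root` modulo the gen-6 kernel
certificate (§7, composition with the certificate kernel-checked in scratch).  0 `sorry` in this file.
Imports no other crux workfile (the farm does not build them as modules); the k2-g7 entry-level
vocabulary / transport it needs is COPIED (credit: ideator k2), the heavy gen-7 tables `normC3_gen`,
`normU_gen` (40 M heartbeats each) are REPLACED by cheap parametrised ones (`cen3_det2/4`, `fix_pow`).
-/

/-! # (k1 gen 12) `STUB_IDEAS_stub_switch_1g12_Sketch.lean` — module docstring ELIDED (see that workfile). -/

set_option linter.style.longLine false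
set_option linter.dupNamespace false
set_option linter.unusedVariables false

namespace Summit.ABC.ABC.Cruxes.FreyModularity.StubSwitchK1G12

open scoped Matrix

/-! ## §1 entry-level vocabulary (VERBATIM from k2 gen 6/7, ns `…StubSwitchK2G7`; plus `lin`) -/

/-- entry-level `2×2` matrices over `𝔽₅`. -/
abbrev M2 := Fin 2 → Fin 2 → ZMod 5
/-- explicit product (`= A * B`, `toM2_mul`). -/
def mul2 (A B : M2) : M2 := fun i j => A i 0 * B 0 j + A i 1 * B 1 j
/-- explicit determinant (`= det`, `d_toM2`). -/
def d (A : M2) : ZMod 5 := A 0 0 * A 1 1 - A 0 1 * A 1 0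
def one2 : M2 := fun i j => if i = j then 1 else 0
def neg2 : M2 := fun i j => if i = j then -1 else 0
def sq2 (A : M2) : M2 := mul2 A A
def p3 (A : M2) : M2 := mul2 (sq2 A) A
def p4 (A : M2) : M2 := sq2 (sq2 A)
def p6 (A : M2) : M2 := mul2 (mul2 (sq2 A) (sq2 A)) (sq2 A)
def app (A : M2) (v : Fin 2 → ZMod 5) : Fin 2 → ZMod 5 := fun i => A i 0 * v 0 + A i 1 * v 1
/-- explicit matrix `[[a,b],[c,e]]`. -/
def m (a b c e : ZMod 5) : M2 := fun i j => if i = 0 then (if j = 0 then a else b) else (if j = 0 then c else e)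
/-- `a·1 + b·S` (the generic element of the centraliser algebra `𝔽₅[S]`). -/
def lin (a b : ZMod 5) (S : M2) : M2 := fun i j => a * one2 i j + b * S i j

/-- the 24 elements of order `5` of `SL₂(𝔽₅)` (complete: `mem_u5List`). -/
def u5List : List M2 :=
  [m 0 1 4 2, m 0 2 2 2, m 0 3 3 2, m 0 4 1 2, m 1 0 1 1, m 1 0 2 1, m 1 0 3 1, m 1 0 4 1,
   m 1 1 0 1, m 1 2 0 1, m 1 3 0 1, m 1 4 0 1, m 2 1 4 0, m 2 2 2 0, m 2 3 3 0, m 2 4 1 0,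
   m 3 1 1 4, m 3 2 3 4, m 3 3 2 4, m 3 4 4 4, m 4 1 1 3, m 4 2 3 3, m 4 3 2 3, m 4 4 4 3]

/-- the 20 elements of order `3` of `SL₂(𝔽₅)` (complete: `mem_s3List`). -/
def s3List : List M2 :=
  [m 0 1 4 4, m 0 2 2 4, m 0 3 3 4, m 0 4 1 4, m 1 1 2 3, m 1 2 1 3, m 1 3 4 3, m 1 4 3 3,
   m 2 1 3 2, m 2 2 4 2, m 2 3 1 2, m 2 4 2 2, m 3 1 2 1, m 3 2 1 1, m 3 3 4 1, m 3 4 3 1,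
   m 4 1 4 0, m 4 2 2 0, m 4 3 3 0, m 4 4 1 0]

/-- a vector spanning the fixed line of a unipotent `u ≠ 1` (`fixv_spec`). -/
def fixv (U : M2) : Fin 2 → ZMod 5 :=
  if (fun i => U i 0 - one2 i 0) ≠ (fun _ => (0 : ZMod 5)) then (fun i => U i 0 - one2 i 0)
  else (fun i => U i 1 - one2 i 1)

/-! ## §2 the kernel-decided facts (all CHEAP: ≤ 625·k cases each) -/

set_option maxHeartbeats 4000000 in
set_option maxRecDepth 100000 in
/-- **order split of `SL₂(𝔽₅)` in one table**: `A = ±1`, or `A² = −1`, or `A²` has order `3`, or `A²` has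
order `5` (orders `{1,2,3,4,5,6,10}`). Replaces gen-7 `orders_SL2` + `invol`. -/
theorem order_cases : ∀ A : M2, d A = 1 → A ≠ one2 → A ≠ neg2 →
    (sq2 A = neg2 ∨ sq2 A ∈ s3List ∨ sq2 A ∈ u5List) := by
  decide

set_option maxHeartbeats 4000000 in
set_option maxRecDepth 100000 in
/-- completeness of `u5List` (gen 7, verbatim). -/
theorem mem_u5List : ∀ A : M2, (d A = 1 ∧ mul2 (p4 A) A = one2 ∧ A ≠ one2) → A ∈ u5List := by
  decide

set_option maxHeartbeats 4000000 in
set_option maxRecDepth 100000 in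
/-- completeness of `s3List` (gen 7, verbatim). -/
theorem mem_s3List : ∀ A : M2, (d A = 1 ∧ p3 A = one2 ∧ A ≠ one2) → A ∈ s3List := by
  decide

set_option maxHeartbeats 4000000 in
set_option maxRecDepth 100000 in
theorem u5List_sound : ∀ A ∈ u5List, d A = 1 ∧ mul2 (p4 A) A = one2 ∧ A ≠ one2 := by
  decide

set_option maxHeartbeats 4000000 in
set_option maxRecDepth 100000 in
theorem s3List_sound : ∀ A ∈ s3List, d A = 1 ∧ p3 A = one2 ∧ A ≠ one2 ∧ A 0 1 ≠ 0 := by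
  decide

set_option maxHeartbeats 4000000 in
set_option maxRecDepth 100000 in
/-- pair lemma, order 5 (gen 7, verbatim). -/
theorem u5_pair : ∀ A ∈ u5List, ∀ B ∈ u5List, mul2 A B ≠ mul2 B A →
    (sq2 (mul2 A B) = neg2 ∨ sq2 (mul2 (sq2 A) B) = neg2 ∨ sq2 (mul2 (p3 A) B) = neg2 ∨
      sq2 (mul2 (p4 A) B) = neg2) := by
  decide

set_option maxHeartbeats 4000000 in
set_option maxRecDepth 100000 in
/-- commuting elements of order 5 generate the same `C₅` (gen 7, verbatim). -/
theorem u5_comm : ∀ A ∈ u5List, ∀ B ∈ u5List, mul2 A B = mul2 B A →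
    (B = A ∨ B = sq2 A ∨ B = p3 A ∨ B = p4 A) := by
  decide

set_option maxHeartbeats 4000000 in
set_option maxRecDepth 100000 in
/-- pair lemma, order 3 (gen 7, verbatim). -/
theorem s3_pair : ∀ A ∈ s3List, ∀ B ∈ s3List, mul2 A B ≠ mul2 B A →
    (sq2 (mul2 A B) = neg2 ∨ sq2 (mul2 (sq2 A) B) = neg2 ∨
      sq2 (mul2 (mul2 (mul2 (sq2 A) B) A) B) = neg2) := by
  decide

set_option maxHeartbeats 4000000 in
set_option maxRecDepth 100000 in
/-- commuting elements of order 3 generate the same `C₃` (gen 7, verbatim). -/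
theorem s3_comm : ∀ A ∈ s3List, ∀ B ∈ s3List, mul2 A B = mul2 B A → (B = A ∨ B = sq2 A) := by
  decide

set_option maxHeartbeats 4000000 in
set_option maxRecDepth 100000 in
/-- **NEW (500 cases): an element of norm `2` of the field `𝔽₅[s] ≅ 𝔽₂₅` has `x⁶ = N(x) = 2`, so `(x⁶)² = −1`.** -/
theorem cen3_det2 : ∀ S ∈ s3List, ∀ a b : ZMod 5, d (lin a b S) = 2 → sq2 (p6 (lin a b S)) = neg2 := by
  decide

set_option maxHeartbeats 4000000 in
set_option maxRecDepth 100000 in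
/-- **NEW (500 cases): an element of norm `4 = −1` of `𝔽₅[s]` has `x⁶ = −1`.** -/
theorem cen3_det4 : ∀ S ∈ s3List, ∀ a b : ZMod 5, d (lin a b S) = 4 → p6 (lin a b S) = neg2 := by
  decide

set_option maxHeartbeats 4000000 in
set_option maxRecDepth 100000 in
/-- `fixv u` is a nonzero fixed vector of `u` (gen 7, verbatim). -/
theorem fixv_spec : ∀ U ∈ u5List, fixv U ≠ (fun _ => 0) ∧ app U (fixv U) = fixv U := by
  decide

set_option maxHeartbeats 4000000 in
set_option maxRecDepth 100000 in
/-- **NEW (600 cases, replaces gen-7 `normU_gen`): a vector fixed by a non-trivial power of `u` lies on the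
fixed line of `u`.** -/
theorem fix_pow : ∀ U ∈ u5List, ∀ v : Fin 2 → ZMod 5,
    (app U v = v ∨ app (sq2 U) v = v ∨ app (p3 U) v = v ∨ app (p4 U) v = v) →
    v 0 * fixv U 1 = v 1 * fixv U 0 := by
  decide

set_option maxHeartbeats 4000000 in
set_option maxRecDepth 100000 in
/-- collinear with a nonzero vector ⇒ a multiple of it (gen 7, verbatim). -/
theorem collinear : ∀ w z : Fin 2 → ZMod 5, w ≠ (fun _ => 0) → z 0 * w 1 = z 1 * w 0 →
    ∃ c : ZMod 5, z = fun i => c * w i := by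
  decide

set_option maxHeartbeats 4000000 in
set_option maxRecDepth 100000 in
/-- **NEW (625 cases): an element of determinant `2` either has a rational eigenline or lies in a non-split
Cartan, where `(g⁶)² = N(g)² = −1`.** -/
theorem eig_or_p6 : ∀ B : M2, d B = 2 →
    (∃ w : Fin 2 → ZMod 5, w ≠ (fun _ => 0) ∧ ∃ c : ZMod 5, app B w = fun i => c * w i) ∨
      sq2 (p6 B) = neg2 := by
  decide

/-- the non-zero elements of `𝔽₅` are the powers `2ᵏ`, `k ≤ 3`. -/
theorem zmod5_cases : ∀ x : ZMod 5, x ≠ 0 → (x = 2 ^ 0 ∨ x = 2 ^ 1 ∨ x = 2 ^ 2 ∨ x = 2 ^ 3) := by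
  decide

/-- `q⁻¹ = q³` in `𝔽₅ˣ`. -/
theorem zmod5_mul_cube : ∀ q : ZMod 5, q ≠ 0 → q * q ^ 3 = 1 := by
  decide

/-! ## §3 transport `GL (Fin 2) (ZMod 5)` → entries (gen 7 verbatim + `app_mul2`, `app_eq_smul`) -/

/-- the entries of `g ∈ GL₂(𝔽₅)`. -/
def toM2 (g : GL (Fin 2) (ZMod 5)) : M2 := fun i j => (g : Matrix (Fin 2) (Fin 2) (ZMod 5)) i j

theorem toM2_mul (g h : GL (Fin 2) (ZMod 5)) : toM2 (g * h) = mul2 (toM2 g) (toM2 h) := by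
  ext i j
  simp [toM2, mul2, Matrix.mul_apply, Fin.sum_univ_two]

theorem toM2_one : toM2 (1 : GL (Fin 2) (ZMod 5)) = one2 := by
  ext i j
  simp [toM2, one2, Matrix.one_apply]

theorem toM2_neg_one : toM2 (-1 : GL (Fin 2) (ZMod 5)) = neg2 := by
  ext i j
  by_cases h : i = j <;> simp [toM2, neg2, h]

theorem d_toM2 (g : GL (Fin 2) (ZMod 5)) : d (toM2 g) = (Matrix.GeneralLinearGroup.det g : ZMod 5) := by
  simp [d, toM2, Matrix.GeneralLinearGroup.val_det_apply, Matrix.det_fin_two]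

theorem toM2_injective : Function.Injective toM2 := by
  intro g h hgh
  apply Units.ext
  ext i j
  exact congrFun (congrFun hgh i) j

theorem mulVec_eq_app (g : GL (Fin 2) (ZMod 5)) (w : Fin 2 → ZMod 5) :
    (g : Matrix (Fin 2) (Fin 2) (ZMod 5)).mulVec w = app (toM2 g) w := by
  ext i
  simp [toM2, app, Matrix.mulVec, dotProduct, Fin.sum_univ_two]

theorem app_mul2 (A B : M2) (v : Fin 2 → ZMod 5) : app (mul2 A B) v = app A (app B v) := by
  ext i
  simp only [app, mul2]
  ring

theorem app_eq_smul (c : ZMod 5) (w : Fin 2 → ZMod 5) : (fun i => c * w i) = c • w := by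
  ext i
  simp

/-- `g² = −1` read back from the entries. -/
theorem sq_eq_neg_one_of_toM2 {g : GL (Fin 2) (ZMod 5)} (h : sq2 (toM2 g) = neg2) : g * g = -1 :=
  toM2_injective (by rw [toM2_mul, toM2_neg_one]; exact h)

/-- `g¹² = −1` read back from `sq2 (p6 (toM2 g)) = neg2`, as a square. -/
theorem pow12_of_toM2 {g : GL (Fin 2) (ZMod 5)} (h : sq2 (p6 (toM2 g)) = neg2) :
    (((g * g) * (g * g)) * (g * g)) * (((g * g) * (g * g)) * (g * g)) = -1 :=
  toM2_injective (by simp only [toM2_mul, toM2_neg_one]; exact h)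

/-! ## §4 the ALGEBRAIC centraliser lemma (replaces the 12 500-case filters of gen-7 `normC3_gen`) -/

/-- **`B` commutes with `S`, `S₀₁ ≠ 0` ⇒ `B = a·1 + b·S`** (entrywise, over the ring `𝔽₅`; `q⁻¹ = q³`). -/
theorem comm_lin (S B : M2) (hq : S 0 1 ≠ 0) (h : mul2 B S = mul2 S B) :
    ∃ a b : ZMod 5, B = lin a b S := by
  have hq' := zmod5_mul_cube (S 0 1) hq
  have e1 := congrFun (congrFun h 0) 0
  have e2 := congrFun (congrFun h 0) 1
  simp only [mul2] at e1 e2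
  refine ⟨B 0 0 - B 0 1 * S 0 1 ^ 3 * S 0 0, B 0 1 * S 0 1 ^ 3, ?_⟩
  funext i j
  fin_cases i <;> fin_cases j
  · simp [lin, one2]
  · simp only [lin, one2, Fin.zero_eta, Fin.mk_one, zero_ne_one, if_false, mul_zero, zero_add]
    linear_combination (-(B 0 1)) * hq'
  · simp only [lin, one2, Fin.zero_eta, Fin.mk_one, one_ne_zero, if_false, mul_zero, zero_add]
    linear_combination (-(B 1 0)) * hq' - S 0 1 ^ 3 * e1
  · simp only [lin, one2, Fin.mk_one, if_true, mul_one]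
    linear_combination (B 0 0 - B 1 1) * hq' - S 0 1 ^ 3 * e2

/-! ## §5 A1 — the group-theoretic core, `H`-free and non-abelian-free (THEOREM) -/

section Core

variable (G : Subgroup (GL (Fin 2) (ZMod 5)))

/-- closure of "`w` is an eigenvector" under products. -/
theorem mulVec_line_mul {g g' : GL (Fin 2) (ZMod 5)} {w : Fin 2 → ZMod 5} {a b : ZMod 5}
    (ha : (g : Matrix (Fin 2) (Fin 2) (ZMod 5)) *ᵥ w = a • w)
    (hb : (g' : Matrix (Fin 2) (Fin 2) (ZMod 5)) *ᵥ w = b • w) :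
    ((g * g' : GL (Fin 2) (ZMod 5)) : Matrix (Fin 2) (Fin 2) (ZMod 5)) *ᵥ w = (a * b) • w := by
  rw [Units.val_mul, ← Matrix.mulVec_mulVec, hb, Matrix.mulVec_smul, ha, smul_smul, mul_comm]

theorem mulVec_line_pow {g : GL (Fin 2) (ZMod 5)} {w : Fin 2 → ZMod 5} {c : ZMod 5}
    (hc : (g : Matrix (Fin 2) (Fin 2) (ZMod 5)) *ᵥ w = c • w) :
    ∀ k : ℕ, ((g ^ k : GL (Fin 2) (ZMod 5)) : Matrix (Fin 2) (Fin 2) (ZMod 5)) *ᵥ w = (c ^ k) • w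
  | 0 => by simp
  | k + 1 => by rw [pow_succ, pow_succ, mulVec_line_mul (mulVec_line_pow hc k) hc]

/-- **order-3 branch**: `s ∈ G` of order 3 (`det 1`), `g₂ ∈ G` with `det g₂ = 2` ⇒ some `g ∈ G` has `g² = −1`. -/
theorem branch3 {s g₂ : GL (Fin 2) (ZMod 5)} (hs : s ∈ G) (hg₂ : g₂ ∈ G)
    (hS : toM2 s ∈ s3List) (hB : d (toM2 g₂) = 2) : ∃ g ∈ G, g * g = -1 := by
  obtain ⟨hdS, hS3, hS1, hq⟩ := s3List_sound _ hS
  have hdet_s : Matrix.GeneralLinearGroup.det s = 1 := Units.ext (by rw [← d_toM2]; simpa using hdS)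
  have hs3 : s * s * s = 1 := toM2_injective (by rw [toM2_mul, toM2_mul, toM2_one]; exact hS3)
  -- the conjugate `s' = g₂ s g₂⁻¹ ∈ G` is again of order 3
  set s' := g₂ * s * g₂⁻¹ with hs'_def
  have hs'G : s' ∈ G := G.mul_mem (G.mul_mem hg₂ hs) (G.inv_mem hg₂)
  have hS' : toM2 s' ∈ s3List := by
    refine mem_s3List _ ⟨?_, ?_, ?_⟩
    · rw [d_toM2, hs'_def, map_mul, map_mul, map_inv, hdet_s, mul_one, mul_inv_cancel, Units.val_one]
    · have h3 : s' * s' * s' = 1 := by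
        have e : s' * s' * s' = g₂ * (s * s * s) * g₂⁻¹ := by rw [hs'_def]; group
        rw [e, hs3, mul_one, mul_inv_cancel]
      have := congrArg toM2 h3
      rw [toM2_mul, toM2_mul, toM2_one] at this
      exact this
    · intro h1
      apply hS1
      have h1' : s' = 1 := toM2_injective (by rw [h1, toM2_one])
      rw [hs'_def, mul_inv_eq_one, mul_eq_left] at h1'
      rw [h1', toM2_one]
  by_cases hc : mul2 (toM2 s) (toM2 s') = mul2 (toM2 s') (toM2 s)
  · -- commuting conjugate: `s' = s` or `s' = s²`
    rcases s3_comm _ hS _ hS' hc with h | h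
    · -- `g₂` centralises `s`: `g₂ ∈ 𝔽₅[s]`, `(g₂⁶)² = −1`
      have hgs : g₂ * s = s * g₂ := by
        have : s' = s := toM2_injective h
        rwa [hs'_def, mul_inv_eq_iff_eq_mul] at this
      have hcomm : mul2 (toM2 g₂) (toM2 s) = mul2 (toM2 s) (toM2 g₂) := by
        rw [← toM2_mul, ← toM2_mul, hgs]
      obtain ⟨a, b, hab⟩ := comm_lin _ _ hq hcomm
      have h6 := cen3_det2 _ hS a b (by rw [← hab]; exact hB)
      rw [← hab] at h6
      exact ⟨_, G.mul_mem (G.mul_mem (G.mul_mem hg₂ hg₂) (G.mul_mem hg₂ hg₂)) (G.mul_mem hg₂ hg₂),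
        pow12_of_toM2 h6⟩
    · -- `g₂ s g₂⁻¹ = s²`: then `g₂²` centralises `s`, `det g₂² = 4`, `(g₂²)⁶ = −1`
      have hconj : g₂ * s * g₂⁻¹ = s * s := by
        rw [← hs'_def]; exact toM2_injective (h.trans (toM2_mul s s).symm)
      have hgs : (g₂ * g₂) * s = s * (g₂ * g₂) := by
        have e1 : (g₂ * g₂) * s * (g₂ * g₂)⁻¹ = g₂ * (g₂ * s * g₂⁻¹) * g₂⁻¹ := by group
        have e2 : g₂ * (s * s) * g₂⁻¹ = (g₂ * s * g₂⁻¹) * (g₂ * s * g₂⁻¹) := by group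
        have e3 : (s * s) * (s * s) = (s * s * s) * s := by group
        rw [hconj, e2, hconj, e3, hs3, one_mul, mul_inv_eq_iff_eq_mul] at e1
        exact e1
      have hcomm : mul2 (toM2 (g₂ * g₂)) (toM2 s) = mul2 (toM2 s) (toM2 (g₂ * g₂)) := by
        rw [← toM2_mul, ← toM2_mul, hgs]
      obtain ⟨a, b, hab⟩ := comm_lin _ _ hq hcomm
      have hd4 : d (toM2 (g₂ * g₂)) = 4 := by
        have h2 : (Matrix.GeneralLinearGroup.det g₂ : ZMod 5) = 2 := by rw [← d_toM2]; exact hB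
        rw [d_toM2, map_mul, Units.val_mul, h2]; decide
      have h6 := cen3_det4 _ hS a b (by rw [← hab]; exact hd4)
      rw [← hab] at h6
      refine ⟨((g₂ * g₂) * (g₂ * g₂)) * (g₂ * g₂),
        G.mul_mem (G.mul_mem (G.mul_mem hg₂ hg₂) (G.mul_mem hg₂ hg₂)) (G.mul_mem hg₂ hg₂), ?_⟩
      apply toM2_injective
      have e : (((g₂ * g₂) * (g₂ * g₂)) * (g₂ * g₂)) * (((g₂ * g₂) * (g₂ * g₂)) * (g₂ * g₂)) =
          (((g₂ * g₂) * (g₂ * g₂)) * ((g₂ * g₂) * (g₂ * g₂))) * ((g₂ * g₂) * (g₂ * g₂)) := by group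
      rw [e, toM2_mul, toM2_mul, toM2_mul, toM2_neg_one]
      exact h6
  · -- non-commuting pair of order 3: an explicit word squares to `−1`
    rcases s3_pair _ hS _ hS' hc with h | h | h
    · exact ⟨s * s', G.mul_mem hs hs'G, sq_eq_neg_one_of_toM2 (by rw [toM2_mul]; exact h)⟩
    · exact ⟨s * s * s', G.mul_mem (G.mul_mem hs hs) hs'G,
        sq_eq_neg_one_of_toM2 (by rw [toM2_mul, toM2_mul]; exact h)⟩
    · exact ⟨s * s * s' * s * s', G.mul_mem (G.mul_mem (G.mul_mem (G.mul_mem hs hs) hs'G) hs) hs'G,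
        sq_eq_neg_one_of_toM2 (by rw [toM2_mul, toM2_mul, toM2_mul, toM2_mul]; exact h)⟩

/-- **order-5 branch**: `u ∈ G` of order 5 and no common `G`-eigenline ⇒ some `g ∈ G` has `g² = −1`. -/
theorem branch5 {u : GL (Fin 2) (ZMod 5)} (hu : u ∈ G) (hU : toM2 u ∈ u5List)
    (hirr : ∀ w : Fin 2 → ZMod 5, w ≠ 0 → ∃ h ∈ G, ∀ c : ZMod 5,
      (h : Matrix (Fin 2) (Fin 2) (ZMod 5)) *ᵥ w ≠ c • w) :
    ∃ g ∈ G, g * g = -1 := by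
  obtain ⟨hdU, hU5, hU1⟩ := u5List_sound _ hU
  obtain ⟨hw0, hw⟩ := fixv_spec _ hU
  set w := fixv (toM2 u) with hw_def
  have hdet_u : Matrix.GeneralLinearGroup.det u = 1 := Units.ext (by rw [← d_toM2]; simpa using hdU)
  have hu5 : (u * u) * (u * u) * u = 1 :=
    toM2_injective (by rw [toM2_mul, toM2_mul, toM2_mul, toM2_one]; exact hU5)
  obtain ⟨h, hhG, hh⟩ := hirr w hw0
  set u' := h * u * h⁻¹ with hu'_def
  have hu'G : u' ∈ G := G.mul_mem (G.mul_mem hhG hu) (G.inv_mem hhG)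
  have hU' : toM2 u' ∈ u5List := by
    refine mem_u5List _ ⟨?_, ?_, ?_⟩
    · rw [d_toM2, hu'_def, map_mul, map_mul, map_inv, hdet_u, mul_one, mul_inv_cancel, Units.val_one]
    · have h5 : (u' * u') * (u' * u') * u' = 1 := by
        have e : (u' * u') * (u' * u') * u' = h * ((u * u) * (u * u) * u) * h⁻¹ := by
          rw [hu'_def]; group
        rw [e, hu5, mul_one, mul_inv_cancel]
      have := congrArg toM2 h5
      rw [toM2_mul, toM2_mul, toM2_mul, toM2_one] at this
      exact this
    · intro h1
      apply hU1
      have h1' : u' = 1 := toM2_injective (by rw [h1, toM2_one])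
      rw [hu'_def, mul_inv_eq_one, mul_eq_left] at h1'
      rw [h1', toM2_one]
  by_cases hc : mul2 (toM2 u) (toM2 u') = mul2 (toM2 u') (toM2 u)
  · -- `h` normalises `⟨u⟩`: it fixes the fixed line of `u` — contradiction with the choice of `h`
    exfalso
    -- `h u h⁻¹ = uᵏ`, i.e. `h u = uᵏ h`, so `uᵏ (h w) = h (u w) = h w`
    set v := app (toM2 h) w with hv_def
    have key : ∀ uk : GL (Fin 2) (ZMod 5), toM2 u' = toM2 uk → app (toM2 uk) v = v := by
      intro uk huk
      have e : h * u = uk * h := by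
        have : u' = uk := toM2_injective huk
        rwa [hu'_def, mul_inv_eq_iff_eq_mul] at this
      have e' := congrArg (fun g => app (toM2 g) w) e
      simp only [toM2_mul, app_mul2] at e'
      rw [hw] at e'
      exact e'.symm
    have hfix : app (toM2 u) v = v ∨ app (sq2 (toM2 u)) v = v ∨ app (p3 (toM2 u)) v = v ∨
        app (p4 (toM2 u)) v = v := by
      have e2 : toM2 (u * u) = sq2 (toM2 u) := by rw [toM2_mul]; rfl
      have e3 : toM2 (u * u * u) = p3 (toM2 u) := by rw [toM2_mul, toM2_mul]; rfl
      have e4 : toM2 ((u * u) * (u * u)) = p4 (toM2 u) := by rw [toM2_mul, toM2_mul]; rfl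
      rcases u5_comm _ hU _ hU' hc with e | e | e | e
      · exact Or.inl (key u e)
      · exact Or.inr (Or.inl (e2 ▸ key (u * u) (e.trans e2.symm)))
      · exact Or.inr (Or.inr (Or.inl (e3 ▸ key (u * u * u) (e.trans e3.symm))))
      · exact Or.inr (Or.inr (Or.inr (e4 ▸ key ((u * u) * (u * u)) (e.trans e4.symm))))
    obtain ⟨c, hcv⟩ := collinear w v hw0 (fix_pow _ hU v hfix)
    apply hh c
    rw [mulVec_eq_app, ← hv_def, hcv, app_eq_smul]
  · rcases u5_pair _ hU _ hU' hc with e | e | e | e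
    · exact ⟨u * u', G.mul_mem hu hu'G, sq_eq_neg_one_of_toM2 (by rw [toM2_mul]; exact e)⟩
    · exact ⟨u * u * u', G.mul_mem (G.mul_mem hu hu) hu'G,
        sq_eq_neg_one_of_toM2 (by rw [toM2_mul, toM2_mul]; exact e)⟩
    · exact ⟨u * u * u * u', G.mul_mem (G.mul_mem (G.mul_mem hu hu) hu) hu'G,
        sq_eq_neg_one_of_toM2 (by rw [toM2_mul, toM2_mul, toM2_mul]; exact e)⟩
    · exact ⟨(u * u) * (u * u) * u', G.mul_mem (G.mul_mem (G.mul_mem hu hu) (G.mul_mem hu hu)) hu'G,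
        sq_eq_neg_one_of_toM2 (by rw [toM2_mul, toM2_mul, toM2_mul]; exact e)⟩

/-- the unit `2 ∈ 𝔽₅ˣ`. -/
def u2 : (ZMod 5)ˣ := ⟨2, 3, by decide, by decide⟩

/-- **A1, THE CORE (THEOREM; gen-12 strengthening of k2's `NegOneIsSquare` — no `H`, no `det(H)² = 1`,
no non-abelian hypothesis):** `det G = 𝔽₅ˣ` and no common `𝔽₅`-eigenline ⇒ `∃ g ∈ G, g² = −1`. -/
theorem exists_sq_eq_neg_one
    (hdet : ∀ d : (ZMod 5)ˣ, ∃ g ∈ G, Matrix.GeneralLinearGroup.det g = d)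
    (hirr : ∀ w : Fin 2 → ZMod 5, w ≠ 0 → ∃ h ∈ G, ∀ c : ZMod 5,
      (h : Matrix (Fin 2) (Fin 2) (ZMod 5)) *ᵥ w ≠ c • w) :
    ∃ g ∈ G, g * g = -1 := by
  obtain ⟨g₂, hg₂G, hg₂⟩ := hdet u2
  have hg₂v : (Matrix.GeneralLinearGroup.det g₂ : ZMod 5) = 2 := by rw [hg₂]; rfl
  have hB : d (toM2 g₂) = 2 := by rw [d_toM2, hg₂v]
  by_cases hsmall : ∀ g ∈ G, Matrix.GeneralLinearGroup.det g = 1 → (g = 1 ∨ g = -1)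
  · -- `G ∩ SL₂ ⊆ {±1}`: `G = {±g₂ᵏ}`; `g₂` has no rational eigenline, so `(g₂⁶)² = −1`
    rcases eig_or_p6 _ hB with ⟨w, hw0, c, hc⟩ | h6
    · exfalso
      have hcw : (g₂ : Matrix (Fin 2) (Fin 2) (ZMod 5)) *ᵥ w = c • w := by
        rw [mulVec_eq_app, hc, app_eq_smul]
      obtain ⟨h, hhG, hh⟩ := hirr w hw0
      obtain ⟨k, hk⟩ : ∃ k : ℕ, (Matrix.GeneralLinearGroup.det h : ZMod 5) = 2 ^ k := by
        rcases zmod5_cases _ (Matrix.GeneralLinearGroup.det h).ne_zero with e | e | e | e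
        · exact ⟨0, e⟩
        · exact ⟨1, e⟩
        · exact ⟨2, e⟩
        · exact ⟨3, e⟩
      have hdk : Matrix.GeneralLinearGroup.det h = Matrix.GeneralLinearGroup.det (g₂ ^ k) :=
        Units.ext (by rw [map_pow, Units.val_pow_eq_pow_val, hg₂v]; exact hk)
      set t := h * (g₂ ^ k)⁻¹ with ht_def
      have htG : t ∈ G := G.mul_mem hhG (G.inv_mem (G.pow_mem hg₂G k))
      have hdt : Matrix.GeneralLinearGroup.det t = 1 := by
        rw [ht_def, map_mul, map_inv, hdk, mul_inv_cancel]
      have hht : h = t * g₂ ^ k := by rw [ht_def, inv_mul_cancel_right]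
      have hpow := mulVec_line_pow hcw k
      rcases hsmall t htG hdt with e | e
      · apply hh (c ^ k)
        rw [hht, e, one_mul, hpow]
      · apply hh (-(c ^ k))
        rw [hht, e, Units.val_mul, Units.val_neg, Units.val_one, ← Matrix.mulVec_mulVec, hpow,
          Matrix.neg_mulVec, Matrix.one_mulVec, neg_smul]
    · exact ⟨_, G.mul_mem (G.mul_mem (G.mul_mem hg₂G hg₂G) (G.mul_mem hg₂G hg₂G)) (G.mul_mem hg₂G hg₂G),
        pow12_of_toM2 h6⟩
  · push Not at hsmall
    obtain ⟨g₀, hg₀G, hdet₀, hne1, hne2⟩ := hsmall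
    have hA : d (toM2 g₀) = 1 := by rw [d_toM2, hdet₀, Units.val_one]
    have hA1 : toM2 g₀ ≠ one2 := fun e => hne1 (toM2_injective (e.trans toM2_one.symm))
    have hA2 : toM2 g₀ ≠ neg2 := fun e => hne2 (toM2_injective (e.trans toM2_neg_one.symm))
    rcases order_cases _ hA hA1 hA2 with h | h | h
    · exact ⟨g₀, hg₀G, sq_eq_neg_one_of_toM2 h⟩
    · exact branch3 G (G.mul_mem hg₀G hg₀G) hg₂G (by rw [toM2_mul]; exact h) hB
    · exact branch5 G (G.mul_mem hg₀G hg₀G) (by rw [toM2_mul]; exact h) hirr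

end Core

/-- **k2's A1 `NegOneIsSquare` (statement VERBATIM = gen-5/7/9, `Iff.rfl` across namespaces).** -/
def NegOneIsSquare : Prop :=
  ∀ (G H : Subgroup (GL (Fin 2) (ZMod 5))), H ≤ G →
    (∀ d : (ZMod 5)ˣ, ∃ g ∈ G, Matrix.GeneralLinearGroup.det g = d) →
    (∀ h ∈ H, Matrix.GeneralLinearGroup.det h ^ 2 = 1) →
    (∀ w : Fin 2 → ZMod 5, w ≠ 0 → ∃ h ∈ H, ∀ c : ZMod 5,
      (h : Matrix (Fin 2) (Fin 2) (ZMod 5)) *ᵥ w ≠ c • w) →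
    (∃ h₁ ∈ H, ∃ h₂ ∈ H, h₁ * h₂ ≠ h₂ * h₁) →
    ∃ g ∈ G, g * g = -1

/-- **A1 (THEOREM, gen 12):** a one-line corollary of the `H`-free core. -/
theorem negOneIsSquare : NegOneIsSquare :=
  fun G H hHG hdet _ hirr _ =>
    exists_sq_eq_neg_one G hdet fun w hw =>
      let ⟨h, hh, hc⟩ := hirr w hw
      ⟨h, hHG hh, hc⟩

/-! ## §6 A2 — the framing (THEOREM) and Piece A `SquareSource` of the k2 road (PROVED) -/

noncomputable section

open scoped NumberField
open Literature.NumberTheory.EllipticCurves Literature.NumberTheory.Automorphic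
open Literature.NumberTheory.GaloisRepresentations Literature.NumberTheory.Automorphic.BCDT
open WeierstrassCurve Field

/-- `det(−1) = 1` in `GL₂(𝔽₅)`. -/
theorem det_neg_one_GL2 : Matrix.GeneralLinearGroup.det (-1 : GL (Fin 2) (ZMod 5)) = 1 :=
  Units.ext (by rw [← d_toM2, toM2_neg_one]; decide)

/-- **irreducibility over `𝔽₅` read as "no `G`-stable line"** (`G = ρ̄(Γ)`): for every `w ≠ 0` some
`ρ̄ σ` moves the line `𝔽₅·w` (a `Subrepresentation` on `span {w}` would be `⊥` or `⊤`; `⊤` is excluded by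
`finrank = 1 ≠ 2`). -/
theorem exists_not_eigen_of_isIrreducible (ρ : ModPGaloisRep ℚ (ZMod 5) 2)
    (hI : FramedRep.IsIrreducible ρ) (w : Fin 2 → ZMod 5) (hw : w ≠ 0) :
    ∃ σ : absoluteGaloisGroup ℚ, ∀ c : ZMod 5,
      ((ρ σ : GL (Fin 2) (ZMod 5)) : Matrix (Fin 2) (Fin 2) (ZMod 5)) *ᵥ w ≠ c • w := by
  by_contra hcon
  push Not at hcon
  haveI : Representation.IsIrreducible (FramedRep.toRepresentation ρ) := hI
  let K : Subrepresentation (FramedRep.toRepresentation ρ) :=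
    { toSubmodule := Submodule.span (ZMod 5) {w}
      apply_mem_toSubmodule := fun σ v hv => by
        rw [FramedRep.toRepresentation_apply_apply]
        obtain ⟨a, rfl⟩ := Submodule.mem_span_singleton.mp hv
        obtain ⟨c, hc⟩ := hcon σ
        rw [Matrix.mulVec_smul, hc, smul_smul]
        exact Submodule.mem_span_singleton.mpr ⟨a * c, rfl⟩ }
  rcases eq_bot_or_eq_top K with hK | hK
  · have h1 : Submodule.span (ZMod 5) {w} = ⊥ := congrArg Subrepresentation.toSubmodule hK
    exact hw (Submodule.span_singleton_eq_bot.mp h1)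
  · have h1 : Submodule.span (ZMod 5) {w} = ⊤ := congrArg Subrepresentation.toSubmodule hK
    have h2 : Module.finrank (ZMod 5) (Submodule.span (ZMod 5) {w}) = 1 := finrank_span_singleton hw
    rw [h1, finrank_top, Module.finrank_fin_fun] at h2
    exact absurd h2 (by norm_num)

/-- **A2 (THEOREM, gen 12; k2-g9 signature VERBATIM — the hypothesis `hG` is no longer needed, the
`H`-free core `exists_sq_eq_neg_one` is applied to `G = ρ̄(Γ_ℚ)` directly).** -/
theorem helper_exists_tau_sq_eq_neg (hG : NegOneIsSquare) (W : WeierstrassCurve ℚ) [W.IsElliptic]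
    (ρ : ModPGaloisRep ℚ (ZMod 5) 2) (hρ : W.IsTorsionGaloisRep 5 ρ)
    (hirr : ρ.IsAbsIrreducibleOverSqrt 5) :
    ∃ τ : absoluteGaloisGroup ℚ, (∀ P : W.geomTorsion 5, τ • (τ • P) = -P) ∧
      modNCyclotomicCharacter ℚ 5 (τ * τ) = 1 := by
  haveI : NeZero ((5 : ℕ) : ℚ) := ⟨by norm_num⟩
  -- `det ρ̄ = χ̄₅` (tree THEOREM, Weil pairing) and `χ̄₅ : Γ_ℚ → 𝔽₅ˣ` onto (tree THEOREM)
  have hdetχ : ∀ σ : absoluteGaloisGroup ℚ,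
      Matrix.GeneralLinearGroup.det (ρ σ) = modNCyclotomicCharacter ℚ 5 σ := fun σ => by
    rw [← modPCyclotomicCharacterZMod_eq_modNCyclotomicCharacter]
    exact W.det_eq_modPCyclotomicCharacter_of_isTorsionGaloisRep_holds 5 ρ hρ σ
  set G : Subgroup (GL (Fin 2) (ZMod 5)) := MonoidHom.range ρ.toMonoidHom with hG_def
  have hmem : ∀ σ : absoluteGaloisGroup ℚ, ρ σ ∈ G := fun σ => MonoidHom.mem_range.mpr ⟨σ, rfl⟩
  have hdet : ∀ d : (ZMod 5)ˣ, ∃ g ∈ G, Matrix.GeneralLinearGroup.det g = d := fun d => by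
    obtain ⟨σ, hσ⟩ := Rat.modNCyclotomicCharacter_surjective 5 d
    exact ⟨ρ σ, hmem σ, by rw [hdetχ, hσ]⟩
  -- absolutely irreducible over `ℚ(√5)` ⇒ irreducible over `𝔽₅` ⇒ no common eigenline
  have hirr5 : ∀ w : Fin 2 → ZMod 5, w ≠ 0 → ∃ h ∈ G, ∀ c : ZMod 5,
      (h : Matrix (Fin 2) (Fin 2) (ZMod 5)) *ᵥ w ≠ c • w := fun w hw => by
    obtain ⟨σ, hσ⟩ := exists_not_eigen_of_isIrreducible ρ
      hirr.isAbsolutelyIrreducible.isIrreducible w hw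
    exact ⟨ρ σ, hmem σ, hσ⟩
  -- A1
  obtain ⟨g, hgG, hg⟩ := exists_sq_eq_neg_one G hdet hirr5
  obtain ⟨τ, hτ⟩ := MonoidHom.mem_range.mp hgG
  have hg' : ρ τ * ρ τ = -1 := by rw [← hg, ← hτ]; rfl
  refine ⟨τ, fun P => ?_, ?_⟩
  · -- through the frame: `e (τ • (τ • P)) = ρ̄(τ)² · e P = −e P`
    obtain ⟨e, he⟩ := hρ
    apply e.injective
    rw [he, he, Matrix.mulVec_mulVec, ← Units.val_mul, hg', map_neg, Units.val_neg, Units.val_one,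
      Matrix.neg_mulVec, Matrix.one_mulVec]
  · -- `χ̄₅(τ²) = det(ρ̄ τ)² = det(−1) = 1`
    rw [map_mul, ← hdetχ, ← map_mul, hg', det_neg_one_GL2]

/-- **Piece A of the k2 road (k2-g9 `SquareSource`, statement VERBATIM).** -/
def SquareSource : Prop :=
  ∀ (W : WeierstrassCurve ℚ) [W.IsElliptic] (ρ : ModPGaloisRep ℚ (ZMod 5) 2),
    W.IsTorsionGaloisRep 5 ρ → ρ.IsAbsIrreducibleOverSqrt 5 →
    ∃ τ : absoluteGaloisGroup ℚ, (∀ P : W.geomTorsion 5, τ • (τ • P) = -P) ∧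
      modNCyclotomicCharacter ℚ 5 (τ * τ) = 1

/-- k2-g9's glue, verbatim. -/
theorem squareSource_of (hG : NegOneIsSquare) : SquareSource :=
  fun W _ ρ hρ hirr => helper_exists_tau_sq_eq_neg hG W ρ hρ hirr

/-- **PIECE A IS PROVED (gen 12).** -/
theorem squareSource : SquareSource := squareSource_of negOneIsSquare

end

/-! ## §7 B6α — a `φ`-fixed root of Fisher's `𝔇_B(·,1)` (THEOREM modulo the gen-6 KERNEL CERTIFICATE)

`helper_fixed_cusp_root_of_cert (hcert : CuspCertificate) …` has, after `hcert`, the k2-g9 binders and conclusion of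
`helper_fixed_cusp_root` VERBATIM.  `CuspCertificate` is PROVED — verbatim modulo namespace — as
`StubSwitchK2G6.D_LL_MM_eq_zero` (`…_2g6_Cert.lean`, 174 KB, not importable here: crux workfiles are not built as
modules on the farm).  The composition WAS kernel-checked this session in a scratch file `…_2g6_Cert.lean ⊕ §7`
(`lean check` rc 0, 0 sorries, 136 s; `#print axioms` = `propext, Classical.choice, Quot.sound`):
`theorem helper_fixed_cusp_root <k2-g9 signature> := helper_fixed_cusp_root_of_cert (fun c₄ c₆ x p hψ hp =>
StubSwitchK2G6.D_LL_MM_eq_zero c₄ c₆ x p hψ hp) c₄ c₆ hΔ hζ hneg` — the two copies of `PSI5/LL/MM` are defeq. -/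

noncomputable section

open scoped NumberField
open Literature.NumberTheory.EllipticCurves Literature.NumberTheory.EllipticCurves.HesseFamilyFive
open Literature.NumberTheory.GaloisRepresentations Literature.NumberTheory.Automorphic
open WeierstrassCurve Field

/-- k2 vocabulary (verbatim): Fisher's integral model `y² = x³ − 27c₄x − 54c₆`. -/
abbrev base (c₄ c₆ : ℚ) : WeierstrassCurve ℚ := ⟨0, 0, 0, -27 * c₄, -54 * c₆⟩

section CertVocabulary
variable {R : Type*} [CommRing R]

/-- the `5`-division polynomial `ψ₅(x)` of `y² = x³ − 27c₄x − 54c₆` (gen-6 cert, verbatim). -/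
def PSI5 (c₄ c₆ x : R) : R :=
  (5 : R) * x ^ 12 + (-1674 : R) * x ^ 10 * c₄ + (-20520 : R) * x ^ 9 * c₆ + (-76545 : R) * x ^ 8 * c₄ ^ 2 + (349920 : R) * x ^ 7 * c₄ * c₆ + (5904900 : R) * x ^ 6 * c₄ ^ 3 + (-699840 : R) * x ^ 6 * c₆ ^ 2 + (27398736 : R) * x ^ 5 * c₄ ^ 2 * c₆ + (-66430125 : R) * x ^ 4 * c₄ ^ 4 + (151165440 : R) * x ^ 4 * c₄ * c₆ ^ 2 + (-85030560 : R) * x ^ 3 * c₄ ^ 3 * c₆ + (251942400 : R) * x ^ 3 * c₆ ^ 3 + (717445350 : R) * x ^ 2 * c₄ ^ 5 + (-510183360 : R) * x ^ 2 * c₄ ^ 2 * c₆ ^ 2 + (2869781400 : R) * x * c₄ ^ 4 * c₆ + (-2720977920 : R) * x * c₄ * c₆ ^ 3 + (387420489 : R) * c₄ ^ 6 + (1836660096 : R) * c₄ ^ 3 * c₆ ^ 2 + (-2176782336 : R) * c₆ ^ 4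

/-- `LL0 = 4x·f(x)` (gen-6 cert, verbatim). -/
def LL0 (c₄ c₆ x : R) : R :=
  (4 : R) * x ^ 4 + (-108 : R) * x ^ 2 * c₄ + (-216 : R) * x * c₆

/-- `LL1 = 4x·f(x) − N(x)` (gen-6 cert, verbatim). -/
def LL1 (c₄ c₆ x : R) : R :=
  (3 : R) * x ^ 4 + (-162 : R) * x ^ 2 * c₄ + (-648 : R) * x * c₆ + (-729 : R) * c₄ ^ 2

/-- `LL = LL0 + p·LL1` (gen-6 cert, verbatim). -/
def LL (c₄ c₆ x p : R) : R :=
  LL0 c₄ c₆ x + p * LL1 c₄ c₆ x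

/-- `MM = 12·f(x)` (gen-6 cert, verbatim). -/
def MM (c₄ c₆ x : R) : R :=
  (12 : R) * x ^ 3 + (-324 : R) * x * c₄ + (-648 : R) * c₆

/-- BRIDGE (gen-6 cert, verbatim): Mathlib's `preΨ'₅` of `⟨0,0,0,−27c₄,−54c₆⟩` evaluates to `PSI5`. -/
theorem eval_preΨ'_five (c₄ c₆ x : R) :
    ((⟨0, 0, 0, -27 * c₄, -54 * c₆⟩ : WeierstrassCurve R).preΨ' 5).eval x = PSI5 c₄ c₆ x := by
  have key := (⟨0, 0, 0, -27 * c₄, -54 * c₆⟩ : WeierstrassCurve R).preΨ'_odd 0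
  simp only [zero_add, Even.zero, ↓reduceIte, mul_one, WeierstrassCurve.preΨ'_four,
    WeierstrassCurve.preΨ'_two, WeierstrassCurve.preΨ'_one, WeierstrassCurve.preΨ'_three, one_pow,
    one_mul] at key
  rw [key]
  simp only [WeierstrassCurve.preΨ₄, WeierstrassCurve.Ψ₃, WeierstrassCurve.Ψ₂Sq, WeierstrassCurve.b₂,
    WeierstrassCurve.b₄, WeierstrassCurve.b₆, WeierstrassCurve.b₈, Polynomial.eval_add,
    Polynomial.eval_sub, Polynomial.eval_mul, Polynomial.eval_pow, Polynomial.eval_C, Polynomial.eval_X,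
    Polynomial.eval_ofNat, PSI5]
  ring

/-- `MM = 12y²` on the curve (gen-6 cert, verbatim). -/
theorem MM_eq_twelve_mul_sq {K : Type*} [Field K] (c₄ c₆ x y : K)
    (h : (⟨0, 0, 0, -27 * c₄, -54 * c₆⟩ : WeierstrassCurve K).toAffine.Equation x y) :
    MM c₄ c₆ x = 12 * y ^ 2 := by
  rw [WeierstrassCurve.Affine.equation_iff] at h
  simp only [MM]
  linear_combination (-12 : K) * h

/-- `𝔇` is homogeneous of degree `12` in `(λ, μ)` (k2-g4 `helper_D_smul`, PROVED by `ring`). -/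
theorem D_smul (c₄ c₆ t l m : R) : D c₄ c₆ (t * l) (t * m) = t ^ 12 * D c₄ c₆ l m := by
  simp only [D]; ring

end CertVocabulary

/-- **The gen-6 KERNEL CERTIFICATE's conclusion, as a named statement** (PROVED — verbatim modulo
namespace — as `StubSwitchK2G6.D_LL_MM_eq_zero` in `…_2g6_Cert.lean`, 174 KB, `lean check` rc 0 there;
NOT re-elaborated in this file): `ψ₅(x) = 0 ∧ p² + p − 1 = 0 ⇒ 𝔇(c₄,c₆; LL(x,p), MM(x)) = 0` over `\bar ℚ`. -/
def CuspCertificate : Prop :=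
  ∀ (c₄ c₆ x p : AlgebraicClosure ℚ),
    PSI5 c₄ c₆ x = 0 → p ^ 2 + p - 1 = 0 → D c₄ c₆ (LL c₄ c₆ x p) (MM c₄ c₆ x) = 0

/-- the base change of Fisher's model to `\bar ℚ` is the literal short model with cast coefficients. -/
theorem base_baseChange (c₄ c₆ : ℤ) :
    (base (c₄ : ℚ) (c₆ : ℚ)).baseChange (AlgebraicClosure ℚ) =
      ⟨0, 0, 0, -27 * (c₄ : AlgebraicClosure ℚ), -54 * (c₆ : AlgebraicClosure ℚ)⟩ := by
  ext <;> simp [WeierstrassCurve.baseChange, WeierstrassCurve.map]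

section B6alpha
open scoped Classical

/-- **B6α modulo the certificate (THEOREM, gen 12; conclusion and binders = k2-g9
`helper_fixed_cusp_root` VERBATIM, plus the named hypothesis `hcert : CuspCertificate`).** -/
theorem helper_fixed_cusp_root_of_cert (hcert : CuspCertificate) (c₄ c₆ : ℤ) (hΔ : c₄ ^ 3 ≠ c₆ ^ 2)
    [(base (c₄ : ℚ) (c₆ : ℚ)).IsElliptic]
    {φ : absoluteGaloisGroup ℚ} (hζ : modNCyclotomicCharacter ℚ 5 φ = 1)
    (hneg : ∀ P : (base (c₄ : ℚ) (c₆ : ℚ)).geomTorsion 5, φ • P = -P) :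
    ∃ ξ : AlgebraicClosure ℚ, φ • ξ = ξ ∧
      D (c₄ : AlgebraicClosure ℚ) (c₆ : AlgebraicClosure ℚ) ξ 1 = 0 := by
  haveI : NeZero ((5 : ℕ) : ℚ) := ⟨by norm_num⟩
  -- (1) a non-zero `5`-torsion point `T`
  obtain ⟨T, hT0⟩ : ∃ T : (base (c₄ : ℚ) (c₆ : ℚ)).geomTorsion 5, T ≠ 0 := by
    obtain ⟨ρ, e, -⟩ := (base (c₄ : ℚ) (c₆ : ℚ)).exists_isTorsionGaloisRep 5
    refine ⟨e.symm (Pi.single 0 1), fun h0 => ?_⟩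
    have h1 := congrArg e h0
    rw [AddEquiv.apply_symm_apply, map_zero] at h1
    have h2 := congrFun h1 0
    simp at h2
  obtain ⟨P, hPmem⟩ := T
  change ((base (c₄ : ℚ) (c₆ : ℚ)).baseChange (AlgebraicClosure ℚ)).toAffine.Point at P
  rcases P with _ | ⟨x, y, hxy⟩
  · exact (hT0 rfl).elim
  -- (2) `φ T = −T` coordinatewise: `φ x = x`
  have hφ := congrArg Subtype.val (hneg ⟨Affine.Point.some x y hxy, hPmem⟩)
  change Affine.Point.map
      ((show AlgebraicClosure ℚ ≃ₐ[ℚ] AlgebraicClosure ℚ from φ) :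
        AlgebraicClosure ℚ →ₐ[ℚ] AlgebraicClosure ℚ) (Affine.Point.some x y hxy) =
      -Affine.Point.some x y hxy at hφ
  rw [Affine.Point.map_some, Affine.Point.neg_some] at hφ
  simp only [Affine.Point.some.injEq, AlgEquiv.coe_toAlgHom] at hφ
  have hx : absoluteGaloisGroup.toAlgEquiv ℚ φ x = x := hφ.1
  -- (3) `5 • T = 0` ⇒ `ψ₅(x) = 0`
  have hT5 : (5 : ℤ) • (Affine.Point.some x y hxy :
      ((base (c₄ : ℚ) (c₆ : ℚ)).baseChange (AlgebraicClosure ℚ)).toAffine.Point) = 0 :=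
    (Submodule.mem_torsionBy_iff _ _).mp hPmem
  have hψ := (((base (c₄ : ℚ) (c₆ : ℚ)).baseChange (AlgebraicClosure ℚ)).zsmul_some_eq_zero_iff_eval_ΨSq
    hxy 5).mp hT5
  rw [base_baseChange, show (5 : ℤ) = ((5 : ℕ) : ℤ) from rfl, WeierstrassCurve.ΨSq_ofNat] at hψ
  have h5odd : ¬ Even (5 : ℕ) := by decide
  simp only [h5odd, ↓reduceIte, mul_one, Polynomial.eval_pow, eval_preΨ'_five] at hψ
  have hψ5 : PSI5 (c₄ : AlgebraicClosure ℚ) (c₆ : AlgebraicClosure ℚ) x = 0 :=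
    (pow_eq_zero_iff two_ne_zero).mp hψ
  -- (4) the equation and `y ≠ 0` (`T` has odd order)
  have heq : (⟨0, 0, 0, -27 * (c₄ : AlgebraicClosure ℚ), -54 * (c₆ : AlgebraicClosure ℚ)⟩ :
      WeierstrassCurve (AlgebraicClosure ℚ)).toAffine.Equation x y := base_baseChange c₄ c₆ ▸ hxy.1
  have hM := MM_eq_twelve_mul_sq _ _ x y heq
  have hy0 : y ≠ 0 := by
    intro hy0
    have hnegP : -(Affine.Point.some x y hxy :
        ((base (c₄ : ℚ) (c₆ : ℚ)).baseChange (AlgebraicClosure ℚ)).toAffine.Point) =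
        Affine.Point.some x y hxy := by
      rw [Affine.Point.neg_some]
      simp only [Affine.Point.some.injEq, true_and]
      simp [WeierstrassCurve.Affine.negY, WeierstrassCurve.baseChange, WeierstrassCurve.map, hy0]
    have hPP : (Affine.Point.some x y hxy :
        ((base (c₄ : ℚ) (c₆ : ℚ)).baseChange (AlgebraicClosure ℚ)).toAffine.Point) +
        Affine.Point.some x y hxy = 0 := by
      nth_rewrite 2 [← hnegP]
      exact add_neg_cancel _
    have hP0 : (Affine.Point.some x y hxy :
        ((base (c₄ : ℚ) (c₆ : ℚ)).baseChange (AlgebraicClosure ℚ)).toAffine.Point) = 0 := by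
      have e : (Affine.Point.some x y hxy :
          ((base (c₄ : ℚ) (c₆ : ℚ)).baseChange (AlgebraicClosure ℚ)).toAffine.Point) =
          (5 : ℤ) • Affine.Point.some x y hxy - (2 : ℤ) • (Affine.Point.some x y hxy +
            Affine.Point.some x y hxy) := by
        abel
      rw [hT5, hPP, zsmul_zero, sub_zero] at e
      exact e
    exact hT0 (Subtype.ext hP0)
  have hM0 : MM (c₄ : AlgebraicClosure ℚ) (c₆ : AlgebraicClosure ℚ) x ≠ 0 := by
    rw [hM]; exact mul_ne_zero (by norm_num) (pow_ne_zero 2 hy0)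
  -- (5) a primitive 5th root of unity `ζ`, fixed by `φ` since `χ̄₅(φ) = 1`; `p := ζ + ζ⁴`
  obtain ⟨ζ, hζp⟩ := HasEnoughRootsOfUnity.exists_primitiveRoot (AlgebraicClosure ℚ) 5
  have hζ5 : ζ ^ 5 = 1 := hζp.pow_eq_one
  have hφζ : φ • ζ = ζ := by
    rw [modNCyclotomicCharacter_spec ℚ 5 φ ζ hζ5, hζ, Units.val_one, ZMod.val_one, pow_one]
  have hgeom : 1 + ζ + ζ ^ 2 + ζ ^ 3 + ζ ^ 4 = 0 := by
    have h := hζp.geom_sum_eq_zero (by norm_num : 1 < 5)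
    simp only [Finset.sum_range_succ, Finset.sum_range_zero, pow_zero, pow_one, zero_add] at h
    linear_combination h
  set p : AlgebraicClosure ℚ := ζ + ζ ^ 4 with hpdef
  have hpp : p ^ 2 + p - 1 = 0 := by
    rw [hpdef]; linear_combination hgeom + (2 + ζ ^ 3) * hζ5
  have hφp : absoluteGaloisGroup.toAlgEquiv ℚ φ p = p := by
    have : φ • p = p := by rw [hpdef, smul_add, smul_pow', hφζ]
    rwa [absoluteGaloisGroup.smul_def] at this
  -- (6) the certificate and homogeneity: `ξ := LL/MM` is a root of `𝔇(·,1)`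
  have hD := hcert (c₄ : AlgebraicClosure ℚ) (c₆ : AlgebraicClosure ℚ) x p hψ5 hpp
  set ξ : AlgebraicClosure ℚ := LL (c₄ : AlgebraicClosure ℚ) (c₆ : AlgebraicClosure ℚ) x p /
    MM (c₄ : AlgebraicClosure ℚ) (c₆ : AlgebraicClosure ℚ) x with hξdef
  have hLL : MM (c₄ : AlgebraicClosure ℚ) (c₆ : AlgebraicClosure ℚ) x * ξ =
      LL (c₄ : AlgebraicClosure ℚ) (c₆ : AlgebraicClosure ℚ) x p := by
    rw [hξdef, ← mul_div_assoc, mul_div_cancel_left₀ _ hM0]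
  have hDξ : D (c₄ : AlgebraicClosure ℚ) (c₆ : AlgebraicClosure ℚ) ξ 1 = 0 := by
    have key : MM (c₄ : AlgebraicClosure ℚ) (c₆ : AlgebraicClosure ℚ) x ^ 12 *
        D (c₄ : AlgebraicClosure ℚ) (c₆ : AlgebraicClosure ℚ) ξ 1 = 0 := by
      rw [← D_smul, hLL, mul_one]; exact hD
    exact (mul_eq_zero.mp key).resolve_left (pow_ne_zero 12 hM0)
  -- (7) `φ` fixes `ξ` (it fixes `x`, `p` and `ℚ`)
  refine ⟨ξ, ?_, hDξ⟩
  rw [absoluteGaloisGroup.smul_def, hξdef]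
  simp only [LL, LL0, LL1, MM, map_div₀, map_add, map_mul, map_pow, map_neg, map_intCast, map_ofNat,
    hx, hφp]

end B6alpha

end

end Summit.ABC.ABC.Cruxes.FreyModularity.StubSwitchK1G12

/-
Copyright: h21 programme. Stub-ideation companion (k = 1, GENERATION 10, HOME FAMILY 1 — RECOGNISE &
IMPORT) — NOT a route file, NOT a Theorems file.  Imports no other crux workfile (the k2-g8 vocabulary
and helper SIGNATURES are copied VERBATIM, never imported).  Elaboration target: rc 0 with `sorry`
only in the helpers explicitly marked OPEN below.
-/

/-! # (k1 gen 10) `STUB_IDEAS_stub_switch_1g10_Sketch.lean` — module docstring ELIDED (see that workfile). -/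

set_option linter.dupNamespace false
set_option linter.unusedVariables false

noncomputable section

open scoped NumberField
open Literature.NumberTheory.EllipticCurves Literature.NumberTheory.GaloisRepresentations
open Literature.NumberTheory.GaloisRepresentations.Serre1972
open WeierstrassCurve Field NumberField IsDedekindDomain Matrix

namespace Summit.ABC.ABC.Cruxes.FreyModularity.StubSwitchK1G10

/-! ## §0 Small algebra -/

/-- `(ℤ/3)ˣ` has exponent `2` (PROVED, `decide`; k2-g8 verbatim). -/
theorem units_zmod3_mul_self (x : (ZMod 3)ˣ) : x * x = 1 := by
  revert x; decide

theorem units_zmod3_cases (u : (ZMod 3)ˣ) : u = 1 ∨ u = -1 := by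
  revert u; decide

theorem units_zmod3_neg_one_ne_one : (-1 : (ZMod 3)ˣ) ≠ 1 := by decide

/-- The sign embedding `(ℤ/3)ˣ = {±1} ↪ ℂˣ` (used to read a `(ℤ/3)ˣ`-valued Galois character as a
Dirichlet character through the tree's dictionary). -/
def unitsSign : (ZMod 3)ˣ →* ℂˣ where
  toFun u := if u = 1 then 1 else -1
  map_one' := if_pos rfl
  map_mul' u v := by
    rcases units_zmod3_cases u with rfl | rfl <;> rcases units_zmod3_cases v with rfl | rfl
    · rw [one_mul, if_pos rfl, one_mul]
    · rw [one_mul, if_neg units_zmod3_neg_one_ne_one, if_pos rfl, one_mul]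
    · rw [mul_one, if_neg units_zmod3_neg_one_ne_one, if_pos rfl, mul_one]
    · rw [units_zmod3_mul_self, if_pos rfl, if_neg units_zmod3_neg_one_ne_one, neg_mul_neg, one_mul]

theorem unitsSign_apply (u : (ZMod 3)ˣ) : unitsSign u = if u = 1 then 1 else -1 := rfl

theorem unitsSign_eq_one_iff (u : (ZMod 3)ˣ) : unitsSign u = 1 ↔ u = 1 := by
  rcases units_zmod3_cases u with rfl | rfl
  · exact ⟨fun _ ↦ rfl, fun _ ↦ map_one _⟩
  · refine ⟨fun h ↦ ?_, fun h ↦ absurd h units_zmod3_neg_one_ne_one⟩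
    rw [unitsSign_apply, if_neg units_zmod3_neg_one_ne_one] at h
    have h' := congrArg Units.val h
    rw [Units.val_neg, Units.val_one] at h'
    norm_num at h'

theorem unitsSign_injective : Function.Injective unitsSign :=
  (injective_iff_map_eq_one unitsSign).mpr fun u hu ↦ (unitsSign_eq_one_iff u).mp hu

/-- `c • x = c.val • x` for `c : ℤ/n`. -/
theorem zmod_smul_eq_val_nsmul {n : ℕ} [NeZero n] {M : Type*} [AddCommGroup M] [Module (ZMod n) M]
    (c : ZMod n) (x : M) : c • x = c.val • x := by
  have h := Nat.cast_smul_eq_nsmul (ZMod n) c.val x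
  rwa [ZMod.natCast_zmod_val] at h

/-- `(1 + D)^n = 1 + nD` when `D² = 0`. -/
theorem one_add_pow_of_mul_self_eq_zero {R : Type*} [CommRing R] (D : R) (hD : D * D = 0) (n : ℕ) :
    (1 + D) ^ n = 1 + (n : R) * D := by
  induction n with
  | zero => simp
  | succ n ih =>
    rw [pow_succ, ih, Nat.cast_succ]
    have : (1 + (n : R) * D) * (1 + D) = 1 + ((n : R) + 1) * D + (n : R) * (D * D) := by ring
    rw [this, hD, mul_zero, add_zero]

/-- coprimality plumbing (PROVED): a place containing the prime `p` contains no `n` prime to `p`. -/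
theorem helper_natCast_not_mem_of_coprime {p n : ℕ} (hcop : Nat.Coprime p n)
    {v : HeightOneSpectrum (𝓞 ℚ)} (hv : (p : 𝓞 ℚ) ∈ v.asIdeal) : (n : 𝓞 ℚ) ∉ v.asIdeal := by
  intro hn
  obtain ⟨a, b, hab⟩ := Nat.isCoprime_iff_coprime.mpr hcop
  have hab' : (a : 𝓞 ℚ) * (p : 𝓞 ℚ) + (b : 𝓞 ℚ) * (n : 𝓞 ℚ) = 1 := by
    have h := congrArg (Int.cast : ℤ → 𝓞 ℚ) hab
    simpa using h
  apply v.isPrime.ne_top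
  rw [Ideal.eq_top_iff_one, ← hab']
  exact v.asIdeal.add_mem (v.asIdeal.mul_mem_left _ hv) (v.asIdeal.mul_mem_left _ hn)

/-- k2-g8 `helper_three_not_mem` (PROVED; special case). -/
theorem helper_three_not_mem {q : ℕ} (hq : q.Prime) (hq3 : q ≠ 3) {v : HeightOneSpectrum (𝓞 ℚ)}
    (hv : (q : 𝓞 ℚ) ∈ v.asIdeal) : ((3 : ℕ) : 𝓞 ℚ) ∉ v.asIdeal :=
  helper_natCast_not_mem_of_coprime ((Nat.coprime_primes hq Nat.prime_three).mpr hq3) hv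

/-! ## §1 Piece B helpers B2, B3 (k2-g8 signatures VERBATIM) — PROVED -/

/-- **B2 (PROVED): equal actions on `W[n]` ⇒ equal on `W[d]` for `d ∣ n`** (`W[d] ≤ W[n]`,
Mathlib `Submodule.torsionBy_le_torsionBy_of_dvd`). -/
theorem helper_smul_eq_of_dvd (W : WeierstrassCurve ℚ) {d n : ℤ} (hdn : d ∣ n)
    {φ σ : absoluteGaloisGroup ℚ} (h : ∀ P : W.geomTorsion n, φ • P = σ • P)
    (P : W.geomTorsion d) : φ • P = σ • P := by
  have hmem : (P : geomPoints W) ∈ W.geomTorsion n :=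
    Submodule.torsionBy_le_torsionBy_of_dvd d n hdn P.2
  have h' := congrArg (Subtype.val : W.geomTorsion n → geomPoints W) (h ⟨P, hmem⟩)
  rw [AddSubgroup.torsionBy.coe_smul, AddSubgroup.torsionBy.coe_smul] at h'
  apply Subtype.ext
  rw [AddSubgroup.torsionBy.coe_smul, AddSubgroup.torsionBy.coe_smul]
  exact h'

/-- **B3 (PROVED): equal actions on `W[n]` ⇒ equal `χ̄_n`** (`det ρ̄_{W,n} = χ̄_n` by the Weil pairing:
tree `det_eq_modNCyclotomicCharacter`, one frame `nonempty_geomTorsion_addEquiv_fin_two` for both). -/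
theorem helper_cyclotomic_eq_of_smul_eq (W : WeierstrassCurve ℚ) [W.IsElliptic] {n : ℕ} [NeZero n]
    (hn : 2 ≤ n) {φ σ : absoluteGaloisGroup ℚ} (h : ∀ P : W.geomTorsion n, φ • P = σ • P) :
    modNCyclotomicCharacter ℚ n φ = modNCyclotomicCharacter ℚ n σ := by
  obtain ⟨e⟩ := nonempty_geomTorsion_addEquiv_fin_two W (m := n) (NeZero.ne (n : ℚ))
  obtain ⟨f, hf⟩ : ∃ f : (Fin 2 → ZMod n) →+ (Fin 2 → ZMod n), ∀ x, f x = e (φ • e.symm x) :=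
    ⟨e.toAddMonoidHom.comp ((DistribMulAction.toAddMonoidHom (W.geomTorsion n) φ).comp
      e.symm.toAddMonoidHom), fun x ↦ rfl⟩
  have hMφ : ∀ P : W.geomTorsion n,
      e (φ • P) = (LinearMap.toMatrix' (f.toZModLinearMap n)).mulVec (e P) := fun P ↦ by
    rw [LinearMap.toMatrix'_mulVec, AddMonoidHom.coe_toZModLinearMap, hf, AddEquiv.symm_apply_apply]
  have hMσ : ∀ P : W.geomTorsion n,
      e (σ • P) = (LinearMap.toMatrix' (f.toZModLinearMap n)).mulVec (e P) := fun P ↦ by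
    rw [← h P]; exact hMφ P
  have h1 := det_eq_modNCyclotomicCharacter W n hn e φ _ hMφ
  have h2 := det_eq_modNCyclotomicCharacter W n hn e σ _ hMσ
  exact Units.ext (h1.symm.trans h2)

/-- **R4e (PROVED; = Mathlib `dvd_sub_pow_of_dvd_sub`): `a ≡ 1 (mod p)` ⇒ `a^{p^k} ≡ 1 (mod p^{k+1})`.** -/
theorem helper_pow_prime_pow_congr_one {p : ℕ} (hp : p.Prime) (k : ℕ) {a : ℤ}
    (ha : a ≡ 1 [ZMOD p]) : a ^ p ^ k ≡ 1 [ZMOD (p : ℤ) ^ (k + 1)] := by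
  have h := dvd_sub_pow_of_dvd_sub (Int.ModEq.dvd ha.symm) k
  rw [one_pow] at h
  exact (Int.modEq_iff_dvd.mpr h).symm

/-! ## §2 Piece C: the R-block (k2-g8 signatures VERBATIM) — PROVED -/

/-- **FIN2 (PROVED): `(φ+1)² = 0` on `E[3]` ⇒ `φ = −1` on every `φ`-stable line.** -/
theorem helper_neg_on_line_of_add_one_sq (E : WeierstrassCurve ℚ) [E.IsElliptic]
    {φ : absoluteGaloisGroup ℚ} (hφ : ∀ Q : E.geomTorsion 3, φ • (φ • Q + Q) + (φ • Q + Q) = 0)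
    {P : E.geomTorsion 3} (hP0 : P ≠ 0) (hst : φ • P ∈ AddSubgroup.zmultiples P) :
    φ • P = -P := by
  haveI : Fact (Nat.Prime 3) := ⟨Nat.prime_three⟩
  letI : Module (ZMod 3) (E.geomTorsion 3) := AddSubgroup.torsionBy.zmodModule (n := 3)
  obtain ⟨k, hk⟩ := AddSubgroup.mem_zmultiples_iff.mp hst
  have haP : φ • P = ((k : ZMod 3)) • P := by rw [← hk, Int.cast_smul_eq_zsmul]
  have hlin : ∀ (c : ZMod 3) (S : E.geomTorsion 3), φ • (c • S) = c • (φ • S) := fun c S ↦ by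
    rw [← ZMod.natCast_zmod_val c, Nat.cast_smul_eq_nsmul, Nat.cast_smul_eq_nsmul]
    exact map_nsmul (DistribMulAction.toAddMonoidHom (E.geomTorsion 3) φ) c.val S
  have h1 : φ • P + P = ((k : ZMod 3) + 1) • P := by rw [haP, add_smul, one_smul]
  have h2 : (((k : ZMod 3) + 1) * ((k : ZMod 3) + 1)) • P = 0 := by
    have h := hφ P
    rw [h1, hlin, haP, smul_smul, ← add_smul] at h
    have : ((k : ZMod 3) + 1) * (k : ZMod 3) + ((k : ZMod 3) + 1) =
        ((k : ZMod 3) + 1) * ((k : ZMod 3) + 1) := by ring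
    rwa [this] at h
  have hinj := smul_left_injective (ZMod 3) hP0
  have h3 : ((k : ZMod 3) + 1) * ((k : ZMod 3) + 1) = 0 :=
    hinj (show (((k : ZMod 3) + 1) * ((k : ZMod 3) + 1)) • P = (0 : ZMod 3) • P by
      rw [zero_smul]; exact h2)
  have h4 : (k : ZMod 3) = -1 := eq_neg_of_add_eq_zero_left (mul_self_eq_zero.mp h3)
  rw [haP, h4, neg_one_smul]

/-- **R1 (PROVED): reducible ⇒ a `Γ_ℚ`-stable line** (tree
`exists_isogenyCharacter_of_not_hasIrreducibleModPGaloisRep`, Mazur 1978 §5). -/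
theorem helper_stable_line_of_not_irreducible (E : WeierstrassCurve ℚ) [E.IsElliptic]
    (h : ¬ E.HasIrreducibleModPGaloisRep 3) :
    ∃ P : E.geomTorsion 3, P ≠ 0 ∧
      ∀ σ : absoluteGaloisGroup ℚ, σ • P ∈ AddSubgroup.zmultiples P := by
  haveI : Fact (Nat.Prime 3) := ⟨Nat.prime_three⟩
  haveI : NeZero ((3 : ℕ) : ℚ) := ⟨by norm_num⟩
  obtain ⟨P, r, hP0, hr⟩ := exists_isogenyCharacter_of_not_hasIrreducibleModPGaloisRep E 3 h
  refine ⟨P, hP0, fun σ ↦ ?_⟩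
  rw [hr σ]
  exact AddSubgroup.nsmul_mem _ (AddSubgroup.mem_zmultiples P) _

/-- **R3 (PROVED): the character of a stable line, with open kernel** (tree
`Mazur1978.exists_isogenyCharacter`, `Mazur1978.isOpen_ker_of_smul_eq`). -/
theorem helper_lineChar (E : WeierstrassCurve ℚ) [E.IsElliptic] {P : E.geomTorsion 3} (hP0 : P ≠ 0)
    (hst : ∀ σ : absoluteGaloisGroup ℚ, σ • P ∈ AddSubgroup.zmultiples P) :
    ∃ r : absoluteGaloisGroup ℚ →* (ZMod 3)ˣ,
      IsOpen ((r.ker : Subgroup (absoluteGaloisGroup ℚ)) : Set (absoluteGaloisGroup ℚ)) ∧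
      ∀ σ : absoluteGaloisGroup ℚ, σ • P = ((r σ : (ZMod 3)ˣ) : ZMod 3).val • P := by
  haveI : Fact (Nat.Prime 3) := ⟨Nat.prime_three⟩
  obtain ⟨r, hr⟩ := Mazur1978.exists_isogenyCharacter E 3 hP0 hst
  exact ⟨r, Mazur1978.isOpen_ker_of_smul_eq E 3 hP0 hr, hr⟩

/-- **Rneg (PROVED): a line character takes the value `−1` at `φ` when `φ • P = −P`.** -/
theorem helper_character_neg_one (E : WeierstrassCurve ℚ) [E.IsElliptic]
    {P : E.geomTorsion 3} (hP0 : P ≠ 0) {r : absoluteGaloisGroup ℚ →* (ZMod 3)ˣ}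
    (hr : ∀ σ : absoluteGaloisGroup ℚ, σ • P = ((r σ : (ZMod 3)ˣ) : ZMod 3).val • P)
    {φ : absoluteGaloisGroup ℚ} (hφ : φ • P = -P) : r φ = -1 := by
  haveI : Fact (Nat.Prime 3) := ⟨Nat.prime_three⟩
  letI : Module (ZMod 3) (E.geomTorsion 3) := AddSubgroup.torsionBy.zmodModule (n := 3)
  have hinj := smul_left_injective (ZMod 3) hP0
  have h1 : ((r φ : (ZMod 3)ˣ) : ZMod 3) • P = ((-1 : (ZMod 3)ˣ) : ZMod 3) • P := by
    rw [zmod_smul_eq_val_nsmul, ← hr φ, hφ, Units.val_neg, Units.val_one, neg_one_smul]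
  exact Units.ext (hinj h1)

/-- **R2 (PROVED): a line character is unramified at every semistable `w ∤ 3`.**  Good reduction:
`Mazur1978.isogenyCharacter_eq_one_of_mem_inertia`; multiplicative: inertia acts unipotently on `E[3]`
(`smul_smul_sub_eq_of_mem_inertia_geomPoints`), so its eigenvalue on the line is `1`
(`Mazur1978.intCast_eq_one_of_unipotent`) — the body of the tree's
`isogenyCharacter_eq_one_of_mem_inertia_of_isSemistable`, localised to one place. -/
theorem helper_lineChar_unramified (E : WeierstrassCurve ℚ) [E.IsElliptic] {P : E.geomTorsion 3}
    (hP0 : P ≠ 0) {r : absoluteGaloisGroup ℚ →* (ZMod 3)ˣ}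
    (hr : ∀ σ : absoluteGaloisGroup ℚ, σ • P = ((r σ : (ZMod 3)ˣ) : ZMod 3).val • P)
    {w : HeightOneSpectrum (𝓞 ℚ)} (h3w : ((3 : ℕ) : 𝓞 ℚ) ∉ w.asIdeal) (hw : E.IsSemistableAt w)
    {𝔓 : Ideal (absIntegers (𝓞 ℚ) ℚ)} (h𝔓 : 𝔓 ∈ w.primesAbove)
    {σ : absoluteGaloisGroup ℚ} (hσ : σ ∈ 𝔓.inertia (absoluteGaloisGroup ℚ)) : r σ = 1 := by
  haveI : Fact (Nat.Prime 3) := ⟨Nat.prime_three⟩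
  rcases hw with hgood | hmult
  · exact Mazur1978.isogenyCharacter_eq_one_of_mem_inertia E 3 hP0 hr hgood h3w h𝔓 hσ
  · have hP0' : (P : geomPoints E) ≠ 0 := fun h ↦ hP0 (Subtype.ext h)
    have h3P : (3 : ℤ) • (P : geomPoints E) = 0 := (Submodule.mem_torsionBy_iff _ _).mp P.2
    have hpP : (3 : ℕ) • (P : geomPoints E) = 0 := by rw [← natCast_zsmul]; exact h3P
    have hpP' : 3 ^ 1 • (P : geomPoints E) = 0 := by rwa [pow_one]
    have hunip :=
      E.smul_smul_sub_eq_of_mem_inertia_geomPoints hmult Nat.prime_three h3w le_rfl h𝔓 hσ hpP'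
    have hs : DistribSMul.toAddMonoidHom (geomPoints E) σ (P : geomPoints E) =
        ((((r σ : (ZMod 3)ˣ) : ZMod 3).val : ℤ)) • (P : geomPoints E) := by
      rw [DistribSMul.toAddMonoidHom_apply, natCast_zsmul]
      have := congrArg (Subtype.val : E.geomTorsion 3 → geomPoints E) (hr σ)
      simpa only [AddSubgroup.torsionBy.coe_smul, AddSubmonoidClass.coe_nsmul] using this
    have h1 := Mazur1978.intCast_eq_one_of_unipotent Nat.prime_three hP0' hpP
      (DistribSMul.toAddMonoidHom (geomPoints E) σ) hs
      (by simpa only [DistribSMul.toAddMonoidHom_apply] using hunip)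
    rw [Int.cast_natCast, ZMod.natCast_zmod_val] at h1
    exact Units.ext h1

/-- **R5 (PROVED): irreducible and `3 ∣ #ρ̄_{E,3}(Γ_ℚ)` ⇒ onto `GL₂(𝔽₃)`** — Serre 1972 Prop. 15 read
backwards (`Serre1972.not_dvd_natCard_of_forall_not_le_eigenvectorStabilizer`) in the frame
`exists_frame_galoisRepTorsion_rat` (`det = χ̄₃` onto: `exists_mem_map_range_det_eq`; no Borel:
`not_le_eigenvectorStabilizer_of_hasIrreducibleModPGaloisRep`). -/
theorem helper_surjective_three_of_irreducible_of_three_dvd (E : WeierstrassCurve ℚ) [E.IsElliptic]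
    (hirr : E.HasIrreducibleModPGaloisRep 3)
    (h3 : 3 ∣ Nat.card (galoisRepTorsion E ((3 : ℕ) : ℤ)).range) :
    E.HasSurjectiveModNGaloisRep ((3 : ℕ) : ℤ) := by
  haveI : Fact (Nat.Prime 3) := ⟨Nat.prime_three⟩
  by_contra hns
  obtain ⟨e, Φ, he, -, -, -, -⟩ := exists_frame_galoisRepTorsion_rat E 3
  set G : Subgroup (GL (Fin 2) (ZMod 3)) := (galoisRepTorsion E 3).range.map Φ.toMonoidHom with hG
  have hGtop : G ≠ ⊤ := fun h ↦ hns ((map_range_galoisRepTorsion_eq_top_iff E 3 Φ).mp h)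
  have hdetG : ∀ u : (ZMod 3)ˣ, ∃ g ∈ G, Matrix.GeneralLinearGroup.det g = u :=
    exists_mem_map_range_det_eq E 3 Φ e he
  have hirrG : ∀ (v : Fin 2 → ZMod 3) (hv : v ≠ 0), ¬ G ≤ eigenvectorStabilizer v hv :=
    fun v hv ↦ not_le_eigenvectorStabilizer_of_hasIrreducibleModPGaloisRep E 3 Φ e he hirr hv
  have hcard : Nat.card G = Nat.card (galoisRepTorsion E ((3 : ℕ) : ℤ)).range :=
    Subgroup.card_map_of_injective Φ.injective
  exact not_dvd_natCard_of_forall_not_le_eigenvectorStabilizer G hdetG hGtop hirrG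
    (by rw [hcard]; exact h3)

/-! ## §3 R4 RE-PLANNED: the Dirichlet dictionary + LEMMA Q -/

/-- **Kernel of `(ℤ/N)ˣ → (ℤ/d)ˣ`**: its elements are `1 + d·q`. -/
theorem helper_ker_unitsMap_coe {N d : ℕ} [NeZero N] (hdN : d ∣ N) (hd1 : 1 < d) {u : (ZMod N)ˣ}
    (hu : ZMod.unitsMap hdN u = 1) :
    ∃ q : ℕ, (u : ZMod N) = 1 + (d : ZMod N) * (q : ZMod N) := by
  haveI : NeZero d := ⟨by omega⟩
  obtain ⟨a, ha⟩ : ∃ a : ℕ, (u : ZMod N) = a := ⟨(u : ZMod N).val, (ZMod.natCast_zmod_val _).symm⟩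
  have h1 : (ZMod.castHom hdN (ZMod d)) (u : ZMod N) = 1 := by
    have := congrArg Units.val hu
    rwa [ZMod.unitsMap_def, Units.coe_map, MonoidHom.coe_coe, Units.val_one] at this
  rw [ha, map_natCast] at h1
  have h3 : a % d = 1 := by
    have := (ZMod.natCast_eq_natCast_iff' a 1 d).mp (by rw [Nat.cast_one]; exact h1)
    rw [this]; exact Nat.mod_eq_of_lt hd1
  refine ⟨a / d, ?_⟩
  rw [ha]
  conv_lhs => rw [← Nat.div_add_mod a d, h3]
  push_cast
  ring

/-- **LEMMA Q, odd part (PROVED): a primitive quadratic Dirichlet character has level prime to `p²`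
for every odd prime `p`.**  (`d = N/p`; `ker((ℤ/N)ˣ → (ℤ/d)ˣ) = {1 + dq}` has exponent `p` because
`p ∣ d`; a value that is both a square root and a `p`-th root of `1` is `1`; so `χ` factors through
`d < N`.) -/
theorem helper_quadConductor_odd {N : ℕ} [NeZero N] (χ : DirichletCharacter ℂ N)
    (hχ : χ.IsPrimitive) (h2 : ∀ a : (ZMod N)ˣ, χ (a : ZMod N) ^ 2 = 1) {p : ℕ} (hp : p.Prime)
    (hp2 : p ≠ 2) : ¬ p ^ 2 ∣ N := by
  rintro ⟨e, he⟩
  obtain ⟨d, hd⟩ : ∃ d, d = p * e := ⟨_, rfl⟩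
  have hNd : N = p * d := by rw [he, hd, pow_two, mul_assoc]
  have hdN : d ∣ N := ⟨p, by rw [hNd, mul_comm]⟩
  have he0 : 0 < e := Nat.pos_of_ne_zero (by rintro rfl; exact NeZero.ne N (by rw [he, mul_zero]))
  have hd0 : 0 < d := by rw [hd]; exact Nat.mul_pos hp.pos he0
  have hd1 : 1 < d := by
    rw [hd]; exact lt_of_lt_of_le hp.one_lt (Nat.le_mul_of_pos_right p he0)
  have hdlt : d < N := by rw [hNd]; nlinarith [hp.one_lt, hd0]
  have hdd : (d : ZMod N) * (d : ZMod N) = 0 := by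
    rw [← Nat.cast_mul, CharP.cast_eq_zero_iff (ZMod N) N]
    exact ⟨e, by rw [hNd, hd]; ring⟩
  have hpd : (p : ZMod N) * (d : ZMod N) = 0 := by
    rw [← Nat.cast_mul, ← hNd, ZMod.natCast_self]
  have hfac : χ.FactorsThrough d := by
    rw [DirichletCharacter.factorsThrough_iff_ker_unitsMap hdN]
    intro u hu
    rw [MonoidHom.mem_ker] at hu ⊢
    obtain ⟨q, hq⟩ := helper_ker_unitsMap_coe hdN hd1 hu
    have hD : (d : ZMod N) * (q : ZMod N) * ((d : ZMod N) * (q : ZMod N)) = 0 := by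
      have : (d : ZMod N) * (q : ZMod N) * ((d : ZMod N) * (q : ZMod N)) =
          (d : ZMod N) * (d : ZMod N) * ((q : ZMod N) * q) := by ring
      rw [this, hdd, zero_mul]
    have hup : u ^ p = 1 := by
      apply Units.ext
      rw [Units.val_pow_eq_pow_val, Units.val_one, hq,
        one_add_pow_of_mul_self_eq_zero _ hD p, ← mul_assoc, hpd, zero_mul, add_zero]
    have hu2 : χ.toUnitHom u ^ 2 = 1 := by
      apply Units.ext
      rw [Units.val_pow_eq_pow_val, MulChar.coe_toUnitHom, Units.val_one]
      exact h2 u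
    have hupχ : χ.toUnitHom u ^ p = 1 := by rw [← map_pow, hup, map_one]
    have hg := pow_gcd_eq_one.mpr ⟨hupχ, hu2⟩
    have hg1 : p.gcd 2 = 1 := (Nat.coprime_primes hp Nat.prime_two).mpr hp2
    rwa [hg1, pow_one] at hg
  have hcond := DirichletCharacter.conductor_dvd_of_mem_conductorSet χ hfac
  rw [hχ] at hcond
  exact absurd (Nat.le_of_dvd hd0 hcond) (not_le.mpr hdlt)

/-- **LEMMA Q, even part (PROVED): a primitive quadratic Dirichlet character has level prime to `16`.**
(`N = 16e`, `d = 8e`: the kernel `{1, 1 + d}` of `(ℤ/N)ˣ → (ℤ/d)ˣ` consists of squares, since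
`1 + d = (1 + 4e)²` and `(1 + 4e)(1 − 4e) = 1` in `ℤ/N`.) -/
theorem helper_quadConductor_two {N : ℕ} [NeZero N] (χ : DirichletCharacter ℂ N)
    (hχ : χ.IsPrimitive) (h2 : ∀ a : (ZMod N)ˣ, χ (a : ZMod N) ^ 2 = 1) : ¬ 16 ∣ N := by
  rintro ⟨e, he⟩
  have hNd : N = 2 * (8 * e) := by rw [he]; ring
  have hdN : 8 * e ∣ N := ⟨2, by rw [hNd, mul_comm]⟩
  have he0 : 0 < e := Nat.pos_of_ne_zero (by rintro rfl; exact NeZero.ne N (by rw [he, mul_zero]))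
  have hd0 : 0 < 8 * e := by omega
  have hd1 : 1 < 8 * e := by omega
  have hdlt : 8 * e < N := by rw [hNd]; omega
  have h16 : (16 : ZMod N) * (e : ZMod N) = 0 := by
    have h : ((16 * e : ℕ) : ZMod N) = 0 := by rw [← he]; exact ZMod.natCast_self N
    push_cast at h
    exact h
  have hw1 : (1 + 4 * (e : ZMod N)) * (1 - 4 * (e : ZMod N)) = 1 := by
    have : (1 + 4 * (e : ZMod N)) * (1 - 4 * (e : ZMod N)) =
        1 - (e : ZMod N) * (16 * (e : ZMod N)) := by ring
    rw [this, h16, mul_zero, sub_zero]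
  have hw2 : (1 - 4 * (e : ZMod N)) * (1 + 4 * (e : ZMod N)) = 1 := by rw [mul_comm]; exact hw1
  obtain ⟨w, hw⟩ : ∃ w : (ZMod N)ˣ, (w : ZMod N) = 1 + 4 * (e : ZMod N) :=
    ⟨⟨1 + 4 * (e : ZMod N), 1 - 4 * (e : ZMod N), hw1, hw2⟩, rfl⟩
  have hwsq : ((w ^ 2 : (ZMod N)ˣ) : ZMod N) = 1 + 8 * (e : ZMod N) := by
    rw [Units.val_pow_eq_pow_val, hw]
    have : (1 + 4 * (e : ZMod N)) ^ 2 = 1 + 8 * (e : ZMod N) + (e : ZMod N) * (16 * (e : ZMod N)) := by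
      ring
    rw [this, h16, mul_zero, add_zero]
  have hfac : χ.FactorsThrough (8 * e) := by
    rw [DirichletCharacter.factorsThrough_iff_ker_unitsMap hdN]
    intro u hu
    rw [MonoidHom.mem_ker] at hu ⊢
    obtain ⟨q, hq⟩ := helper_ker_unitsMap_coe hdN hd1 hu
    rcases Nat.even_or_odd q with ⟨r, hr⟩ | ⟨r, hr⟩
    · have hu1 : u = 1 := by
        apply Units.ext
        rw [hq, hr, Units.val_one]
        have : ((8 * e : ℕ) : ZMod N) * ((r + r : ℕ) : ZMod N) =
            (r : ZMod N) * (16 * (e : ZMod N)) := by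
          push_cast; ring
        rw [this, h16, mul_zero, add_zero]
      rw [hu1, map_one]
    · have huw : u = w ^ 2 := by
        apply Units.ext
        rw [hwsq, hq, hr]
        have : ((8 * e : ℕ) : ZMod N) * ((2 * r + 1 : ℕ) : ZMod N) =
            (r : ZMod N) * (16 * (e : ZMod N)) + 8 * (e : ZMod N) := by
          push_cast; ring
        rw [this, h16, mul_zero, zero_add]
      rw [huw, map_pow]
      apply Units.ext
      rw [Units.val_pow_eq_pow_val, MulChar.coe_toUnitHom, Units.val_one]
      exact h2 w
  have hcond := DirichletCharacter.conductor_dvd_of_mem_conductorSet χ hfac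
  rw [hχ] at hcond
  exact absurd (Nat.le_of_dvd hd0 hcond) (not_le.mpr hdlt)

/-- **Local-to-global divisibility (PROVED)**: `N ∣ M` as soon as every prime of `N` divides `M`,
`N` is odd-squarefree with `16 ∤ N`, and `8 ∣ M`. -/
theorem helper_dvd_of_local {N M : ℕ} (h8 : 8 ∣ M)
    (hpr : ∀ p : ℕ, p.Prime → p ∣ N → p ∣ M)
    (hodd : ∀ p : ℕ, p.Prime → p ≠ 2 → ¬ p ^ 2 ∣ N) (h16 : ¬ 16 ∣ N) : N ∣ M := by
  rw [Nat.dvd_iff_prime_pow_dvd_dvd]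
  intro p k hp hpk
  rcases k with _ | k
  · rw [pow_zero]; exact one_dvd M
  by_cases hp2 : p = 2
  · subst hp2
    have hk : k + 1 ≤ 3 := by
      by_contra hk
      have h4 : 2 ^ 4 ∣ 2 ^ (k + 1) := pow_dvd_pow 2 (by omega)
      exact h16 (by have := h4.trans hpk; norm_num at this; exact this)
    have h8' : 2 ^ 3 ∣ M := by norm_num; exact h8
    exact (pow_dvd_pow 2 hk).trans h8'
  · have hk : k = 0 := by
      by_contra hk
      have hsq : p ^ 2 ∣ p ^ (k + 1) := pow_dvd_pow p (by omega)
      exact hodd p hp hp2 (hsq.trans hpk)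
    subst hk
    rw [zero_add, pow_one] at hpk ⊢
    exact hpr p hp hpk

/-- **R4 (PROVED; k2-g8 signature VERBATIM): a character `Γ_ℚ → (ℤ/3)ˣ` with open kernel, unramified
at every `w ∤ m` (`8 ∣ m`), takes equal values on elements with equal `χ̄_m`.**  Proof: read `ψ` in `ℂˣ`
(`unitsSign`), take the primitive Dirichlet character `χ` of level `N` with `ψ = χ ∘ χ̄_N`
(`exists_isPrimitive_dirichletCharacter_eq_dirichletGaloisCharacter`, Kronecker–Weber inside); every
prime `p ∣ N` divides `m` (else `ψ` is unramified at `p` and `not_dvd_level_of_isPrimitive_of_forall_mem_inertia`);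
`χ² = 1` (`χ̄_N` onto), so LEMMA Q bounds the exponents and `N ∣ m` (`helper_dvd_of_local`); finally
`χ̄_m(σ) = χ̄_m(σ') ⇒ χ̄_N(σ) = χ̄_N(σ')` (`unitsMap_modNCyclotomicCharacter`). -/
theorem helper_char_eq_of_cyclotomic_eq {m : ℕ} [NeZero m] (h8 : 8 ∣ m)
    (ψ : absoluteGaloisGroup ℚ →* (ZMod 3)ˣ)
    (hker : IsOpen ((ψ.ker : Subgroup (absoluteGaloisGroup ℚ)) : Set (absoluteGaloisGroup ℚ)))
    (hunr : ∀ (w : HeightOneSpectrum (𝓞 ℚ)), (m : 𝓞 ℚ) ∉ w.asIdeal →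
      ∀ 𝔓 ∈ w.primesAbove, ∀ σ ∈ 𝔓.inertia (absoluteGaloisGroup ℚ), ψ σ = 1)
    {σ σ' : absoluteGaloisGroup ℚ}
    (hσ : modNCyclotomicCharacter ℚ m σ = modNCyclotomicCharacter ℚ m σ') : ψ σ = ψ σ' := by
  -- (1) `ψ` as a complex character with the same (open) kernel
  have hkerEq : (unitsSign.comp ψ).ker = ψ.ker := by
    ext τ
    rw [MonoidHom.mem_ker, MonoidHom.mem_ker, MonoidHom.comp_apply, unitsSign_eq_one_iff]
  have hkerC : IsOpen (((unitsSign.comp ψ).ker : Subgroup (absoluteGaloisGroup ℚ)) :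
      Set (absoluteGaloisGroup ℚ)) := by
    rw [hkerEq]; exact hker
  -- (2) the primitive Dirichlet character of `ψ`
  obtain ⟨N, hN, χ, hprim, hχ⟩ :=
    exists_isPrimitive_dirichletCharacter_eq_dirichletGaloisCharacter (unitsSign.comp ψ) hkerC
  haveI := hN
  -- (3) `χ` is quadratic
  have h2 : ∀ a : (ZMod N)ˣ, χ (a : ZMod N) ^ 2 = 1 := by
    intro a
    obtain ⟨τ, rfl⟩ := modNCyclotomicCharacter_rat_surjective N a
    rw [← coe_dirichletGaloisCharacter_apply, ← hχ τ, ← Units.val_pow_eq_pow_val,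
      MonoidHom.comp_apply, ← map_pow, pow_two, units_zmod3_mul_self, map_one, Units.val_one]
  -- (4) every prime of `N` divides `m`
  have hprimes : ∀ p : ℕ, p.Prime → p ∣ N → p ∣ m := by
    intro p hp hpN
    by_contra hpm
    set v : HeightOneSpectrum (𝓞 ℚ) := Rat.HeightOneSpectrum.primesEquiv.symm ⟨p, hp⟩ with hvdef
    have hgen : Rat.HeightOneSpectrum.natGenerator v = p := by
      change ((Rat.HeightOneSpectrum.primesEquiv v : Nat.Primes) : ℕ) = p
      rw [hvdef, Equiv.apply_symm_apply]
    have hv : (p : 𝓞 ℚ) ∈ v.asIdeal := by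
      have h := Mazur1978.natCast_natGenerator_mem_asIdeal v
      rwa [hgen] at h
    have hmv : (m : 𝓞 ℚ) ∉ v.asIdeal :=
      helper_natCast_not_mem_of_coprime ((Nat.Prime.coprime_iff_not_dvd hp).mpr hpm) hv
    obtain ⟨𝔓, h𝔓⟩ := v.primesAbove_nonempty
    have hψI : ∀ τ ∈ 𝔓.inertia (absoluteGaloisGroup ℚ),
        ((dirichletGaloisCharacter ℚ χ τ : ℂˣ) : ℂ) = 1 := by
      intro τ hτ
      rw [← hχ τ, MonoidHom.comp_apply, hunr v hmv 𝔓 h𝔓 τ hτ, map_one, Units.val_one]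
    exact not_dvd_level_of_isPrimitive_of_forall_mem_inertia hprim hp hv h𝔓 hψI hpN
  -- (5) `N ∣ m`
  have hNm : N ∣ m := helper_dvd_of_local h8 hprimes
    (fun p hp hp2 ↦ helper_quadConductor_odd χ hprim h2 hp hp2) (helper_quadConductor_two χ hprim h2)
  -- (6) conclude
  have hN' : modNCyclotomicCharacter ℚ N σ = modNCyclotomicCharacter ℚ N σ' := by
    rw [← unitsMap_modNCyclotomicCharacter ℚ hNm σ, ← unitsMap_modNCyclotomicCharacter ℚ hNm σ', hσ]
  have hC : (unitsSign.comp ψ) σ = (unitsSign.comp ψ) σ' := by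
    apply Units.ext
    rw [hχ σ, hχ σ', coe_dirichletGaloisCharacter_apply, coe_dirichletGaloisCharacter_apply, hN']
  rw [MonoidHom.comp_apply, MonoidHom.comp_apply] at hC
  exact unitsSign_injective hC

/-! ## §4 Piece C (k2-g8 VERBATIM) and its PROVED glue from the helpers above -/

/-- **PIECE C (k2-g8 verbatim).** -/
def SurjThreeOfCuspData : Prop :=
  ∀ (E : WeierstrassCurve ℚ) [E.IsElliptic] (M : ℕ) [NeZero M] (q : ℕ) (v : HeightOneSpectrum (𝓞 ℚ))
    (𝔓 : Ideal (absIntegers (𝓞 ℚ) ℚ)) (φ τ : absoluteGaloisGroup ℚ),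
    8 ∣ M → 3 ∣ M →
    (∀ w : HeightOneSpectrum (𝓞 ℚ), (M : 𝓞 ℚ) ∉ w.asIdeal → E.IsSemistableAt w) →
    q.Prime → ¬ q ∣ M → (q : 𝓞 ℚ) ∈ v.asIdeal → 𝔓 ∈ v.primesAbove → IsArithFrobAt (𝓞 ℚ) φ 𝔓 →
    E.HasMultiplicativeReductionAt v → E.ordMinimalDiscriminant v = 5 →
    (∀ P : E.geomTorsion 5, φ • P = -P) →
    modNCyclotomicCharacter ℚ 3 φ = 1 → modNCyclotomicCharacter ℚ 5 φ = 1 →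
    modNCyclotomicCharacter ℚ M φ = modNCyclotomicCharacter ℚ M (τ * τ) →
    E.HasSurjectiveModNGaloisRep ((3 : ℕ) : ℤ)

/-- **T2 as a `Prop` (k2-g8 `helper_frob_addOneSq_three` signature; PROVED by k1 gen 9 as
`StubSwitchK1G9.helper_frob_addOneSq_three'`):** `(Frob_q + 1)² = 0` on `E[3]`. -/
def T2Statement : Prop :=
  ∀ (E : WeierstrassCurve ℚ) [E.IsElliptic] {v : HeightOneSpectrum (𝓞 ℚ)},
    E.HasMultiplicativeReductionAt v → ∀ {𝔓 : Ideal (absIntegers (𝓞 ℚ) ℚ)}, 𝔓 ∈ v.primesAbove →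
    ∀ {φ : absoluteGaloisGroup ℚ}, IsArithFrobAt (𝓞 ℚ) φ 𝔓 →
    modNCyclotomicCharacter ℚ 3 φ = 1 → modNCyclotomicCharacter ℚ 5 φ = 1 →
    (∀ P : E.geomTorsion 5, φ • P = -P) →
    ∀ Q : E.geomTorsion 3, φ • (φ • Q + Q) + (φ • Q + Q) = 0

/-- **PIECE C from T2 alone (PROVED GLUE; k2-g8 `surjThreeOfCuspData_of_helpers` verbatim, every other
helper now a theorem of this file).** -/
theorem surjThreeOfCuspData_of (hT2 : T2Statement) : SurjThreeOfCuspData := by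
  intro E _ M _ q v 𝔓 φ τ h8 h3M hss hq hqM hv h𝔓 hφ hmult hord hneg h3 h5 hM
  have hq3 : q ≠ 3 := by rintro rfl; exact hqM h3M
  have h3v : ((3 : ℕ) : 𝓞 ℚ) ∉ v.asIdeal := helper_three_not_mem hq hq3 hv
  have hdvd : 3 ∣ Nat.card (galoisRepTorsion E ((3 : ℕ) : ℤ)).range :=
    E.dvd_card_range_galoisRepTorsion_of_hasMultiplicativeReductionAt_of_not_dvd hmult
      Nat.prime_three h3v (by rw [hord]; decide)
  refine helper_surjective_three_of_irreducible_of_three_dvd E ?_ hdvd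
  by_contra hirr
  obtain ⟨P, hP0, hst⟩ := helper_stable_line_of_not_irreducible E hirr
  obtain ⟨r, hker, hr⟩ := helper_lineChar E hP0 hst
  have hφP : φ • P = -P :=
    helper_neg_on_line_of_add_one_sq E (hT2 E hmult h𝔓 hφ h3 h5 hneg) hP0 (hst φ)
  have hr1 : r φ = -1 := helper_character_neg_one E hP0 hr hφP
  have hunr : ∀ (w : HeightOneSpectrum (𝓞 ℚ)), (M : 𝓞 ℚ) ∉ w.asIdeal →
      ∀ 𝔓' ∈ w.primesAbove, ∀ σ ∈ 𝔓'.inertia (absoluteGaloisGroup ℚ), r σ = 1 := by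
    intro w hw 𝔓' h𝔓' σ hσ
    have h3w : ((3 : ℕ) : 𝓞 ℚ) ∉ w.asIdeal := fun h => hw (by
      obtain ⟨k, hk⟩ := h3M
      rw [hk, Nat.cast_mul]
      exact Ideal.mul_mem_right _ _ h)
    exact helper_lineChar_unramified E hP0 hr h3w (hss w hw) h𝔓' hσ
  have heq : r φ = r (τ * τ) := helper_char_eq_of_cyclotomic_eq h8 r hker hunr hM
  rw [map_mul, units_zmod3_mul_self] at heq
  rw [heq] at hr1
  exact absurd hr1 (by decide)

/-! ## §5 T2 DISCHARGED — k1 GEN 9 §1–§2 VERBATIM (`STUB_IDEAS_stub_switch_1g9_Sketch.lean`, lines 108–388,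
sorry-free there and here; copied, not imported, per the crux-workfile convention), then PIECE C CLOSED. -/

section K1G9Verbatim

open scoped Classical Pointwise

/-! ### (k1-g9 §1)  The eigenline re-cut of the Tate block (helpers E1–E7)

Notation: `K_v = v.adicCompletion K`, `K̄_v = AlgebraicClosure K_v`, `Ψ : K̄_vˣ → E(K̄_v)` a TWISTED Tate
parametrisation with kernel `q^ℤ` and sign `ε : Γ_{K_v} → {±1}` (`σ • Ψ(u) = ε σ • Ψ(σ u)`), as delivered by
`TateCurve.exists_twistedTateUniformisation_tateJ` with `ε σ = if σ t = t then 1 else -1`. -/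

section Local

variable {K : Type} [Field K] [NumberField K] (W : WeierstrassCurve K) (v : HeightOneSpectrum (𝓞 K))

/-- **E1 (PROVED here; pure import) — the Tate EIGENPOINT.** For a root of unity `u ∈ K̄_vˣ` of prime
order `p`, `L := Ψ(u)` is a non-zero `p`-torsion point, and every `σ ∈ Γ_{K_v}` FIXING `u` acts on `L`
by the sign `ε σ`.  (`map_ofMul_ne_zero_of_pow_eq_one`, `zsmul_map_ofMul_eq_zero_of_pow_eq_one`, `htw`.)
Replaces the "shape on ALL `p₁p₂`-torsion" of k2-g8 T1: only the eigenpoint is needed downstream. -/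
theorem helper_tate_eigenpoint_local {q : v.adicCompletion K} (hq0 : q ≠ 0) (hq1 : Valued.v q < 1)
    (Ψ : Additive (AlgebraicClosure (v.adicCompletion K))ˣ →+ localPoints W (v.adicCompletion K))
    (hker : ∀ u : (AlgebraicClosure (v.adicCompletion K))ˣ, Ψ (Additive.ofMul u) = 0 ↔
      ∃ n : ℤ, (u : AlgebraicClosure (v.adicCompletion K)) =
        algebraMap (v.adicCompletion K) (AlgebraicClosure (v.adicCompletion K)) q ^ n)
    (ε : absoluteGaloisGroup (v.adicCompletion K) → ℤ)
    (htw : ∀ (σ : absoluteGaloisGroup (v.adicCompletion K))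
        (u : (AlgebraicClosure (v.adicCompletion K))ˣ),
      σ • Ψ (Additive.ofMul u) = ε σ • Ψ (Additive.ofMul (Units.map
        (Field.absoluteGaloisGroup.toAlgEquiv (v.adicCompletion K) σ :
          AlgebraicClosure (v.adicCompletion K) →* AlgebraicClosure (v.adicCompletion K)) u)))
    {p : ℕ} [Fact p.Prime] {u : (AlgebraicClosure (v.adicCompletion K))ˣ} (hup : u ^ p = 1)
    (hu1 : u ≠ 1) :
    Ψ (Additive.ofMul u) ≠ 0 ∧ (p : ℤ) • Ψ (Additive.ofMul u) = 0 ∧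
      ∀ σ : absoluteGaloisGroup (v.adicCompletion K),
        Field.absoluteGaloisGroup.toAlgEquiv (v.adicCompletion K) σ u = u →
          σ • Ψ (Additive.ofMul u) = ε σ • Ψ (Additive.ofMul u) := by
  refine ⟨map_ofMul_ne_zero_of_pow_eq_one (W := W) (v := v) hq0 hq1 Ψ hker hup hu1,
    zsmul_map_ofMul_eq_zero_of_pow_eq_one (W := W) (v := v) Ψ hup, fun σ hσ ↦ ?_⟩
  have hfix : Units.map (Field.absoluteGaloisGroup.toAlgEquiv (v.adicCompletion K) σ :
      AlgebraicClosure (v.adicCompletion K) →* AlgebraicClosure (v.adicCompletion K)) u = u :=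
    Units.ext (by simpa using hσ)
  simpa only [hfix] using htw σ u

/-- **E1′ (PROVED here) — roots of unity of `K̄` give the units `u` of E1**, fixed by every
`σ ∈ Γ_{K_v}` whose restriction fixes them in `K̄` (IMPORT 6). -/
theorem helper_unit_of_closureEmb {p : ℕ} (hp : p.Prime) {ζ : AlgebraicClosure K} (hζp : ζ ^ p = 1)
    (hζ1 : ζ ≠ 1) :
    ∃ u : (AlgebraicClosure (v.adicCompletion K))ˣ,
      (u : AlgebraicClosure (v.adicCompletion K)) = closureEmb (K := K) (v.adicCompletion K) ζ ∧
      u ^ p = 1 ∧ u ≠ 1 ∧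
      ∀ σ : absoluteGaloisGroup (v.adicCompletion K), resGal (K := K) (v.adicCompletion K) σ • ζ = ζ →
        Field.absoluteGaloisGroup.toAlgEquiv (v.adicCompletion K) σ u = u := by
  have hζu : IsUnit (closureEmb (K := K) (v.adicCompletion K) ζ) :=
    (IsUnit.of_pow_eq_one hζp hp.ne_zero).map _
  refine ⟨hζu.unit, rfl, Units.ext ?_, fun h ↦ hζ1 ?_, fun σ hσ ↦ ?_⟩
  · rw [Units.val_pow_eq_pow_val, IsUnit.unit_spec, ← map_pow, hζp, map_one, Units.val_one]
  · have h' := congrArg Units.val h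
    rw [IsUnit.unit_spec, Units.val_one, ← map_one (closureEmb (K := K) (v.adicCompletion K))] at h'
    exact (closureEmb (K := K) (v.adicCompletion K)).injective h'
  · rw [IsUnit.unit_spec, ← Field.absoluteGaloisGroup.smul_def, ← closureEmb_resGal_smul, hσ]

end Local

section Global

variable {K : Type} [Field K] [NumberField K] (W : WeierstrassCurve K) [W.IsElliptic]
  {v : HeightOneSpectrum (𝓞 K)}

/-- **E2 (PROVED here from E1, E1′ and IMPORTS 1, 5) — the GLOBAL Tate eigenline with a COMMON sign.**  At a multiplicative place `v`
there is ONE sign function `ε : Γ_{K_v} → {±1}` (the unramified quadratic twist of Silverman V.5.3,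
trivial iff split) such that for EVERY prime `p` and every non-trivial `p`-th root of unity `ζ ∈ K̄`,
some non-zero `P ∈ E[p](K̄)` satisfies `σ|_{K̄} • P = ε σ • P` for all `σ ∈ Γ_{K_v}` with `σ|_{K̄} ζ = ζ`.
Proof plan (pattern of PROVED `exists_unipotent_of_hasMultiplicativeReductionAt`): IMPORT 1 → `ε`;
E1′ → `u`; E1 → `L = Ψ(u)`; IMPORT 5 → global `P` with `pointsMap P = L`; `pointsMap_smul` +
`pointsMapOfEmb_injective` transport the eigen-relation.  No `hζ`, no `p ∤ v`, uniform in `char k_v`. -/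
theorem helper_tate_eigenline_global (hmult : W.HasMultiplicativeReductionAt v) :
    ∃ ε : absoluteGaloisGroup (v.adicCompletion K) → ℤ,
      (∀ σ, ε σ = 1 ∨ ε σ = -1) ∧
      ∀ (p : ℕ), p.Prime → ∀ ζ : AlgebraicClosure K, ζ ^ p = 1 → ζ ≠ 1 →
        ∃ P : geomPoints W, P ≠ 0 ∧ p • P = 0 ∧
          ∀ σ : absoluteGaloisGroup (v.adicCompletion K),
            resGal (K := K) (v.adicCompletion K) σ • ζ = ζ →
              resGal (K := K) (v.adicCompletion K) σ • P = ε σ • P := by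
  obtain ⟨q, t, Ψ, hq0, hq1, -, -, -, -, -, hker, htw⟩ :=
    TateCurve.exists_twistedTateUniformisation_tateJ W v hmult
  refine ⟨fun σ ↦ if Field.absoluteGaloisGroup.toAlgEquiv (v.adicCompletion K) σ t = t then (1 : ℤ)
      else -1, fun σ ↦ ?_, fun p hp ζ hζp hζ1 ↦ ?_⟩
  · by_cases h : Field.absoluteGaloisGroup.toAlgEquiv (v.adicCompletion K) σ t = t
    · exact Or.inl (if_pos h)
    · exact Or.inr (if_neg h)
  haveI : Fact p.Prime := ⟨hp⟩
  -- E1′: the unit `u = ι(ζ) ∈ K̄_vˣ`; E1: the eigenpoint `L = Ψ(u)`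
  obtain ⟨u, hu, hup, hu1, hufix⟩ := helper_unit_of_closureEmb (K := K) v hp hζp hζ1
  obtain ⟨hL0, hpL, hLσ⟩ := helper_tate_eigenpoint_local W v hq0 hq1 Ψ hker
    (fun σ ↦ if Field.absoluteGaloisGroup.toAlgEquiv (v.adicCompletion K) σ t = t then (1 : ℤ)
      else -1) htw hup hu1
  -- IMPORT 5: the eigenpoint comes from `E(K̄)`
  have hpL' : p • Ψ (Additive.ofMul u) = 0 := by rw [← natCast_zsmul]; exact hpL
  obtain ⟨P, hpP, hPL⟩ := exists_pointsMapOfEmb_eq_of_nsmul_eq_zero W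
    (closureEmb (K := K) (v.adicCompletion K)) hp.ne_zero hpL'
  have hinj : Function.Injective (pointsMap W (v.adicCompletion K)) := pointsMapOfEmb_injective W _
  refine ⟨P, ?_, hpP, fun σ hσ ↦ hinj ?_⟩
  · rintro rfl
    exact hL0 (by rw [← hPL, map_zero])
  · have key := hLσ σ (hufix σ hσ)
    rw [← hPL] at key
    rw [pointsMap_smul, map_zsmul]
    exact key

/-- **E3 (PROVED here, pure algebra) — the sign is read off at an ODD level.** If `ε ∈ {±1}`,
`P ≠ 0` is `p`-torsion with `p` odd and `ε • P = -P`, then `ε = -1`. (Used with `p = 5`.) -/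
theorem helper_sign_eq_neg_one {A : Type*} [AddCommGroup A] {P : A} (hP : P ≠ 0) {p : ℕ}
    (hp : Odd p) (hpP : p • P = 0) {ε : ℤ} (hε : ε = 1 ∨ ε = -1) (h : ε • P = -P) : ε = -1 := by
  rcases hε with rfl | rfl
  · exfalso
    rw [one_zsmul] at h
    have h2 : 2 • P = 0 := by rw [two_nsmul]; nth_rw 1 [h]; exact neg_add_cancel P
    have hd : addOrderOf P ∣ 1 := by
      have := Nat.dvd_gcd (addOrderOf_dvd_of_nsmul_eq_zero h2) (addOrderOf_dvd_of_nsmul_eq_zero hpP)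
      rwa [Nat.Coprime.gcd_eq_one (Nat.coprime_two_left.mpr hp)] at this
    exact hP (AddMonoid.addOrderOf_eq_one_iff.mp (Nat.dvd_one.mp hd))
  · rfl

/-- **E4 (PROVED here; pure import) — conjugating a decomposition-group element onto `Γ_{K_v}`.**  If `φ ∈ D_𝔓` for a
prime `𝔓` above `v`, then `φ = g · σ|_{K̄} · g⁻¹` for some `g ∈ Γ_K`, `σ ∈ Γ_{K_v}`
(IMPORT 4: `g • 𝔓₀ = 𝔓`; IMPORT 2: `D_{𝔓₀} = range resGal`; `MulAction.stabilizer_smul_eq_stabilizer_map_conj`). -/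
theorem helper_conj_resGal_of_mem_decompositionSubgroup {𝔓 : Ideal (absIntegers (𝓞 K) K)}
    (h𝔓 : 𝔓 ∈ v.primesAbove) {φ : absoluteGaloisGroup K}
    (hφ : φ ∈ 𝔓.decompositionSubgroup (absoluteGaloisGroup K)) :
    ∃ (g : absoluteGaloisGroup K) (σ : absoluteGaloisGroup (v.adicCompletion K)),
      φ = g * resGal (K := K) (v.adicCompletion K) σ * g⁻¹ := by
  obtain ⟨g, hg⟩ := HeightOneSpectrum.exists_smul_eq_of_mem_primesAbove_holds
    (adicCompletionPrime_mem_primesAbove K v) h𝔓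
  subst hg
  rw [Ideal.decompositionSubgroup_smul, Subgroup.mem_pointwise_smul_iff_inv_smul_mem,
    decompositionSubgroup_adicCompletionPrime_eq_range] at hφ
  obtain ⟨σ, hσ⟩ := MonoidHom.mem_range.mp hφ
  refine ⟨g, σ, ?_⟩
  rw [resGal_eq_absGaloisRestrict]
  change φ = g * (absGaloisRestrict K (v.adicCompletion K)).toMonoidHom σ * g⁻¹
  rw [hσ, MulAut.smul_def, MulAut.conj_inv_apply]
  group

/-- **E5 (PROVED here) — `χ̄_N(σ) = 1` means `σ` fixes the `N`-th roots of unity of `K̄`**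
(`modNCyclotomicCharacter_spec`).  Turns k2-g8's hypotheses `h3`/`h5` into the fixing hypotheses of E2,
conjugation-invariantly (`χ̄_N` is a homomorphism to an abelian group). -/
theorem helper_smul_eq_self_of_modNCyclotomicCharacter_eq_one {N : ℕ} [NeZero N]
    {σ : absoluteGaloisGroup K} (hσ : modNCyclotomicCharacter K N σ = 1) {ζ : AlgebraicClosure K}
    (hζ : ζ ^ N = 1) : σ • ζ = ζ := by
  have h := modNCyclotomicCharacter_spec K N σ ζ hζ
  rw [hσ, Units.val_one] at h
  rcases Nat.lt_or_ge 1 N with hN | hN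
  · haveI : Fact (1 < N) := ⟨hN⟩
    rwa [ZMod.val_one, pow_one] at h
  · have hN1 : N = 1 := le_antisymm hN (Nat.pos_of_ne_zero (NeZero.ne N))
    subst hN1
    rw [pow_one] at hζ
    rw [hζ, smul_one]

omit [NumberField K] [W.IsElliptic] in
/-- **E5′ (PROVED here) — `φ = -1` on `E[n]` is conjugation-invariant.** -/
theorem helper_neg_conj {n : ℤ} {φ g : absoluteGaloisGroup K}
    (hneg : ∀ P : W.geomTorsion n, φ • P = -P) (P : W.geomTorsion n) :
    (g⁻¹ * φ * g) • P = -P := by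
  rw [mul_smul, mul_smul, hneg, smul_neg, inv_smul_smul]

end Global

/-! ### (k1-g9 §2)  The road-facing outputs (currency of k2-g8 Piece C `SurjThreeOfCuspData`) -/

/-- **E6 = N1e (PROVED here from E2–E5; only E2 is open) — a `-1`-EIGENVECTOR of `Frob_q` on `E[3]`.**  `E/ℚ` multiplicative
at `v`, `φ` a Frobenius at `𝔓 ∣ v` with `χ̄₃(φ) = χ̄₅(φ) = 1` acting as `-1` on `E[5]` ⇒ some
`P ∈ E[3] ∖ 0` has `φ • P = -P`.  Assembly: IMPORT 3 + E4 (`φ = g σ|_{K̄} g⁻¹`), E5 (`σ|_{K̄}` fixes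
`ζ₃, ζ₅`), E2 at `p = 5` with E5′ + E3 (`ε σ = -1`), E2 at `p = 3` (`σ|_{K̄} • P₃ = -P₃`), `P := g • P₃`.
SAME hypotheses as k2-g8 T2; no `q`, valid also for `v ∣ 15`. -/
theorem helper_frob_neg_eigenvector_three (E : WeierstrassCurve ℚ) [E.IsElliptic]
    {v : HeightOneSpectrum (𝓞 ℚ)} (hmult : E.HasMultiplicativeReductionAt v)
    {𝔓 : Ideal (absIntegers (𝓞 ℚ) ℚ)} (h𝔓 : 𝔓 ∈ v.primesAbove) {φ : absoluteGaloisGroup ℚ}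
    (hφ : IsArithFrobAt (𝓞 ℚ) φ 𝔓) (h3 : modNCyclotomicCharacter ℚ 3 φ = 1)
    (h5 : modNCyclotomicCharacter ℚ 5 φ = 1) (hneg : ∀ P : E.geomTorsion 5, φ • P = -P) :
    ∃ P : E.geomTorsion 3, P ≠ 0 ∧ φ • P = -P := by
  haveI := h𝔓.1
  -- E4: `φ = g σ|_{K̄} g⁻¹`
  obtain ⟨g, σ, hφg⟩ :=
    helper_conj_resGal_of_mem_decompositionSubgroup (K := ℚ) h𝔓 hφ.mem_stabilizer
  have hφ' : resGal (K := ℚ) (v.adicCompletion ℚ) σ = g⁻¹ * φ * g := by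
    rw [hφg]; group
  -- E2: the global eigenline with its common sign `ε`
  obtain ⟨ε, hε, hline⟩ := helper_tate_eigenline_global E hmult
  -- E5: `σ|_{K̄}` fixes `ζ₃`, `ζ₅` (cyclotomic characters are conjugation-invariant)
  have hfix : ∀ (N : ℕ) [NeZero N], modNCyclotomicCharacter ℚ N φ = 1 →
      ∀ ζ : AlgebraicClosure ℚ, ζ ^ N = 1 → resGal (K := ℚ) (v.adicCompletion ℚ) σ • ζ = ζ := by
    intro N _ hN ζ hζ
    refine helper_smul_eq_self_of_modNCyclotomicCharacter_eq_one ?_ hζ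
    rw [hφ', map_mul, map_mul, hN, mul_one, map_inv, inv_mul_cancel]
  -- E5′: `g⁻¹ φ g = -1` on `E[5]`, read in `E(K̄)`
  have hconj : ∀ (P : geomPoints E) (hP : P ∈ E.geomTorsion 5), (g⁻¹ * φ * g) • P = -P :=
    fun P hP ↦ congrArg Subtype.val (helper_neg_conj E (g := g) hneg ⟨P, hP⟩)
  have hmem : ∀ (n : ℕ) (P : geomPoints E), n • P = 0 → P ∈ E.geomTorsion n := by
    intro n P h
    refine (Submodule.mem_torsionBy_iff _ _).mpr ?_
    change ((n : ℕ) : ℤ) • P = 0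
    rw [natCast_zsmul, h]
  -- level 5: the sign `ε σ = -1` (E3)
  obtain ⟨ζ₅, hζ₅⟩ := HasEnoughRootsOfUnity.prim (M := AlgebraicClosure ℚ) (n := 5)
  obtain ⟨P₅, hP₅0, h5P₅, hP₅⟩ :=
    hline 5 (by norm_num) ζ₅ hζ₅.pow_eq_one (hζ₅.ne_one (by norm_num))
  have hεσ : ε σ = -1 := by
    have h1 := hP₅ σ (hfix 5 h5 ζ₅ hζ₅.pow_eq_one)
    have h2 : resGal (K := ℚ) (v.adicCompletion ℚ) σ • P₅ = -P₅ := by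
      rw [hφ']; exact hconj P₅ (hmem 5 P₅ h5P₅)
    exact helper_sign_eq_neg_one hP₅0 ⟨2, by norm_num⟩ h5P₅ (hε σ) (h1.symm.trans h2)
  -- level 3: the `-1`-eigenvector, conjugated back by `g`
  obtain ⟨ζ₃, hζ₃⟩ := HasEnoughRootsOfUnity.prim (M := AlgebraicClosure ℚ) (n := 3)
  obtain ⟨P₃, hP₃0, h3P₃, hP₃⟩ :=
    hline 3 (by norm_num) ζ₃ hζ₃.pow_eq_one (hζ₃.ne_one (by norm_num))
  have h3' : (g⁻¹ * φ * g) • P₃ = -P₃ := by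
    rw [← hφ', hP₃ σ (hfix 3 h3 ζ₃ hζ₃.pow_eq_one), hεσ, neg_one_zsmul]
  refine ⟨⟨g • P₃, smul_mem_torsionBy g (hmem 3 P₃ h3P₃)⟩, fun h0 ↦ hP₃0 ?_, Subtype.ext ?_⟩
  · have h0' : g • P₃ = 0 := by simpa using congrArg Subtype.val h0
    exact (smul_eq_zero_iff_eq g).mp h0'
  · show φ • g • P₃ = -(g • P₃)
    have h4 := congrArg (g • ·) h3'
    simp only [smul_smul, smul_neg] at h4
    rwa [show g * (g⁻¹ * φ * g) = φ * g by group, mul_smul] at h4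

/-- **E7 = T2′ (PROVED here; IMPORTS 7–8) — Cayley–Hamilton closes k2-g8 T2 VERBATIM.**  A `-1`-eigenvector on `E[3]` plus
`det ρ̄₃(φ) = χ̄₃(φ) = 1` give `(φ + 1)² = 0` on `E[3]`: in the frame `exists_frame_galoisRepTorsion_rat`
(IMPORT 7 / `det Φ = χ̄`), apply IMPORT 8 to `-M` (`det (-M) = det M` for `2 × 2`).
Honours `Disproof.switch_false_without_det` (the determinant is used). -/
theorem helper_addOneSq_of_neg_eigenvector (E : WeierstrassCurve ℚ) [E.IsElliptic]
    {φ : absoluteGaloisGroup ℚ} (h3 : modNCyclotomicCharacter ℚ 3 φ = 1)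
    {P : E.geomTorsion 3} (hP : P ≠ 0) (hφP : φ • P = -P) :
    ∀ Q : E.geomTorsion 3, φ • (φ • Q + Q) + (φ • Q + Q) = 0 := by
  haveI : Fact (Nat.Prime 3) := ⟨by norm_num⟩
  obtain ⟨e, Φ, he, -, hdet, -⟩ := exists_frame_galoisRepTorsion_rat E 3
  set M : Matrix (Fin 2) (Fin 2) (ZMod 3) :=
    ((Φ (galoisRepTorsion E ((3 : ℕ) : ℤ) φ) : GL (Fin 2) (ZMod 3)) : Matrix (Fin 2) (Fin 2) (ZMod 3))
    with hM
  -- the frame: `e (φ • Q) = M e(Q)`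
  have hMv : ∀ Q : E.geomTorsion 3, e (φ • Q) = M *ᵥ e Q := fun Q ↦ by
    rw [← galoisRepTorsion_apply]; exact he _ Q
  -- `det M = χ̄₃(φ) = 1` (this is where the determinant is used: `Disproof.switch_false_without_det`)
  have hdetM : M.det = 1 := by
    have h := hdet φ
    rw [modPCyclotomicCharacterZMod_eq_modNCyclotomicCharacter, h3] at h
    rw [hM, ← Matrix.GeneralLinearGroup.val_det_apply, h, Units.val_one]
  -- the `-1`-eigenvector in coordinates
  have hc : M *ᵥ e P = -(e P) := by rw [← hMv, hφP, map_neg]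
  have hc0 : e P ≠ 0 := fun h ↦ hP (by simpa using congrArg e.symm h)
  have hunit : IsUnit (e P 0) ∨ IsUnit (e P 1) := by
    by_contra hcon
    simp only [not_or, isUnit_iff_ne_zero, ne_eq, not_not] at hcon
    apply hc0
    funext i
    fin_cases i
    · simpa using hcon.1
    · simpa using hcon.2
  -- Cayley–Hamilton for `-M` (IMPORT 8): `(-M - 1)² = 0`, i.e. `(M + 1)² = 0`
  have hneg : (-M) *ᵥ e P = e P := by rw [Matrix.neg_mulVec, hc, neg_neg]
  have hdet' : (-M).det = 1 := by
    rw [Matrix.det_fin_two] at hdetM ⊢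
    simp only [Matrix.neg_apply]
    linear_combination hdetM
  have hsq := mul_self_sub_one_eq_zero_of_mulVec_eq_of_det_eq_one (-M) (e P) hunit hneg hdet'
  have hsq' : (M + 1) * (M + 1) = 0 := by
    rw [show -M - 1 = -(M + 1) by abel, neg_mul_neg] at hsq
    exact hsq
  intro Q
  apply e.injective
  simp only [map_add, map_zero, hMv]
  have h : ((M + 1) * (M + 1)) *ᵥ e Q = 0 := by rw [hsq', Matrix.zero_mulVec]
  rwa [← Matrix.mulVec_mulVec, Matrix.add_mulVec, Matrix.one_mulVec, Matrix.add_mulVec,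
    Matrix.one_mulVec] at h

/-- **k2-g8 T2, DISCHARGED (sorry-free composition of E6 + E7)**: exactly the signature of
`StubSwitchK2G8.helper_frob_addOneSq_three`, so k2-g8's PROVED `surjThreeOfCuspData_of_helpers` is untouched and
its T1 (`helper_twistedTate_addOneSq_local`) is no longer needed. -/
theorem helper_frob_addOneSq_three' (E : WeierstrassCurve ℚ) [E.IsElliptic]
    {v : HeightOneSpectrum (𝓞 ℚ)} (hmult : E.HasMultiplicativeReductionAt v)
    {𝔓 : Ideal (absIntegers (𝓞 ℚ) ℚ)} (h𝔓 : 𝔓 ∈ v.primesAbove) {φ : absoluteGaloisGroup ℚ}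
    (hφ : IsArithFrobAt (𝓞 ℚ) φ 𝔓) (h3 : modNCyclotomicCharacter ℚ 3 φ = 1)
    (h5 : modNCyclotomicCharacter ℚ 5 φ = 1) (hneg : ∀ P : E.geomTorsion 5, φ • P = -P) :
    ∀ Q : E.geomTorsion 3, φ • (φ • Q + Q) + (φ • Q + Q) = 0 := by
  obtain ⟨P, hP, hφP⟩ := helper_frob_neg_eigenvector_three E hmult h𝔓 hφ h3 h5 hneg
  exact helper_addOneSq_of_neg_eigenvector E h3 hP hφP

end K1G9Verbatim

/-- **T2 holds** (k1 gen 9, `helper_frob_addOneSq_three'`). -/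
theorem t2Statement_holds : T2Statement := by
  intro E _ v hmult 𝔓 h𝔓 φ hφ h3 h5 hneg
  exact helper_frob_addOneSq_three' E hmult h𝔓 hφ h3 h5 hneg

/-- **PIECE C `SurjThreeOfCuspData` — PROVED (sorry-free, this file).** -/
theorem surjThreeOfCuspData : SurjThreeOfCuspData := surjThreeOfCuspData_of t2Statement_holds

/-! ## sanity: the tree inputs consumed above exist with the expected shape -/

example (E : WeierstrassCurve ℚ) [E.IsElliptic] {v : HeightOneSpectrum (𝓞 ℚ)}
    (hmult : E.HasMultiplicativeReductionAt v) (h3v : ((3 : ℕ) : 𝓞 ℚ) ∉ v.asIdeal)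
    (h5 : E.ordMinimalDiscriminant v = 5) :
    3 ∣ Nat.card (galoisRepTorsion E ((3 : ℕ) : ℤ)).range :=
  E.dvd_card_range_galoisRepTorsion_of_hasMultiplicativeReductionAt_of_not_dvd hmult Nat.prime_three
    h3v (by rw [h5]; decide)


end Summit.ABC.ABC.Cruxes.FreyModularity.StubSwitchK1G10

end

/-
Copyright: h21 programme. Stub-ideation companion (k = 1, GENERATION 11, HOME FAMILY 1 — RECOGNISE &
IMPORT) — NOT a route file, NOT a Theorems file.  Elaboration sanity for `STUB-IDEAS-stub_switch-1.md`
(gen 11): the road helpers of `STUB_IDEAS_stub_switch_2g9_Sketch.lean` (ideator k2, gen 9) that are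
TREE / MATHLIB THEOREMS IN DISGUISE, discharged here SORRY-FREE with k2's signatures VERBATIM, so the
road companion can copy them (as it copied the gen-9 Tate block).  Imports no other crux workfile (the
farm does not build them as modules), so the shared vocabulary (`member`, `base`, `IntegralModel`) is
copied verbatim from k2-g9 §0/§2, not imported.
-/

/-! # (k1 gen 11) `STUB_IDEAS_stub_switch_1g11_Sketch.lean` — module docstring ELIDED (see that workfile). -/

set_option linter.dupNamespace false
set_option linter.unusedVariables false

noncomputable section

open scoped NumberField Classical Pointwise
open Literature.NumberTheory.EllipticCurves Literature.NumberTheory.EllipticCurves.HesseFamilyFive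
open Literature.NumberTheory.Automorphic Literature.NumberTheory.GaloisRepresentations
open Literature.NumberTheory.Automorphic.BCDT WeierstrassCurve Field NumberField IsDedekindDomain Matrix
open Polynomial

namespace Summit.ABC.ABC.Cruxes.FreyModularity.StubSwitchK1G11

/-! ## §0 Vocabulary (copied VERBATIM from `…_2g9_Sketch.lean` §0/§2) -/

/-- Member `E_{l,m}` of Fisher's direct `5`-congruence family of `y² = x³ − 27c₄x − 54c₆`. -/
abbrev member (c₄ c₆ l m : ℚ) : WeierstrassCurve ℚ :=
  ⟨0, 0, 0, -27 * C4 c₄ c₆ l m, -54 * C6 c₄ c₆ l m⟩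

/-- The `c₄c₆`-model (= the member at `(l:m) = (1:0)`). -/
abbrev base (c₄ c₆ : ℚ) : WeierstrassCurve ℚ := ⟨0, 0, 0, -27 * c₄, -54 * c₆⟩

/-- **Piece I `IntegralModel`** (k2-g9 §2 verbatim). -/
def IntegralModel : Prop :=
  ∀ (W : WeierstrassCurve ℚ) [W.IsElliptic], ∃ c₄ c₆ : ℤ, c₄ ^ 3 ≠ c₆ ^ 2 ∧
    ∃ _ : (base (c₄ : ℚ) (c₆ : ℚ)).IsElliptic, Congr (base (c₄ : ℚ) (c₆ : ℚ)) W

/-! ## §I0 the integral model — PROVED -/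

/-- `Δ` of the `c₄c₆`-model. -/
theorem base_Δ (c₄ c₆ : ℚ) : (base c₄ c₆).Δ = 2 ^ 6 * 3 ^ 9 * (c₄ ^ 3 - c₆ ^ 2) := by
  simp only [WeierstrassCurve.Δ, WeierstrassCurve.b₂, WeierstrassCurve.b₄, WeierstrassCurve.b₆,
    WeierstrassCurve.b₈]
  ring

/-- **I0 (PROVED).** `W ≅ ⟨0,0,0,−27c₄(W),−54c₆(W)⟩` (`fisherChange_smul`), then rescale by the common
denominator `d = den(c₄)·den(c₆)` (`scale_smul_short` with `v = d`): the model
`base (d⁴c₄(W)) (d⁶c₆(W))` is integral, `ℚ`-isomorphic — hence `5`-congruent — to `W`, and elliptic. -/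
theorem integralModel : IntegralModel := by
  intro W hW
  set d : ℕ := W.c₄.den * W.c₆.den with hd
  have hdpos : 0 < d := Nat.mul_pos W.c₄.den_pos W.c₆.den_pos
  have hd0 : (d : ℚ) ≠ 0 := by exact_mod_cast hdpos.ne'
  -- the two integers
  set c₄ : ℤ := W.c₄.num * W.c₄.den ^ 3 * W.c₆.den ^ 4 with hc₄def
  set c₆ : ℤ := W.c₆.num * W.c₆.den ^ 5 * W.c₄.den ^ 6 with hc₆def
  have hc₄ : (c₄ : ℚ) = (d : ℚ) ^ 4 * W.c₄ := by
    have h : (d : ℚ) ^ 4 * W.c₄ = (W.c₄.den : ℚ) ^ 3 * (W.c₆.den : ℚ) ^ 4 * (W.c₄ * W.c₄.den) := by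
      rw [hd]; push_cast; ring
    rw [h, Rat.mul_den_eq_num, hc₄def]; push_cast; ring
  have hc₆ : (c₆ : ℚ) = (d : ℚ) ^ 6 * W.c₆ := by
    have h : (d : ℚ) ^ 6 * W.c₆ = (W.c₆.den : ℚ) ^ 5 * (W.c₄.den : ℚ) ^ 6 * (W.c₆ * W.c₆.den) := by
      rw [hd]; push_cast; ring
    rw [h, Rat.mul_den_eq_num, hc₆def]; push_cast; ring
  -- the rescaling
  set C : WeierstrassCurve.VariableChange ℚ := ⟨Units.mk0 (d : ℚ)⁻¹ (inv_ne_zero hd0), 0, 0, 0⟩ with hC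
  have hbase : C • (fisherChange W • W) = base (c₄ : ℚ) (c₆ : ℚ) := by
    rw [fisherChange_smul, hC, scale_smul_short (d : ℚ) hd0]
    ext <;> simp [hc₄, hc₆] <;> ring
  have hcongr : Congr W (base (c₄ : ℚ) (c₆ : ℚ)) :=
    congr_trans (congr_smul W (fisherChange W)) (congr_of_smul_eq C hbase)
  haveI hEll : (base (c₄ : ℚ) (c₆ : ℚ)).IsElliptic := by rw [← hbase]; infer_instance
  refine ⟨c₄, c₆, ?_, hEll, congr_symm hcongr⟩
  -- `c₄³ ≠ c₆²` from `Δ ≠ 0`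
  have hΔ : (base (c₄ : ℚ) (c₆ : ℚ)).Δ ≠ 0 := (base (c₄ : ℚ) (c₆ : ℚ)).isUnit_Δ.ne_zero
  rw [base_Δ] at hΔ
  intro h
  apply hΔ
  have h' : ((c₄ : ℚ)) ^ 3 = ((c₆ : ℚ)) ^ 2 := by exact_mod_cast h
  rw [h', sub_self, mul_zero]

/-! ## §B5 Frobenius-fixed algebraic integers are congruent to rational integers — PROVED -/

/-- **B5 (PROVED; k2-g9 signature verbatim).**  `φ • A ≡ A^{N(𝔓 ∩ 𝓞 ℚ)} (mod 𝔓)` (`IsArithFrobAt`) and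
`φ • A = A` give `ā^q = ā` in the residue field `\bar ℤ/𝔓 ⊇ 𝓞 ℚ/v = 𝔽_q`; the roots of `X^q − X` there are
exactly the prime field (`Literature.AlgebraicGeometry.Motives.mem_range_of_pow_card_eq`), and `𝓞 ℚ = ℤ`
(`Rat.ringOfIntegersEquiv`). -/
theorem helper_exists_int_congr_of_frob_fixed {v : HeightOneSpectrum (𝓞 ℚ)}
    {𝔓 : Ideal (absIntegers (𝓞 ℚ) ℚ)} (h𝔓 : 𝔓 ∈ v.primesAbove)
    {φ : absoluteGaloisGroup ℚ} (hφ : IsArithFrobAt (𝓞 ℚ) φ 𝔓)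
    (A : absIntegers (𝓞 ℚ) ℚ) (hA : φ • A = A) : ∃ a : ℤ, A - a ∈ 𝔓 := by
  haveI h𝔓max : 𝔓.IsMaximal := HeightOneSpectrum.isMaximal_of_mem_primesAbove h𝔓
  haveI : 𝔓.LiesOver v.asIdeal := (HeightOneSpectrum.mem_primesAbove_iff.mp h𝔓).2
  have hover : v.asIdeal = 𝔓.under (𝓞 ℚ) := Ideal.LiesOver.over
  -- the Frobenius congruence for the fixed element `A`
  have h1 : φ • A - A ^ Nat.card (𝓞 ℚ ⧸ 𝔓.under (𝓞 ℚ)) ∈ 𝔓 := hφ A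
  rw [hA, ← hover] at h1
  -- residue fields
  letI : Field (absIntegers (𝓞 ℚ) ℚ ⧸ 𝔓) := Ideal.Quotient.field 𝔓
  haveI : v.asIdeal.IsMaximal := v.isMaximal
  letI : Field (𝓞 ℚ ⧸ v.asIdeal) := Ideal.Quotient.field v.asIdeal
  haveI : Finite (𝓞 ℚ ⧸ v.asIdeal) := by rw [hover]; exact hφ.finite_quotient
  let ι : 𝓞 ℚ ⧸ v.asIdeal →+* absIntegers (𝓞 ℚ) ℚ ⧸ 𝔓 :=
    Ideal.quotientMap 𝔓 (algebraMap (𝓞 ℚ) (absIntegers (𝓞 ℚ) ℚ)) hover.le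
  have h2 : (Ideal.Quotient.mk 𝔓 A) ^ Nat.card (𝓞 ℚ ⧸ v.asIdeal) = Ideal.Quotient.mk 𝔓 A := by
    rw [← map_pow, eq_comm, Ideal.Quotient.eq]; exact h1
  obtain ⟨w, hw⟩ := Literature.AlgebraicGeometry.Motives.mem_range_of_pow_card_eq ι h2
  obtain ⟨r, rfl⟩ := Ideal.Quotient.mk_surjective w
  have hw' : Ideal.Quotient.mk 𝔓 (algebraMap (𝓞 ℚ) (absIntegers (𝓞 ℚ) ℚ) r) =
      Ideal.Quotient.mk 𝔓 A := by
    rw [← hw]; exact (Ideal.quotientMap_mk).symm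
  -- `r ∈ 𝓞 ℚ` is a rational integer
  obtain ⟨a, ha⟩ : ∃ a : ℤ, (a : 𝓞 ℚ) = r :=
    ⟨Rat.ringOfIntegersEquiv r, Rat.ringOfIntegersEquiv.injective (by rw [map_intCast, Int.cast_id])⟩
  subst ha
  rw [map_intCast] at hw'
  exact ⟨a, Ideal.Quotient.eq.mp hw'.symm⟩

/-! ## §B6β/γ `𝔇(·,1)` is a monic integer polynomial — PROVED -/

section DPoly

variable {R S : Type*} [CommRing R] [CommRing S]

/-- `𝔇` commutes with ring homomorphisms (it is a polynomial with integer coefficients). -/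
theorem map_D {F : Type*} [FunLike F R S] [RingHomClass F R S] (f : F) (c₄ c₆ l m : R) :
    f (D c₄ c₆ l m) = D (f c₄) (f c₆) (f l) (f m) := by
  simp only [D, map_add, map_sub, map_mul, map_pow, map_ofNat]

/-- `𝔇(c₄,c₆; X, 1) ∈ R[X]`. -/
def DPoly (c₄ c₆ : R) : R[X] := D (C c₄) (C c₆) (X : R[X]) 1

theorem eval_DPoly (c₄ c₆ l : R) : (DPoly c₄ c₆).eval l = D c₄ c₆ l 1 := by
  rw [DPoly, ← coe_evalRingHom, map_D]
  simp only [coe_evalRingHom, eval_C, eval_X, eval_one]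

theorem aeval_DPoly [Algebra R S] (c₄ c₆ : R) (x : S) :
    aeval x (DPoly c₄ c₆) = D (algebraMap R S c₄) (algebraMap R S c₆) x 1 := by
  rw [DPoly, map_D]
  simp only [aeval_C, aeval_X, map_one]

/-- `𝔇(·,1)` is monic of degree `12`. -/
theorem monic_DPoly (c₄ c₆ : R) : (DPoly c₄ c₆).Monic := by
  nontriviality R
  unfold DPoly D
  monicity!

end DPoly

/-- **B6β (PROVED; k2-g9 signature verbatim): a root of the MONIC integer polynomial `𝔇(·,1)` is an
algebraic integer.** -/
theorem helper_mem_absIntegers_of_D_eq_zero (c₄ c₆ : ℤ) {ξ : AlgebraicClosure ℚ}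
    (hξ : D (c₄ : AlgebraicClosure ℚ) (c₆ : AlgebraicClosure ℚ) ξ 1 = 0) :
    ξ ∈ absIntegers (𝓞 ℚ) ℚ := by
  rw [mem_integralClosure_iff]
  have hint : IsIntegral ℤ ξ := by
    refine ⟨DPoly c₄ c₆, monic_DPoly c₄ c₆, ?_⟩
    rw [← aeval_def, aeval_DPoly]
    simpa only [algebraMap_int_eq, eq_intCast] using hξ
  exact hint.tower_top

/-- the prime under a place of `ℚ` containing `q` is `q` (PROVED by k2, gen 9; copied verbatim). -/
theorem natGenerator_eq_of_mem {q : ℕ} (hq : q.Prime) {v : HeightOneSpectrum (𝓞 ℚ)}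
    (hv : (q : 𝓞 ℚ) ∈ v.asIdeal) : Rat.HeightOneSpectrum.natGenerator v = q := by
  have h1 : Rat.HeightOneSpectrum.natGenerator v ∣ q := by
    rw [Rat.HeightOneSpectrum.natGenerator_dvd_iff]
    have h2 := Ideal.mem_map_of_mem (Rat.IsIntegralClosure.intEquiv (𝓞 ℚ)) hv
    rwa [map_natCast] at h2
  exact (Nat.prime_dvd_prime_iff_eq (Rat.HeightOneSpectrum.prime_natGenerator v) hq).mp h1

/-- **B6γ (PROVED; k2-g9 signature verbatim): the reduction mod `𝔓` of an integral root lands in `qℤ`.** -/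
theorem helper_dvd_D_of_sub_mem (c₄ c₆ : ℤ) {q : ℕ} (hq : q.Prime) {v : HeightOneSpectrum (𝓞 ℚ)}
    (hv : (q : 𝓞 ℚ) ∈ v.asIdeal) {𝔓 : Ideal (absIntegers (𝓞 ℚ) ℚ)} (h𝔓 : 𝔓 ∈ v.primesAbove)
    {A : absIntegers (𝓞 ℚ) ℚ}
    (hA : D (c₄ : AlgebraicClosure ℚ) (c₆ : AlgebraicClosure ℚ) (A : AlgebraicClosure ℚ) 1 = 0)
    {a : ℤ} (ha : A - a ∈ 𝔓) : (q : ℤ) ∣ D c₄ c₆ a 1 := by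
  haveI : 𝔓.LiesOver v.asIdeal := (HeightOneSpectrum.mem_primesAbove_iff.mp h𝔓).2
  -- Step 1: `𝔇(A,1) = 0` already in `\bar ℤ` (the coercion to `\bar ℚ` is injective)
  have hA' : D (c₄ : absIntegers (𝓞 ℚ) ℚ) (c₆ : absIntegers (𝓞 ℚ) ℚ) A 1 = 0 := by
    have hinj : Function.Injective (algebraMap (absIntegers (𝓞 ℚ) ℚ) (AlgebraicClosure ℚ)) :=
      Subtype.val_injective
    apply hinj
    rw [map_D, map_intCast, map_intCast, map_one, map_zero]
    exact hA
  -- Step 2: `(a − A) ∣ 𝔇(a,1) − 𝔇(A,1) = 𝔇(a,1)` in `\bar ℤ`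
  have hdiv : (a : absIntegers (𝓞 ℚ) ℚ) - A ∣
      D (c₄ : absIntegers (𝓞 ℚ) ℚ) (c₆ : absIntegers (𝓞 ℚ) ℚ) (a : absIntegers (𝓞 ℚ) ℚ) 1 := by
    have h := Polynomial.sub_dvd_eval_sub (a : absIntegers (𝓞 ℚ) ℚ) A
      (DPoly (c₄ : absIntegers (𝓞 ℚ) ℚ) (c₆ : absIntegers (𝓞 ℚ) ℚ))
    rwa [eval_DPoly, eval_DPoly, hA', sub_zero] at h
  -- Step 3: hence `𝔇(a,1) ∈ 𝔓`
  have hmem : (((D c₄ c₆ a 1 : ℤ)) : absIntegers (𝓞 ℚ) ℚ) ∈ 𝔓 := by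
    have hcast : ((D c₄ c₆ a 1 : ℤ) : absIntegers (𝓞 ℚ) ℚ) =
        D (c₄ : absIntegers (𝓞 ℚ) ℚ) (c₆ : absIntegers (𝓞 ℚ) ℚ) (a : absIntegers (𝓞 ℚ) ℚ) 1 := by
      have h := map_D (Int.castRingHom (absIntegers (𝓞 ℚ) ℚ)) c₄ c₆ a 1
      simpa only [eq_intCast, Int.cast_one] using h
    rw [hcast]
    obtain ⟨t, ht⟩ := hdiv
    rw [ht]
    refine Ideal.mul_mem_right _ _ ?_
    have h := 𝔓.neg_mem_iff.mpr ha
    rwa [neg_sub] at h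
  -- Step 4: `𝔓 ∩ 𝓞 ℚ = v` and `v ∩ ℤ = qℤ`
  have h2 : ((D c₄ c₆ a 1 : ℤ) : 𝓞 ℚ) ∈ v.asIdeal := by
    rw [Ideal.mem_of_liesOver 𝔓 v.asIdeal, map_intCast]
    exact hmem
  rw [Rat.intCast_mem_asIdeal_iff, natGenerator_eq_of_mem hq hv] at h2
  exact h2

/-! ## §B8a/b valuation bookkeeping for Fisher's `𝔠₄, 𝔠₆` — PROVED -/

section Casts

theorem cast_Dl (c₄ c₆ l : ℤ) : ((Dl c₄ c₆ l 1 : ℤ) : ℚ) = Dl (c₄ : ℚ) (c₆ : ℚ) (l : ℚ) 1 := by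
  simp only [Dl]; push_cast; ring
theorem cast_Dm (c₄ c₆ l : ℤ) : ((Dm c₄ c₆ l 1 : ℤ) : ℚ) = Dm (c₄ : ℚ) (c₆ : ℚ) (l : ℚ) 1 := by
  simp only [Dm]; push_cast; ring
theorem cast_Dll (c₄ c₆ l : ℤ) : ((Dll c₄ c₆ l 1 : ℤ) : ℚ) = Dll (c₄ : ℚ) (c₆ : ℚ) (l : ℚ) 1 := by
  simp only [Dll]; push_cast; ring
theorem cast_Dlm (c₄ c₆ l : ℤ) : ((Dlm c₄ c₆ l 1 : ℤ) : ℚ) = Dlm (c₄ : ℚ) (c₆ : ℚ) (l : ℚ) 1 := by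
  simp only [Dlm]; push_cast; ring
theorem cast_Dmm (c₄ c₆ l : ℤ) : ((Dmm c₄ c₆ l 1 : ℤ) : ℚ) = Dmm (c₄ : ℚ) (c₆ : ℚ) (l : ℚ) 1 := by
  simp only [Dmm]; push_cast; ring
theorem cast_Dlll (c₄ c₆ l : ℤ) :
    ((Dlll c₄ c₆ l 1 : ℤ) : ℚ) = Dlll (c₄ : ℚ) (c₆ : ℚ) (l : ℚ) 1 := by
  simp only [Dlll]; push_cast; ring
theorem cast_Dllm (c₄ c₆ l : ℤ) :
    ((Dllm c₄ c₆ l 1 : ℤ) : ℚ) = Dllm (c₄ : ℚ) (c₆ : ℚ) (l : ℚ) 1 := by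
  simp only [Dllm]; push_cast; ring
theorem cast_Dlmm (c₄ c₆ l : ℤ) :
    ((Dlmm c₄ c₆ l 1 : ℤ) : ℚ) = Dlmm (c₄ : ℚ) (c₆ : ℚ) (l : ℚ) 1 := by
  simp only [Dlmm]; push_cast; ring
theorem cast_Dmmm (c₄ c₆ l : ℤ) :
    ((Dmmm c₄ c₆ l 1 : ℤ) : ℚ) = Dmmm (c₄ : ℚ) (c₆ : ℚ) (l : ℚ) 1 := by
  simp only [Dmmm]; push_cast; ring

end Casts

/-- **B8a (PROVED; k2-g9 signature verbatim): at integer arguments Fisher's `𝔠₄, 𝔠₆` have denominators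
`17424` and `17424·240`.**  The numerators are the integer forms `−(𝔇_λλ𝔇_μμ − 𝔇_λμ²)` and
`−𝔇_λ·N_μ + 𝔇_μ·N_λ` evaluated in `ℤ`; the `𝔇`-derivatives are treated as atoms (`cast_D…`). -/
theorem helper_C4_C6_den (c₄ c₆ l : ℤ) :
    (∃ z : ℤ, C4 (c₄ : ℚ) (c₆ : ℚ) (l : ℚ) 1 = (z : ℚ) / 17424) ∧
      ∃ z : ℤ, C6 (c₄ : ℚ) (c₆ : ℚ) (l : ℚ) 1 = (z : ℚ) / (17424 * 240) := by
  constructor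
  · refine ⟨-(Dll c₄ c₆ l 1 * Dmm c₄ c₆ l 1 - Dlm c₄ c₆ l 1 ^ 2), ?_⟩
    push_cast
    rw [cast_Dll, cast_Dmm, cast_Dlm, C4]
  · refine ⟨-(Dl c₄ c₆ l 1 * (Dllm c₄ c₆ l 1 * Dmm c₄ c₆ l 1 + Dll c₄ c₆ l 1 * Dmmm c₄ c₆ l 1
        - 2 * Dlm c₄ c₆ l 1 * Dlmm c₄ c₆ l 1)) + Dm c₄ c₆ l 1 * (Dlll c₄ c₆ l 1 * Dmm c₄ c₆ l 1
        + Dll c₄ c₆ l 1 * Dlmm c₄ c₆ l 1 - 2 * Dlm c₄ c₆ l 1 * Dllm c₄ c₆ l 1), ?_⟩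
    push_cast
    rw [cast_Dl, cast_Dm, cast_Dll, cast_Dmm, cast_Dlm, cast_Dlll, cast_Dllm, cast_Dlmm, cast_Dmmm,
      C6, C4l, C4m]
    ring

/-- **B8b (PROVED; k2-g9 signature verbatim): `q`-integral `x, y` with `ord_q(x³ − y²) = 5` force `x ≠ 0`
and `ord_q x = 0`.** -/
theorem helper_padicValRat_eq_zero_of_cube_sub_sq {q : ℕ} [Fact q.Prime] {x y : ℚ}
    (hx : x = 0 ∨ 0 ≤ padicValRat q x) (hy : y = 0 ∨ 0 ≤ padicValRat q y) (hxy : x ^ 3 - y ^ 2 ≠ 0)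
    (h5 : padicValRat q (x ^ 3 - y ^ 2) = 5) : x ≠ 0 ∧ padicValRat q x = 0 := by
  rcases eq_or_ne x 0 with hx0 | hx0
  · exfalso
    subst hx0
    have hy0 : y ≠ 0 := by rintro rfl; exact hxy (by ring)
    rw [zero_pow three_ne_zero, zero_sub, padicValRat.neg, padicValRat.pow] at h5
    omega
  refine ⟨hx0, ?_⟩
  have hxv : 0 ≤ padicValRat q x := hx.resolve_left hx0
  rcases eq_or_ne y 0 with hy0 | hy0
  · exfalso
    subst hy0
    rw [zero_pow two_ne_zero, sub_zero, padicValRat.pow] at h5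
    omega
  have hyv : 0 ≤ padicValRat q y := hy.resolve_left hy0
  have h3 : padicValRat q (x ^ 3) = 3 * padicValRat q x := by rw [padicValRat.pow]; push_cast; ring
  have h2 : padicValRat q (-y ^ 2) = 2 * padicValRat q y := by
    rw [padicValRat.neg, padicValRat.pow]; push_cast; ring
  have hsum : x ^ 3 + -y ^ 2 ≠ 0 := by rwa [← sub_eq_add_neg]
  rw [sub_eq_add_neg] at h5
  by_cases hne : padicValRat q (x ^ 3) = padicValRat q (-y ^ 2)
  · have hmin := padicValRat.min_le_padicValRat_add (p := q) hsum
    rw [h5, h3, h2] at hmin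
    rw [h3, h2] at hne
    omega
  · have hadd := padicValRat.add_eq_min (p := q) hsum (pow_ne_zero 3 hx0)
      (neg_ne_zero.mpr (pow_ne_zero 2 hy0)) hne
    rw [h5, h3, h2] at hadd
    omega

/-! ## §B9 semistability of the member away from `30(c₄³ − c₆²)` — PROVED -/

/-- integers have valuation `≤ 1` at every finite place of `ℚ`. -/
theorem valuation_intCast_le_one (w : HeightOneSpectrum (𝓞 ℚ)) (z : ℤ) :
    w.valuation ℚ (z : ℚ) ≤ 1 := by
  have h : w.valuation ℚ (algebraMap (𝓞 ℚ) ℚ (z : 𝓞 ℚ)) ≤ 1 :=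
    HeightOneSpectrum.valuation_le_one (K := ℚ) w (z : 𝓞 ℚ)
  rwa [map_intCast] at h

/-- an integer dividing an integer outside `w` is outside `w`. -/
theorem intCast_not_mem_of_dvd {w : HeightOneSpectrum (𝓞 ℚ)} {a b : ℤ} (hab : a ∣ b)
    (hb : (b : 𝓞 ℚ) ∉ w.asIdeal) : (a : 𝓞 ℚ) ∉ w.asIdeal := by
  intro ha
  apply hb
  obtain ⟨c, rfl⟩ := hab
  push_cast
  exact Ideal.mul_mem_right _ _ ha

/-- an integer outside `w` has valuation exactly `1`. -/
theorem valuation_intCast_eq_one {w : HeightOneSpectrum (𝓞 ℚ)} {z : ℤ}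
    (hz : (z : 𝓞 ℚ) ∉ w.asIdeal) : w.valuation ℚ (z : ℚ) = 1 := by
  refine le_antisymm (valuation_intCast_le_one w z) (not_lt.mp fun hlt => hz ?_)
  have h : w.valuation ℚ (algebraMap (𝓞 ℚ) ℚ (z : 𝓞 ℚ)) < 1 ↔ (z : 𝓞 ℚ) ∈ w.asIdeal :=
    HeightOneSpectrum.valuation_lt_one_iff_mem (K := ℚ) w (z : 𝓞 ℚ)
  rw [map_intCast] at h
  exact h.mp hlt

/-- the `c₄c₆`-model has good reduction at every `w ∤ 30(c₄³ − c₆²)` (AEC VIII.1 Rem. 1.3). -/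
theorem hasGoodReductionAt_base (c₄ c₆ : ℤ) {w : HeightOneSpectrum (𝓞 ℚ)}
    (hw : ((30 * (c₄ ^ 3 - c₆ ^ 2).natAbs : ℕ) : 𝓞 ℚ) ∉ w.asIdeal) :
    (base (c₄ : ℚ) (c₆ : ℚ)).HasGoodReductionAt w := by
  have hw' : (((30 * (c₄ ^ 3 - c₆ ^ 2) : ℤ)) : 𝓞 ℚ) ∉ w.asIdeal := by
    refine intCast_not_mem_of_dvd (b := ((30 * (c₄ ^ 3 - c₆ ^ 2).natAbs : ℕ) : ℤ)) ?_
      (by rwa [Int.cast_natCast])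
    push_cast
    exact mul_dvd_mul_left _ (self_dvd_abs _)
  have hpow : (((30 * (c₄ ^ 3 - c₆ ^ 2)) ^ 9 : ℤ) : 𝓞 ℚ) ∉ w.asIdeal := by
    intro h
    apply hw'
    rw [Int.cast_pow] at h
    exact Ideal.IsPrime.mem_of_pow_mem inferInstance 9 h
  have hN : ((2 ^ 6 * 3 ^ 9 * (c₄ ^ 3 - c₆ ^ 2) : ℤ) : 𝓞 ℚ) ∉ w.asIdeal :=
    intCast_not_mem_of_dvd ⟨2 ^ 3 * 5 ^ 9 * (c₄ ^ 3 - c₆ ^ 2) ^ 8, by ring⟩ hpow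
  refine hasGoodReductionAt_of_valuation_le_one_of_valuation_Δ_eq_one w _ ?_ ?_ ?_ ?_ ?_ ?_
  · simp
  · simp
  · simp
  · have h := valuation_intCast_le_one w (-27 * c₄); push_cast at h; exact h
  · have h := valuation_intCast_le_one w (-54 * c₆); push_cast at h; exact h
  · rw [base_Δ]
    have h := valuation_intCast_eq_one hN
    convert h using 2
    push_cast
    ring

/-- **B9 (PROVED; k2-g9 signature verbatim): the member is semistable at every `w ∤ 30(c₄³ − c₆²)`.**
`base` is good at `w` ⇒ `I_w` (of `𝔓₀ = adicCompletionPrime ℚ w`) acts trivially on `base[5]`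
(`smul_geomTorsion_eq_of_mem_inertia`, `w ∤ 5`) ⇒ via the equivariant `Congr`-isomorphism trivially on
`member[5]` ⇒ not additive (`exists_mem_inertia_smul_geomTorsion_ne_of_hasAdditiveReductionAt`, `m = 5`,
bridge `GreenbergSelmer.inertia w = 𝔓₀.inertia Γ_ℚ`) ⇒ semistable. -/
theorem helper_isSemistableAt_member (c₄ c₆ l : ℤ) (hΔ : c₄ ^ 3 ≠ c₆ ^ 2)
    [(base (c₄ : ℚ) (c₆ : ℚ)).IsElliptic] [(member (c₄ : ℚ) (c₆ : ℚ) (l : ℚ) 1).IsElliptic]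
    (hc : Congr (member (c₄ : ℚ) (c₆ : ℚ) (l : ℚ) 1) (base (c₄ : ℚ) (c₆ : ℚ)))
    {w : HeightOneSpectrum (𝓞 ℚ)} (hw : ((30 * (c₄ ^ 3 - c₆ ^ 2).natAbs : ℕ) : 𝓞 ℚ) ∉ w.asIdeal) :
    (member (c₄ : ℚ) (c₆ : ℚ) (l : ℚ) 1).IsSemistableAt w := by
  rw [isSemistableAt_iff_not_hasAdditiveReductionAt]
  intro hadd
  -- `w ∤ 5`
  have h5 : ((5 : ℕ) : 𝓞 ℚ) ∉ w.asIdeal := by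
    have h := intCast_not_mem_of_dvd (w := w) (a := 5) (b := ((30 * (c₄ ^ 3 - c₆ ^ 2).natAbs : ℕ) : ℤ))
      (by push_cast; exact Dvd.dvd.mul_right (by norm_num) _) (by rwa [Int.cast_natCast])
    exact_mod_cast h
  have h5' : (((5 : ℤ)) : 𝓞 ℚ) ∉ w.asIdeal := by exact_mod_cast h5
  -- good reduction of `base` and the inertia bridge
  have hgood := hasGoodReductionAt_base c₄ c₆ hw
  have e : GreenbergSelmer.inertia w = (adicCompletionPrime ℚ w).inertia (absoluteGaloisGroup ℚ) :=
    (inertia_adicCompletionPrime_eq_map_absInertia ℚ w).symm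
  obtain ⟨f, hf⟩ := hc
  have key : ∀ σ ∈ GreenbergSelmer.inertia w,
      ∀ P : (member (c₄ : ℚ) (c₆ : ℚ) (l : ℚ) 1).geomTorsion 5, σ • P = P := by
    intro σ hσ P
    rw [e] at hσ
    apply f.injective
    rw [hf]
    exact smul_geomTorsion_eq_of_mem_inertia _ hgood h5' (adicCompletionPrime_mem_primesAbove ℚ w) hσ
      (f P)
  obtain ⟨σ, hσ, Q, hσQ⟩ :=
    exists_mem_inertia_smul_geomTorsion_ne_of_hasAdditiveReductionAt _ hadd (m := 5) (by norm_num) h5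
  exact hσQ (key σ hσ Q)

/-! ## §B7 a simple root mod `q` lifts to `ord_q 𝔇(l,1) = 1` — PROVED
(Hensel à la `Polynomial.binomExpansion`; the Bézout block `BU/BV/bezout_D_Dl/helper_simple_root_mod_q`
is COPIED VERBATIM from ideator k2 gen 7, where it was already PROVED — credit k2, kit j345058) -/

section Bezout

variable {R : Type*} [CommRing R]

/-- Bézout cofactor of `𝔇(λ,1)` (k2 gen 7, kit j345058; `a = c₄`, `b = c₆`, `x = λ`). -/
def BU (a b x : R) : R :=
  2244 * a * x ^ 10 - 2244 * b * x ^ 9 - 121176 * a ^ 2 * x ^ 8 - 619344 * a * b * x ^ 7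
  + (-2345376 * a ^ 3 + 743160 * b ^ 2) * x ^ 6 - 2544696 * a ^ 2 * b * x ^ 5
  + (4470840 * a ^ 4 - 7109784 * a * b ^ 2) * x ^ 4 + (-12786576 * a ^ 3 * b + 10982400 * b ^ 3) * x ^ 3
  + (-43272900 * a ^ 5 + 42485256 * a ^ 2 * b ^ 2) * x ^ 2 + (-39588516 * a ^ 4 * b + 39388800 * a * b ^ 3) * x
  + (-106168320 * a ^ 6 + 200624280 * a ^ 3 * b ^ 2 - 94478400 * b ^ 4)

/-- Bézout cofactor of `∂_λ𝔇(λ,1)` (k2 gen 7). -/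
def BV (a b x : R) : R :=
  -187 * a * x ^ 11 + 187 * b * x ^ 10 + 12155 * a ^ 2 * x ^ 9 + 70125 * a * b * x ^ 8
  + (290070 * a ^ 3 - 82500 * b ^ 2) * x ^ 7 + 384846 * a ^ 2 * b * x ^ 6
  + (-835758 * a ^ 4 + 1314852 * a * b ^ 2) * x ^ 5 + (2287890 * a ^ 3 * b - 1878360 * b ^ 3) * x ^ 4
  + (11370645 * a ^ 5 - 11132220 * a ^ 2 * b ^ 2) * x ^ 3 + (15947415 * a ^ 4 * b - 15856720 * a * b ^ 3) * x ^ 2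
  + (38332035 * a ^ 6 - 67142052 * a ^ 3 * b ^ 2 + 28830400 * b ^ 4) * x
  + (2126817 * a ^ 5 * b - 2124760 * a ^ 2 * b ^ 3)

/-- (k2 gen 7, PROVED, `ring`) `BU·𝔇(λ,1) + BV·𝔇_λ(λ,1) = −2¹⁸·3¹⁰·5⁴·(c₄³ − c₆²)⁴`. -/
theorem bezout_D_Dl (c₄ c₆ l : R) :
    BU c₄ c₆ l * D c₄ c₆ l 1 + BV c₄ c₆ l * Dl c₄ c₆ l 1 = -(9674588160000 * (c₄ ^ 3 - c₆ ^ 2) ^ 4) := by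
  simp only [BU, BV, D, Dl]
  ring

/-- (k2 gen 7, PROVED) for a prime `q ∤ 30(c₄³ − c₆²)`, a root of `𝔇(·,1)` mod `q` is simple. -/
theorem helper_simple_root_mod_q (c₄ c₆ r : ℤ) {q : ℕ} (hq : q.Prime)
    (hq30 : ¬ (q : ℤ) ∣ 30 * (c₄ ^ 3 - c₆ ^ 2)) (hr : (q : ℤ) ∣ D c₄ c₆ r 1) :
    ¬ (q : ℤ) ∣ Dl c₄ c₆ r 1 := by
  intro hl
  have hq' : Prime (q : ℤ) := Nat.prime_iff_prime_int.mp hq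
  have hsum : (q : ℤ) ∣ BU c₄ c₆ r * D c₄ c₆ r 1 + BV c₄ c₆ r * Dl c₄ c₆ r 1 :=
    dvd_add (dvd_mul_of_dvd_right hr _) (dvd_mul_of_dvd_right hl _)
  rw [bezout_D_Dl, dvd_neg] at hsum
  have hpow : (q : ℤ) ∣ (30 * (c₄ ^ 3 - c₆ ^ 2)) ^ 18 :=
    dvd_trans hsum ⟨3 ^ 8 * 5 ^ 14 * (c₄ ^ 3 - c₆ ^ 2) ^ 14, by ring⟩
  exact hq30 (hq'.dvd_of_dvd_pow hpow)

/-- NEW (k1 g11): the formal derivative of `𝔇(·,1)` evaluates to Fisher's `𝔇_λ(·,1)`. -/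
theorem eval_derivative_DPoly (c₄ c₆ l : R) :
    (derivative (DPoly c₄ c₆)).eval l = Dl c₄ c₆ l 1 := by
  simp [DPoly, D, Dl, derivative_mul, derivative_pow]
  ring

end Bezout

/-- NEW (k1 g11): `ord_q a = 1` from `q ∣ a`, `q² ∤ a`. -/
theorem padicValInt_eq_one_of_dvd_of_not_sq_dvd {q : ℕ} [Fact q.Prime] {a : ℤ}
    (h1 : (q : ℤ) ∣ a) (h2 : ¬ (q : ℤ) ^ 2 ∣ a) : padicValInt q a = 1 := by
  have h1' := (padicValInt_dvd_iff 1 a).mp (by rwa [pow_one])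
  have h2' : ¬ (a = 0 ∨ 2 ≤ padicValInt q a) := fun h => h2 ((padicValInt_dvd_iff 2 a).mpr h)
  simp only [not_or, not_le] at h2'
  rcases h1' with h | h
  · exact absurd h h2'.1
  · omega

/-- **B7 (PROVED; signature = k2-g9 `helper_lift_root` VERBATIM): a root of `𝔇(·,1)` mod a prime
`q ∤ 30(c₄³ − c₆²)` lifts to `l ∈ {r, r + q}` with `ord_q 𝔇(l,1) = 1`.**  Simple root by the Bézout
certificate; `𝔇(r+q) = 𝔇(r) + q·𝔇_λ(r) + k·q²` by `Polynomial.binomExpansion`. -/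
theorem helper_lift_root {q : ℕ} (hq : q.Prime) (c₄ c₆ r : ℤ)
    (hq0 : ¬ (q : ℤ) ∣ 30 * (c₄ ^ 3 - c₆ ^ 2)) (hr : (q : ℤ) ∣ D c₄ c₆ r 1) :
    ∃ l : ℤ, padicValInt q (D c₄ c₆ l 1) = 1 := by
  haveI : Fact q.Prime := ⟨hq⟩
  have hqz : (q : ℤ) ≠ 0 := by exact_mod_cast hq.ne_zero
  have hsimple : ¬ (q : ℤ) ∣ Dl c₄ c₆ r 1 := helper_simple_root_mod_q c₄ c₆ r hq hq0 hr
  by_cases h2 : (q : ℤ) ^ 2 ∣ D c₄ c₆ r 1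
  · -- second-order root data: move to `r + q`
    obtain ⟨k, hk⟩ := (DPoly c₄ c₆).binomExpansion r (q : ℤ)
    rw [eval_DPoly, eval_DPoly, eval_derivative_DPoly] at hk
    refine ⟨r + q, padicValInt_eq_one_of_dvd_of_not_sq_dvd ?_ ?_⟩
    · rw [hk]
      exact dvd_add (dvd_add hr (dvd_mul_left _ _)) (Dvd.dvd.mul_left (dvd_pow_self _ two_ne_zero) k)
    · rw [hk]
      intro h
      have h3 : (q : ℤ) ^ 2 ∣ Dl c₄ c₆ r 1 * q := by
        have h' := dvd_sub (dvd_sub h h2) (Dvd.dvd.mul_left (dvd_refl ((q : ℤ) ^ 2)) k)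
        have e : D c₄ c₆ r 1 + Dl c₄ c₆ r 1 * (q : ℤ) + k * (q : ℤ) ^ 2 - D c₄ c₆ r 1
            - k * (q : ℤ) ^ 2 = Dl c₄ c₆ r 1 * q := by ring
        rwa [e] at h'
      rw [pow_two] at h3
      exact hsimple ((mul_dvd_mul_iff_right hqz).mp h3)
  · exact ⟨r, padicValInt_eq_one_of_dvd_of_not_sq_dvd hr h2⟩

/-! ## §B8d valuations of the member at `v ∋ q` — PROVED modulo the k2-g5 kernel-certified syzygy -/

/-- Fisher's syzygy `𝔠₄³ − 𝔠₆² = (c₄³ − c₆²)·𝔇⁵` at `μ = 1` — PROVED by ideator k2 (gen 5,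
`hesse_syzygy_five_m1`, `STUB_IDEAS_stub_switch_2g5_Sketch.lean`, `field_simp; ring`, ≈ 70 s,
`maxHeartbeats 8000000`); taken here as a NAMED HYPOTHESIS so this file stays fast — in the road file
`fun c₄ c₆ l => hesse_syzygy_five_m1 c₄ c₆ l : HesseSyzygyFiveM1` discharges it. -/
def HesseSyzygyFiveM1 : Prop :=
  ∀ c₄ c₆ l : ℚ, C4 c₄ c₆ l 1 ^ 3 - C6 c₄ c₆ l 1 ^ 2 = (c₄ ^ 3 - c₆ ^ 2) * D c₄ c₆ l 1 ^ 5

theorem cast_D (c₄ c₆ l : ℤ) : ((D c₄ c₆ l 1 : ℤ) : ℚ) = D (c₄ : ℚ) (c₆ : ℚ) (l : ℚ) 1 := by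
  have h := map_D (Int.castRingHom ℚ) c₄ c₆ l 1
  simpa only [eq_intCast, Int.cast_one] using h

/-- **VAL0 (PROVED; the bridge `v(x) = exp(−ord_q x)` at the place `v ∋ q` — private in the tree as
`CPMuDescent.valuation_eq_exp_neg_padicValRat`, restated with `q` in place of `natGenerator v`).** -/
theorem valuation_eq_exp_neg_padicValRat {q : ℕ} (hq : q.Prime) {v : HeightOneSpectrum (𝓞 ℚ)}
    (hv : (q : 𝓞 ℚ) ∈ v.asIdeal) {x : ℚ} (hx : x ≠ 0) :
    v.valuation ℚ x = WithZero.exp (-padicValRat q x) := by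
  rw [← natGenerator_eq_of_mem hq hv]
  haveI hp : Fact (Rat.HeightOneSpectrum.natGenerator v).Prime :=
    ⟨Rat.HeightOneSpectrum.prime_natGenerator v⟩
  haveI hp' : Fact (Nat.Prime ((Rat.HeightOneSpectrum.primesEquiv v : Nat.Primes) : ℕ)) :=
    ⟨(Rat.HeightOneSpectrum.primesEquiv v).2⟩
  have hequiv := Rat.HeightOneSpectrum.valuation_equiv_padicValuation v
  set n : ℤ := padicValRat (Rat.HeightOneSpectrum.natGenerator v) x with hn
  have h2x : Rat.padicValuation (Rat.HeightOneSpectrum.primesEquiv v) x = WithZero.exp (-n) := by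
    change Rat.padicValuation (Rat.HeightOneSpectrum.natGenerator v) x = _
    simp [Rat.padicValuation, hx, hn]
  have h2p : Rat.padicValuation (Rat.HeightOneSpectrum.primesEquiv v)
      ((Rat.HeightOneSpectrum.natGenerator v : ℚ) ^ n) = WithZero.exp (-n) := by
    change Rat.padicValuation (Rat.HeightOneSpectrum.natGenerator v) _ = _
    rw [map_zpow₀, Rat.padicValuation_self, ← WithZero.exp_zsmul]
    simp
  have h1p : v.valuation ℚ ((Rat.HeightOneSpectrum.natGenerator v : ℚ) ^ n) = WithZero.exp (-n) := by
    rw [map_zpow₀, Literature.NumberTheory.GaloisRepresentations.Rat.valuation_natGenerator,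
      ← WithZero.exp_zsmul]
    simp
  rw [← h1p]
  exact (hequiv.eq_iff).mpr (h2x.trans h2p.symm)


/-- `c₄` of a member (PROVED, gen 5; `6⁴ = 1296`). -/
theorem member_c₄ (c₄ c₆ l m : ℚ) : (member c₄ c₆ l m).c₄ = 6 ^ 4 * C4 c₄ c₆ l m := by
  simp only [WeierstrassCurve.c₄, WeierstrassCurve.b₂, WeierstrassCurve.b₄]; ring

/-- `Δ` of a member (PROVED, gen 5). With the gen-5 PROVED syzygy `hesse_syzygy_five_m1`
(`𝔠₄³ − 𝔠₆² = (c₄³ − c₆²)·𝔇(l,1)⁵`, `…_2g5_Sketch.lean`, ≈ 70 s `field_simp; ring`, not re-run here)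
this is `Δ(E_{l,1}) = 2⁶3⁹(c₄³ − c₆²)𝔇(l,1)⁵`. -/
theorem member_Δ (c₄ c₆ l m : ℚ) :
    (member c₄ c₆ l m).Δ = 2 ^ 6 * 3 ^ 9 * (C4 c₄ c₆ l m ^ 3 - C6 c₄ c₆ l m ^ 2) := by
  simp only [WeierstrassCurve.Δ, WeierstrassCurve.b₂, WeierstrassCurve.b₄, WeierstrassCurve.b₆,
    WeierstrassCurve.b₈]
  ring

section PadicBookkeeping

variable {q : ℕ}

theorem padicValRat_intCast_nonneg (z : ℤ) : 0 ≤ padicValRat q (z : ℚ) := by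
  rw [padicValRat.of_int]; positivity

theorem padicValRat_intCast_of_not_dvd {z : ℤ} (h : ¬ (q : ℤ) ∣ z) : padicValRat q (z : ℚ) = 0 := by
  rw [padicValRat.of_int, padicValInt.eq_zero_of_not_dvd h, Nat.cast_zero]

variable [Fact q.Prime]

/-- `x = z/N` with `q ∤ N` is `q`-integral (in the `x = 0 ∨ 0 ≤ ord_q x` form of B8b). -/
theorem qIntegral_of_eq_div {x : ℚ} {z N : ℤ} (hN : ¬ (q : ℤ) ∣ N) (hx : x = z / N) :
    x = 0 ∨ 0 ≤ padicValRat q x := by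
  by_cases hz : z = 0
  · left; rw [hx, hz, Int.cast_zero, zero_div]
  · right
    have hN0 : N ≠ 0 := by rintro rfl; exact hN (dvd_zero _)
    rw [hx, padicValRat.div (Int.cast_ne_zero.mpr hz) (Int.cast_ne_zero.mpr hN0),
      padicValRat_intCast_of_not_dvd hN, sub_zero]
    exact padicValRat_intCast_nonneg z

end PadicBookkeeping

set_option linter.deprecated false in
/-- `q`-integral rationals have valuation `≤ 1` at the place `v ∋ q`. -/
theorem valuation_le_one_of_qIntegral {q : ℕ} (hq : q.Prime) {v : HeightOneSpectrum (𝓞 ℚ)}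
    (hv : (q : 𝓞 ℚ) ∈ v.asIdeal) {r : ℚ} (hr : r = 0 ∨ 0 ≤ padicValRat q r) :
    v.valuation ℚ r ≤ 1 := by
  rcases eq_or_ne r 0 with h0 | h0
  · rw [h0, map_zero]; exact zero_le'
  · rw [valuation_eq_exp_neg_padicValRat hq hv h0, ← WithZero.exp_zero, WithZero.exp_le_exp]
    have := hr.resolve_left h0
    omega

/-- **B8d (PROVED modulo the named syzygy; conclusion = k2-g9 `helper_member_valuations` VERBATIM):
`Δ ≠ 0`, the member is `v`-integral, `v(c₄) = 1`, `v(Δ) = exp(−5)` at `v ∋ q`, `q ∤ 330(c₄³ − c₆²)`,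
`ord_q 𝔇(l,1) = 1`.**  In the road file: `helper_member_valuations … :=
helper_member_valuations_of_syzygy (fun a b c => hesse_syzygy_five_m1 a b c) …`. -/
theorem helper_member_valuations_of_syzygy (hsyz : HesseSyzygyFiveM1) (c₄ c₆ l : ℤ)
    (hΔ : c₄ ^ 3 ≠ c₆ ^ 2) {q : ℕ} (hq : q.Prime)
    (hq0 : ¬ (q : ℤ) ∣ 330 * (c₄ ^ 3 - c₆ ^ 2)) (hl : padicValInt q (D c₄ c₆ l 1) = 1)
    {v : HeightOneSpectrum (𝓞 ℚ)} (hv : (q : 𝓞 ℚ) ∈ v.asIdeal) :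
    (member (c₄ : ℚ) (c₆ : ℚ) (l : ℚ) 1).Δ ≠ 0 ∧
      (member (c₄ : ℚ) (c₆ : ℚ) (l : ℚ) 1).IsIntegralAt v ∧
      v.valuation ℚ (member (c₄ : ℚ) (c₆ : ℚ) (l : ℚ) 1).c₄ = 1 ∧
      v.valuation ℚ (member (c₄ : ℚ) (c₆ : ℚ) (l : ℚ) 1).Δ = WithZero.exp (-(5 : ℤ)) := by
  haveI : Fact q.Prime := ⟨hq⟩
  have hP : Prime (q : ℤ) := Nat.prime_iff_prime_int.mp hq
  -- the primes `q` avoids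
  have hqt : ¬ (q : ℤ) ∣ c₄ ^ 3 - c₆ ^ 2 := fun h => hq0 (Dvd.dvd.mul_left h 330)
  have hq2 : ¬ (q : ℤ) ∣ 2 := fun h => hq0 (h.trans ⟨165 * (c₄ ^ 3 - c₆ ^ 2), by ring⟩)
  have hq3 : ¬ (q : ℤ) ∣ 3 := fun h => hq0 (h.trans ⟨110 * (c₄ ^ 3 - c₆ ^ 2), by ring⟩)
  have hq5 : ¬ (q : ℤ) ∣ 5 := fun h => hq0 (h.trans ⟨66 * (c₄ ^ 3 - c₆ ^ 2), by ring⟩)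
  have hq11 : ¬ (q : ℤ) ∣ 11 := fun h => hq0 (h.trans ⟨30 * (c₄ ^ 3 - c₆ ^ 2), by ring⟩)
  have hq6 : ¬ (q : ℤ) ∣ 6 := fun h =>
    (hP.dvd_mul.mp (show (q : ℤ) ∣ 2 * 3 by norm_num; exact h)).elim hq2 hq3
  have hq30 : ¬ (q : ℤ) ∣ 30 := fun h =>
    (hP.dvd_mul.mp (show (q : ℤ) ∣ 6 * 5 by norm_num; exact h)).elim hq6 hq5
  have hq66 : ¬ (q : ℤ) ∣ 66 := fun h =>
    (hP.dvd_mul.mp (show (q : ℤ) ∣ 6 * 11 by norm_num; exact h)).elim hq6 hq11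
  have h17424 : ¬ (q : ℤ) ∣ 17424 := fun h =>
    hq66 (hP.dvd_of_dvd_pow (n := 4) (h.trans ⟨1089, by norm_num⟩))
  have h240 : ¬ (q : ℤ) ∣ 240 := fun h =>
    hq30 (hP.dvd_of_dvd_pow (n := 4) (h.trans ⟨3375, by norm_num⟩))
  have hden : ¬ (q : ℤ) ∣ 17424 * 240 := fun h => (hP.dvd_mul.mp h).elim h17424 h240
  -- `x = 𝔠₄(l,1)`, `y = 𝔠₆(l,1)` are `q`-integral (B8a)
  obtain ⟨⟨z₁, hz₁⟩, ⟨z₂, hz₂⟩⟩ := helper_C4_C6_den c₄ c₆ l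
  set x : ℚ := C4 (c₄ : ℚ) (c₆ : ℚ) (l : ℚ) 1 with hxdef
  set y : ℚ := C6 (c₄ : ℚ) (c₆ : ℚ) (l : ℚ) 1 with hydef
  have hx : x = 0 ∨ 0 ≤ padicValRat q x :=
    qIntegral_of_eq_div (N := 17424) h17424 (by rw [hz₁]; push_cast; ring)
  have hy : y = 0 ∨ 0 ≤ padicValRat q y :=
    qIntegral_of_eq_div (N := 17424 * 240) hden (by rw [hz₂]; push_cast; ring)
  -- the syzygy: `x³ − y² = (c₄³ − c₆²)·𝔇(l,1)⁵`, so `ord_q(x³ − y²) = 0 + 5·1`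
  have hsyz' : x ^ 3 - y ^ 2 = ((c₄ ^ 3 - c₆ ^ 2 : ℤ) : ℚ) * ((D c₄ c₆ l 1 : ℤ) : ℚ) ^ 5 := by
    rw [hxdef, hydef, hsyz, cast_D]; push_cast; ring
  have ht0 : ((c₄ ^ 3 - c₆ ^ 2 : ℤ) : ℚ) ≠ 0 := by exact_mod_cast sub_ne_zero.mpr hΔ
  have hD0 : (D c₄ c₆ l 1 : ℤ) ≠ 0 := by
    intro h; rw [h, padicValInt.zero] at hl; exact zero_ne_one hl
  have hD0' : ((D c₄ c₆ l 1 : ℤ) : ℚ) ≠ 0 := by exact_mod_cast hD0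
  have hxy0 : x ^ 3 - y ^ 2 ≠ 0 := by rw [hsyz']; exact mul_ne_zero ht0 (pow_ne_zero 5 hD0')
  have hxy5 : padicValRat q (x ^ 3 - y ^ 2) = 5 := by
    rw [hsyz', padicValRat.mul ht0 (pow_ne_zero 5 hD0'), padicValRat.pow,
      padicValRat_intCast_of_not_dvd hqt, padicValRat.of_int, hl]
    simp
  -- B8b: `x ≠ 0`, `ord_q x = 0`
  obtain ⟨hx0, hxv⟩ := helper_padicValRat_eq_zero_of_cube_sub_sq hx hy hxy0 hxy5
  -- small primes have `ord_q = 0`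
  have hv2 : padicValRat q 2 = 0 := by
    have h := padicValRat_intCast_of_not_dvd hq2; simp only [Int.cast_ofNat] at h; exact h
  have hv3 : padicValRat q 3 = 0 := by
    have h := padicValRat_intCast_of_not_dvd hq3; simp only [Int.cast_ofNat] at h; exact h
  have hv6 : padicValRat q 6 = 0 := by
    have h := padicValRat_intCast_of_not_dvd hq6; simp only [Int.cast_ofNat] at h; exact h
  -- the member's invariants
  have hc4 : (member (c₄ : ℚ) (c₆ : ℚ) (l : ℚ) 1).c₄ = 6 ^ 4 * x := member_c₄ _ _ _ _
  have hΔm : (member (c₄ : ℚ) (c₆ : ℚ) (l : ℚ) 1).Δ = 2 ^ 6 * 3 ^ 9 * (x ^ 3 - y ^ 2) :=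
    member_Δ _ _ _ _
  have hc4val : padicValRat q (6 ^ 4 * x) = 0 := by
    rw [padicValRat.mul (by norm_num) hx0, padicValRat.pow, hv6, hxv]; simp
  have hΔval : padicValRat q (2 ^ 6 * 3 ^ 9 * (x ^ 3 - y ^ 2)) = 5 := by
    rw [padicValRat.mul (by norm_num) hxy0, padicValRat.mul (by norm_num) (by norm_num),
      padicValRat.pow, padicValRat.pow, hv2, hv3, hxy5]; simp
  have ha4 : -27 * x = 0 ∨ 0 ≤ padicValRat q (-27 * x) := by
    right
    rw [padicValRat.mul (by norm_num) hx0, padicValRat.neg, hxv, add_zero]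
    have h := padicValRat_intCast_nonneg (q := q) 27; simp only [Int.cast_ofNat] at h; exact h
  have ha6 : -54 * y = 0 ∨ 0 ≤ padicValRat q (-54 * y) := by
    rcases eq_or_ne y 0 with hy0 | hy0
    · left; rw [hy0, mul_zero]
    · right
      rw [padicValRat.mul (by norm_num) hy0, padicValRat.neg]
      have h54 : 0 ≤ padicValRat q 54 := by
        have h := padicValRat_intCast_nonneg (q := q) 54; simp only [Int.cast_ofNat] at h; exact h
      have hyv := hy.resolve_left hy0
      linarith
  refine ⟨?_, ?_, ?_, ?_⟩
  · rw [hΔm]; exact mul_ne_zero (by norm_num) hxy0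
  · refine isIntegralAt_of_valuation_le_one v _ ?_ ?_ ?_ ?_ ?_
    · simp
    · simp
    · simp
    · exact valuation_le_one_of_qIntegral hq hv ha4
    · exact valuation_le_one_of_qIntegral hq hv ha6
  · rw [hc4, valuation_eq_exp_neg_padicValRat hq hv (mul_ne_zero (by norm_num) hx0), hc4val, neg_zero,
      WithZero.exp_zero]
  · rw [hΔm, valuation_eq_exp_neg_padicValRat hq hv (mul_ne_zero (by norm_num) hxy0), hΔval]

/-! ## sanity: the discharged helpers have exactly the k2-g9 shapes consumed by the road's glue -/

example : IntegralModel := integralModel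
example (c₄ c₆ l : ℤ) := helper_C4_C6_den c₄ c₆ l

end Summit.ABC.ABC.Cruxes.FreyModularity.StubSwitchK1G11

end


/-! # k2 gen-5 syzygy (copied verbatim: `StubSwitchK2G5.hesse_syzygy_five_m1`, PROVED by `field_simp; ring`) -/
noncomputable section
namespace Summit.ABC.ABC.Cruxes.FreyModularity.StubSwitchK2G5x
open Literature.NumberTheory.EllipticCurves.HesseFamilyFive

set_option maxHeartbeats 8000000 in
theorem hesse_syzygy_five_m1 (c₄ c₆ l : ℚ) :
    C4 c₄ c₆ l 1 ^ 3 - C6 c₄ c₆ l 1 ^ 2 = (c₄ ^ 3 - c₆ ^ 2) * D c₄ c₆ l 1 ^ 5 := by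
  simp only [C4, C6, C4l, C4m, D, Dl, Dm, Dll, Dlm, Dmm, Dlll, Dllm, Dlmm, Dmmm]
  field_simp
  ring

end Summit.ABC.ABC.Cruxes.FreyModularity.StubSwitchK2G5x
end

/-
Copyright: h21 programme. Stub-ideation companion (k = 2, GENERATION 9, HOME FAMILY 2 — RESHAPE) —
NOT a route file, NOT a Theorems file.  Elaboration sanity: the reshaped target, its PROVED glue to the
registered stub, the PROVED joins, every OPEN helper with its final signature (`sorry`), and — new in this
generation — the k1-g9 discharge of the Tate block copied VERBATIM (§T, credit: ideator k1) so that ONE file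
carries the whole road.  Imports no other crux workfile (the farm does not build them as modules:
`lean check` of an `import Summits.ABC.ABC.Cruxes.FreyModularity.STUB_IDEAS_stub_switch_1g9_Sketch`
answers `remote:stale:…:unbuilt`), so shared vocabulary is copied, not imported.
-/

/-! # (k2 gen 9) `STUB_IDEAS_stub_switch_2g9_Sketch.lean` — THE ROAD (vocabulary, pieces, joins)
Module docstring (≈8 KB: road diagram, helper census, credits) ELIDED here for the 200 KB workfile cap —
read it in the original workfile; the declarations below are that file's, patched only as listed in the header. -/

set_option linter.dupNamespace false
set_option linter.unusedVariables false

noncomputable section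

open scoped NumberField Classical Pointwise
open Literature.NumberTheory.EllipticCurves Literature.NumberTheory.EllipticCurves.HesseFamilyFive
open Literature.NumberTheory.Automorphic Literature.NumberTheory.GaloisRepresentations
open Literature.NumberTheory.Automorphic.BCDT WeierstrassCurve Field NumberField IsDedekindDomain Matrix

namespace Summit.ABC.ABC.Cruxes.FreyModularity.StubSwitchK2G9

/-! ## §0 Vocabulary (copied from the gen-2/5/8 companions; `Iff.rfl`-equal) -/

/-- `Sig.stub_switch` verbatim (the registered stub's statement; = `BCDT.CDT_three_five_switch`). -/
def StubSwitch : Prop :=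
  ∀ (W : WeierstrassCurve ℚ) [W.IsElliptic], ¬ 27 ∣ W.conductorNorm ℤ →
    (∀ ρ₃ : ModPGaloisRep ℚ (ZMod 3) 2, W.IsTorsionGaloisRep 3 ρ₃ →
      ¬ ρ₃.IsAbsIrreducibleOverSqrt (-3)) →
    ∀ (ρ : ModPGaloisRep ℚ (ZMod 5) 2), W.IsTorsionGaloisRep 5 ρ → ρ.IsAbsIrreducibleOverSqrt 5 →
    ∃ (W' : WeierstrassCurve ℚ) (_ : W'.IsElliptic), W'.IsTorsionGaloisRep 5 ρ ∧
      ∃ ρ₃' : ModPGaloisRep ℚ (ZMod 3) 2, W'.IsTorsionGaloisRep 3 ρ₃' ∧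
        ρ₃'.IsAbsIrreducibleOverSqrt (-3)

theorem stubSwitch_iff_CDT_three_five_switch : StubSwitch ↔ CDT_three_five_switch := Iff.rfl

/-- Member `E_{l,m}` of Fisher's direct `5`-congruence family of `y² = x³ − 27c₄x − 54c₆`. -/
abbrev member (c₄ c₆ l m : ℚ) : WeierstrassCurve ℚ :=
  ⟨0, 0, 0, -27 * C4 c₄ c₆ l m, -54 * C6 c₄ c₆ l m⟩

/-- The `c₄c₆`-model (= the member at `(l:m) = (1:0)`). -/
abbrev base (c₄ c₆ : ℚ) : WeierstrassCurve ℚ := ⟨0, 0, 0, -27 * c₄, -54 * c₆⟩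

/-- The modulus of the line: `M = 2640·|c₄³ − c₆²|` (`2640 = 2⁴·3·5·11`; `8`, `3`, `5`, `11` and every
prime of bad reduction of the INTEGRAL model `base c₄ c₆` divide it; `11` because of the denominators
`17424 = 2⁴3²11²`, `240` of Fisher's `𝔠₄, 𝔠₆`). -/
def modulus (c₄ c₆ : ℤ) : ℕ := 2640 * (c₄ ^ 3 - c₆ ^ 2).natAbs

/-- **The reshaped 3-side target (gen 2, verbatim).** -/
def CuspForcedSource : Prop :=
  ∀ (W : WeierstrassCurve ℚ) [W.IsElliptic] (ρ : ModPGaloisRep ℚ (ZMod 5) 2),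
    W.IsTorsionGaloisRep 5 ρ → ρ.IsAbsIrreducibleOverSqrt 5 →
    ∃ (W' : WeierstrassCurve ℚ) (_ : W'.IsElliptic), Congr W' W ∧
      W'.HasSurjectiveModNGaloisRep ((3 : ℕ) : ℤ)

/-! ## §1 TOP GLUE (PROVED, gen 2): `CuspForcedSource ⇒ stub_switch` -/

theorem isTorsionGaloisRep_of_congr {W W' : WeierstrassCurve ℚ} (h : Congr W' W)
    {ρ : ModPGaloisRep ℚ (ZMod 5) 2} (hρ : W.IsTorsionGaloisRep 5 ρ) :
    W'.IsTorsionGaloisRep 5 ρ := by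
  obtain ⟨e', he'⟩ := h
  obtain ⟨e, he⟩ := hρ
  refine ⟨e'.trans e, fun σ P => ?_⟩
  rw [AddEquiv.trans_apply, AddEquiv.trans_apply, he', he]

theorem surjective_of_hasSurjectiveModNGaloisRep {F : Type} [Field F] {W : WeierstrassCurve F}
    {p : ℕ} [Fact p.Prime] (hs : W.HasSurjectiveModNGaloisRep (p : ℤ)) {ρ : ModPGaloisRep F (ZMod p) 2}
    (hρ : W.IsTorsionGaloisRep p ρ) : Function.Surjective ρ := by
  obtain ⟨e, he⟩ := hρ
  intro M
  let f : (Fin 2 → ZMod p) ≃+ (Fin 2 → ZMod p) :=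
    { toFun := fun v ↦ (M : Matrix (Fin 2) (Fin 2) (ZMod p)) *ᵥ v
      invFun := fun v ↦ ((M⁻¹ : GL (Fin 2) (ZMod p)) : Matrix (Fin 2) (Fin 2) (ZMod p)) *ᵥ v
      left_inv := fun v ↦ by
        simp only [Matrix.mulVec_mulVec, Units.inv_mul, Matrix.one_mulVec]
      right_inv := fun v ↦ by
        simp only [Matrix.mulVec_mulVec, Units.mul_inv, Matrix.one_mulVec]
      map_add' := fun v w ↦ Matrix.mulVec_add _ _ _ }
  have hf : ∀ v, f v = (M : Matrix (Fin 2) (Fin 2) (ZMod p)) *ᵥ v := fun _ ↦ rfl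
  obtain ⟨σ, hσ⟩ := hs (Multiplicative.ofAdd (e.trans (f.trans e.symm)))
  have hσP : ∀ P : geomTorsion W p, σ • P = e.symm (f (e P)) := fun P ↦ by
    have h := W.galoisRepTorsion_apply (p : ℤ) σ P
    rw [hσ, toAdd_ofAdd] at h
    exact h.symm
  refine ⟨σ, ?_⟩
  have hv : ∀ v : Fin 2 → ZMod p,
      ((ρ σ : GL (Fin 2) (ZMod p)) : Matrix (Fin 2) (Fin 2) (ZMod p)) *ᵥ v =
        (M : Matrix (Fin 2) (Fin 2) (ZMod p)) *ᵥ v := fun v ↦ by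
    have h := he σ (e.symm v)
    rw [hσP, AddEquiv.apply_symm_apply, AddEquiv.apply_symm_apply, hf] at h
    exact h.symm
  have hmat : ((ρ σ : GL (Fin 2) (ZMod p)) : Matrix (Fin 2) (Fin 2) (ZMod p)) =
      (M : Matrix (Fin 2) (Fin 2) (ZMod p)) :=
    Matrix.toLin'.injective (LinearMap.ext fun v ↦ by rw [Matrix.toLin'_apply, Matrix.toLin'_apply, hv])
  exact Units.ext hmat

/-- **`CuspForcedSource ⇒ stub_switch` (PROVED).** -/
theorem stubSwitch_of_cuspForcedSource (h : CuspForcedSource) : StubSwitch := by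
  intro W _ _ _ ρ hρ hirr
  obtain ⟨W', hW', hc, hs⟩ := h W ρ hρ hirr
  haveI := hW'
  haveI : Fact (Nat.Prime 3) := ⟨Nat.prime_three⟩
  haveI : NeZero ((3 : ℕ) : ℚ) := ⟨by norm_num⟩
  obtain ⟨ρ₃, hρ₃⟩ := W'.exists_isTorsionGaloisRep 3
  exact ⟨W', hW', isTorsionGaloisRep_of_congr hc hρ, ρ₃, hρ₃,
    isAbsIrreducibleOverSqrt_neg_three_of_surjective ρ₃
      (surjective_of_hasSurjectiveModNGaloisRep hs hρ₃)⟩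

theorem CDT_three_five_switch_of_cuspForcedSource (h : CuspForcedSource) : CDT_three_five_switch :=
  stubSwitch_iff_CDT_three_five_switch.mp (stubSwitch_of_cuspForcedSource h)

/-! ## §2 THE THREE PIECES (gen-8 cut) and their PROVED join -/

/-- **Piece A `SquareSource` (S, pure group theory + framing): a Galois element whose SQUARE is `−1` on
`W[5]`, with `χ̄₅(τ²) = 1`.**  (= G1a′ `NegOneIsSquare` + G1′.) -/
def SquareSource : Prop :=
  ∀ (W : WeierstrassCurve ℚ) [W.IsElliptic] (ρ : ModPGaloisRep ℚ (ZMod 5) 2),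
    W.IsTorsionGaloisRep 5 ρ → ρ.IsAbsIrreducibleOverSqrt 5 →
    ∃ τ : absoluteGaloisGroup ℚ, (∀ P : W.geomTorsion 5, τ • (τ • P) = -P) ∧
      modNCyclotomicCharacter ℚ 5 (τ * τ) = 1

/-- **Piece I `IntegralModel` (S−, plumbing): every `W/ℚ` is `5`-congruent (indeed `ℚ`-isomorphic) to an
INTEGRAL `c₄c₆`-model.** (`congr_fisherModel`, `scale_smul_short` with `v = d⁶`, `congr_of_smul_eq`.) -/
def IntegralModel : Prop :=
  ∀ (W : WeierstrassCurve ℚ) [W.IsElliptic], ∃ c₄ c₆ : ℤ, c₄ ^ 3 ≠ c₆ ^ 2 ∧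
    ∃ _ : (base (c₄ : ℚ) (c₆ : ℚ)).IsElliptic, Congr (base (c₄ : ℚ) (c₆ : ℚ)) W

/-- **Piece B `CuspMemberSource` (the constructive heart: Chebotarev + cusp forcing + local structure).**
For the integral model `B = base c₄ c₆`, a modulus `M` (multiple of `modulus c₄ c₆`) and `τ` with
`τ² = −1` on `B[5]`, `χ̄₅(τ²) = 1`: there are an integer `l`, a prime `q ∤ M` with its place `v`, a prime
`𝔓 ∣ q` of `\bar ℤ` and an arithmetic Frobenius `φ` at `𝔓` such that the member `E = E_{l,1}` is
elliptic, `5`-congruent to `B`, semistable away from `M`, multiplicative at `q` with `v_q(Δ_min) = 5`,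
and `φ = −1` on `E[5]`, `χ̄₃(φ) = χ̄₅(φ) = 1`, `χ̄_M(φ) = χ̄_M(τ²)`. -/
def CuspMemberSource : Prop :=
  ∀ (c₄ c₆ : ℤ), c₄ ^ 3 ≠ c₆ ^ 2 → ∀ [(base (c₄ : ℚ) (c₆ : ℚ)).IsElliptic] (M : ℕ) [NeZero M]
    (τ : absoluteGaloisGroup ℚ), modulus c₄ c₆ ∣ M →
    (∀ P : (base (c₄ : ℚ) (c₆ : ℚ)).geomTorsion 5, τ • (τ • P) = -P) →
    modNCyclotomicCharacter ℚ 5 (τ * τ) = 1 →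
    ∃ (l : ℤ) (_ : (member (c₄ : ℚ) (c₆ : ℚ) (l : ℚ) 1).IsElliptic) (q : ℕ)
      (v : HeightOneSpectrum (𝓞 ℚ)) (𝔓 : Ideal (absIntegers (𝓞 ℚ) ℚ)) (φ : absoluteGaloisGroup ℚ),
      q.Prime ∧ ¬ q ∣ M ∧ (q : 𝓞 ℚ) ∈ v.asIdeal ∧ 𝔓 ∈ v.primesAbove ∧ IsArithFrobAt (𝓞 ℚ) φ 𝔓 ∧
      Congr (member (c₄ : ℚ) (c₆ : ℚ) (l : ℚ) 1) (base (c₄ : ℚ) (c₆ : ℚ)) ∧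
      (∀ w : HeightOneSpectrum (𝓞 ℚ), (M : 𝓞 ℚ) ∉ w.asIdeal →
        (member (c₄ : ℚ) (c₆ : ℚ) (l : ℚ) 1).IsSemistableAt w) ∧
      (member (c₄ : ℚ) (c₆ : ℚ) (l : ℚ) 1).HasMultiplicativeReductionAt v ∧
      (member (c₄ : ℚ) (c₆ : ℚ) (l : ℚ) 1).ordMinimalDiscriminant v = 5 ∧
      (∀ P : (member (c₄ : ℚ) (c₆ : ℚ) (l : ℚ) 1).geomTorsion 5, φ • P = -P) ∧
      modNCyclotomicCharacter ℚ 3 φ = 1 ∧ modNCyclotomicCharacter ℚ 5 φ = 1 ∧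
      modNCyclotomicCharacter ℚ M φ = modNCyclotomicCharacter ℚ M (τ * τ)

/-- **Piece C `SurjThreeOfCuspData` (Tate + reducible-case contradiction + Serre): the data of Piece B
force `ρ̄_{E,3}` onto `GL₂(𝔽₃)`.** -/
def SurjThreeOfCuspData : Prop :=
  ∀ (E : WeierstrassCurve ℚ) [E.IsElliptic] (M : ℕ) [NeZero M] (q : ℕ) (v : HeightOneSpectrum (𝓞 ℚ))
    (𝔓 : Ideal (absIntegers (𝓞 ℚ) ℚ)) (φ τ : absoluteGaloisGroup ℚ),
    8 ∣ M → 3 ∣ M →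
    (∀ w : HeightOneSpectrum (𝓞 ℚ), (M : 𝓞 ℚ) ∉ w.asIdeal → E.IsSemistableAt w) →
    q.Prime → ¬ q ∣ M → (q : 𝓞 ℚ) ∈ v.asIdeal → 𝔓 ∈ v.primesAbove → IsArithFrobAt (𝓞 ℚ) φ 𝔓 →
    E.HasMultiplicativeReductionAt v → E.ordMinimalDiscriminant v = 5 →
    (∀ P : E.geomTorsion 5, φ • P = -P) →
    modNCyclotomicCharacter ℚ 3 φ = 1 → modNCyclotomicCharacter ℚ 5 φ = 1 →
    modNCyclotomicCharacter ℚ M φ = modNCyclotomicCharacter ℚ M (τ * τ) →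
    E.HasSurjectiveModNGaloisRep ((3 : ℕ) : ℤ)

/-- **THE JOIN (PROVED): `SquareSource ∧ IntegralModel ∧ CuspMemberSource ∧ SurjThreeOfCuspData ⇒
CuspForcedSource`.** -/
theorem cuspForcedSource_of_pieces (hA : SquareSource) (hI : IntegralModel) (hB : CuspMemberSource)
    (hC : SurjThreeOfCuspData) : CuspForcedSource := by
  intro W _ ρ hρ hirr
  obtain ⟨τ, hτ, hχτ⟩ := hA W ρ hρ hirr
  obtain ⟨c₄, c₆, hΔ, hBell, hBW⟩ := hI W
  haveI := hBell
  haveI : NeZero (modulus c₄ c₆) :=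
    ⟨mul_ne_zero (by norm_num) (Int.natAbs_ne_zero.mpr (sub_ne_zero.mpr hΔ))⟩
  have hτB : ∀ P : (base (c₄ : ℚ) (c₆ : ℚ)).geomTorsion 5, τ • (τ • P) = -P := by
    obtain ⟨e, he⟩ := hBW
    intro P
    apply e.injective
    rw [he, he, hτ, map_neg]
  obtain ⟨l, hEll, q, v, 𝔓, φ, hq, hqM, hv, h𝔓, hφ, hcongr, hss, hmult, hord, hneg, h3, h5, hM⟩ :=
    hB c₄ c₆ hΔ (modulus c₄ c₆) τ dvd_rfl hτB hχτ
  haveI := hEll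
  refine ⟨member (c₄ : ℚ) (c₆ : ℚ) (l : ℚ) 1, hEll, congr_trans hcongr hBW, ?_⟩
  exact hC _ (modulus c₄ c₆) q v 𝔓 φ τ (dvd_mul_of_dvd_left (by norm_num) _)
    (dvd_mul_of_dvd_left (by norm_num) _) hss hq hqM hv h𝔓 hφ hmult hord hneg h3 h5 hM

/-- hence the registered stub from the four pieces (PROVED). -/
theorem stubSwitch_of_pieces (hA : SquareSource) (hI : IntegralModel) (hB : CuspMemberSource)
    (hC : SurjThreeOfCuspData) : StubSwitch :=
  stubSwitch_of_cuspForcedSource (cuspForcedSource_of_pieces hA hI hB hC)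

/-! ## §A helpers for `SquareSource` -/

/-- **G1a′ (S; statement VERBATIM = gen-5/gen-7 `NegOneIsSquare`; every finite fact it needs is DECIDED in
`STUB_IDEAS_stub_switch_2g7_Sketch.lean` §2–§3: `orders_SL2`, `invol`, `s3_pair/s3_comm/normC3_gen`,
`u5_pair/u5_comm/normU_gen`, `GL_orders`).**  `G ≤ GL₂(𝔽₅)` with `det G = 𝔽₅ˣ`, `H ≤ G` with
`det(H)² = 1`, `H` without a common eigenline and non-abelian ⇒ some `g ∈ G` has `g² = −1`. -/
def NegOneIsSquare : Prop :=
  ∀ (G H : Subgroup (GL (Fin 2) (ZMod 5))), H ≤ G →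
    (∀ d : (ZMod 5)ˣ, ∃ g ∈ G, Matrix.GeneralLinearGroup.det g = d) →
    (∀ h ∈ H, Matrix.GeneralLinearGroup.det h ^ 2 = 1) →
    (∀ w : Fin 2 → ZMod 5, w ≠ 0 → ∃ h ∈ H, ∀ c : ZMod 5,
      (h : Matrix (Fin 2) (Fin 2) (ZMod 5)) *ᵥ w ≠ c • w) →
    (∃ h₁ ∈ H, ∃ h₂ ∈ H, h₁ * h₂ ≠ h₂ * h₁) →
    ∃ g ∈ G, g * g = -1

/-- G1a′ (S): the sylow-free case analysis of gen 7 §4 over the decided tables. -/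
theorem negOneIsSquare : NegOneIsSquare :=
  StubSwitchK1G12.negOneIsSquare

/-- **G1′ (S, framing glue): `G = range ρ̄`, `H = ρ̄(Γ_{ℚ(√5)})`; `det ρ̄ = χ̄₅` onto
(`det_eq_modPCyclotomicCharacter_of_isTorsionGaloisRep_holds`, `χ̄₅` onto over `ℚ`), `χ̄₅² = 1` on
`Γ_{ℚ(√5)}`, no common eigenline / non-abelian from `IsAbsIrreducibleOverSqrt 5`; G1a′ gives `ρ̄(τ)² = −1`,
the frame turns it into `τ • (τ • P) = −P`, and `χ̄₅(τ²) = det(−1) = 1`.** -/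
theorem helper_exists_tau_sq_eq_neg (hG : NegOneIsSquare) (W : WeierstrassCurve ℚ) [W.IsElliptic]
    (ρ : ModPGaloisRep ℚ (ZMod 5) 2) (hρ : W.IsTorsionGaloisRep 5 ρ)
    (hirr : ρ.IsAbsIrreducibleOverSqrt 5) :
    ∃ τ : absoluteGaloisGroup ℚ, (∀ P : W.geomTorsion 5, τ • (τ • P) = -P) ∧
      modNCyclotomicCharacter ℚ 5 (τ * τ) = 1 :=
  StubSwitchK1G12.helper_exists_tau_sq_eq_neg hG W ρ hρ hirr

/-- Piece A from G1a′ + G1′ (PROVED glue). -/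
theorem squareSource_of (hG : NegOneIsSquare) : SquareSource :=
  fun W _ ρ hρ hirr => helper_exists_tau_sq_eq_neg hG W ρ hρ hirr

/-! ## §I the integral model (S−) -/

/-- **I0 (S−).** `W ≅ base(W.c₄, W.c₆)` (`congr_fisherModel`), then rescale by `d⁶`, `d` a common
denominator (`scale_smul_short`, `congr_of_smul_eq`, `congr_symm/trans`); `IsElliptic` transports along
variable changes. -/
theorem integralModel : IntegralModel :=
  StubSwitchK1G11.integralModel

/-! ## §B helpers for `CuspMemberSource`
B1 is the TREE fact `chebotarev_geomTorsion_holds` (applied to `base`, level `n = M`, `σ = τ * τ`,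
`S = {p : p ∣ M}`); F1 is the tree NAMED FACT `thm132_geomTorsionFive_of_hesseFamily`. -/

/-- **B2 (XS): equal actions on `W[n]` restrict to `W[d]`, `d ∣ n`.** -/
theorem helper_smul_eq_of_dvd (W : WeierstrassCurve ℚ) {d n : ℤ} (hdn : d ∣ n)
    {φ σ : absoluteGaloisGroup ℚ} (h : ∀ P : W.geomTorsion n, φ • P = σ • P)
    (P : W.geomTorsion d) : φ • P = σ • P :=
  StubSwitchK1G10.helper_smul_eq_of_dvd W hdn h P

/-- **B3 = G2 (S): equal actions on `W[n]` ⇒ equal `χ̄_n`** (`det ρ̄_{W,n} = χ̄_n`: tree PROVED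
`det_eq_modNCyclotomicCharacter`, one frame of `W[n]` for both elements). -/
theorem helper_cyclotomic_eq_of_smul_eq (W : WeierstrassCurve ℚ) [W.IsElliptic] {n : ℕ} [NeZero n]
    (hn : 2 ≤ n) {φ σ : absoluteGaloisGroup ℚ} (h : ∀ P : W.geomTorsion n, φ • P = σ • P) :
    modNCyclotomicCharacter ℚ n φ = modNCyclotomicCharacter ℚ n σ :=
  StubSwitchK1G10.helper_cyclotomic_eq_of_smul_eq W hn h

/-- `(ℤ/3)ˣ` has exponent `2` (PROVED, `decide`). -/
theorem units_zmod3_mul_self (x : (ZMod 3)ˣ) : x * x = 1 := by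
  revert x; decide

/-- **B4 (PROVED, XS): `χ̄₃(τ²) = 1`.** -/
theorem helper_chi3_sq (τ : absoluteGaloisGroup ℚ) : modNCyclotomicCharacter ℚ 3 (τ * τ) = 1 := by
  rw [map_mul]; exact units_zmod3_mul_self _

/-- **B5 = C1-i (S): a Frobenius-fixed algebraic integer is congruent to a rational integer mod `𝔓`.** -/
theorem helper_exists_int_congr_of_frob_fixed {v : HeightOneSpectrum (𝓞 ℚ)}
    {𝔓 : Ideal (absIntegers (𝓞 ℚ) ℚ)} (h𝔓 : 𝔓 ∈ v.primesAbove)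
    {φ : absoluteGaloisGroup ℚ} (hφ : IsArithFrobAt (𝓞 ℚ) φ 𝔓)
    (A : absIntegers (𝓞 ℚ) ℚ) (hA : φ • A = A) : ∃ a : ℤ, A - a ∈ 𝔓 :=
  StubSwitchK1G11.helper_exists_int_congr_of_frob_fixed h𝔓 hφ A hA

/-! ### B6 RE-CUT (gen 9, RESHAPE technique 2 — SPLIT the `M−` cusp step over the gen-6 KERNEL
CERTIFICATE; integrality from the MONICITY of `𝔇(·,1)`, not from a denominator bound) -/

/-- **B6α (S; every step kernel-side or routine): a `φ`-fixed root of Fisher's `𝔇_B(·,1)` in `\bar ℚ`.**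
From `φ = −1` on `B[5]`: a non-zero `T = (x,y) ∈ B[5]` (`exists_isTorsionGaloisRep 5` gives
`B[5] ≃+ 𝔽₅²`) has `φx = x` (`φT = −T`; negation fixes `x` on a short model; the action is coordinatewise,
`Affine.Point.map_some`), `y ≠ 0` (`T` has odd order) and `ψ₅(x) = 0` (`PSI5_eq_zero_of_five_torsion`,
`…_2g6_Cert.lean`, from `zsmul_some_eq_zero_iff_eval_ΨSq`); a primitive 5th root of unity `ζ ∈ \bar ℚ`
(`exists_isPrimitiveRoot_absIntegers`) has `φζ = ζ^{χ̄₅(φ)} = ζ` (`smul_eq_pow_modNCyclotomicCharacter`, `hζ`),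
so `p := ζ + ζ⁴` is `φ`-fixed with `p² + p − 1 = 0` (`IsPrimitiveRoot.geom_sum_eq_zero`); the KERNEL-CERTIFIED
cusp identity `D_LL_MM_eq_zero` (`…_2g6_Cert.lean`, any field) gives `𝔇(LL(x,p), MM(x)) = 0` with
`MM(x) = 12y² ≠ 0` (`MM_eq_twelve_mul_sq`), hence `ξ := LL/MM` is a root of `𝔇(·,1)` by homogeneity
(`helper_D_smul`, gen 4 PROVED) fixed by the ring automorphism `φ` (it fixes `x`, `p`, `ℚ`). -/
theorem helper_fixed_cusp_root (hcert : StubSwitchK1G12.CuspCertificate) (c₄ c₆ : ℤ) (hΔ : c₄ ^ 3 ≠ c₆ ^ 2) [(base (c₄ : ℚ) (c₆ : ℚ)).IsElliptic]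
    {φ : absoluteGaloisGroup ℚ} (hζ : modNCyclotomicCharacter ℚ 5 φ = 1)
    (hneg : ∀ P : (base (c₄ : ℚ) (c₆ : ℚ)).geomTorsion 5, φ • P = -P) :
    ∃ ξ : AlgebraicClosure ℚ, φ • ξ = ξ ∧
      D (c₄ : AlgebraicClosure ℚ) (c₆ : AlgebraicClosure ℚ) ξ 1 = 0 :=
  StubSwitchK1G12.helper_fixed_cusp_root_of_cert hcert c₄ c₆ hΔ hζ hneg

/-- **B6β (XS/S−): a root of the MONIC integer polynomial `𝔇(·,1)` (leading term `l¹²`,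
`ModFiveCongruenceHessePolynomials.D`) is an algebraic integer** — `IsIntegral ℤ ξ` witnessed by the
explicit monic `Polynomial ℤ` whose `aeval ξ` is `D c₄ c₆ ξ 1`, then `mem_integralClosure_iff` +
`IsIntegral.tower_top` (`ℤ → 𝓞 ℚ`).  Replaces gen-8's "`MM ∉ 𝔓` by a Bézout identity". -/
theorem helper_mem_absIntegers_of_D_eq_zero (c₄ c₆ : ℤ) {ξ : AlgebraicClosure ℚ}
    (hξ : D (c₄ : AlgebraicClosure ℚ) (c₆ : AlgebraicClosure ℚ) ξ 1 = 0) :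
    ξ ∈ absIntegers (𝓞 ℚ) ℚ :=
  StubSwitchK1G11.helper_mem_absIntegers_of_D_eq_zero c₄ c₆ hξ

/-- **B6γ (S−): the reduction mod `𝔓` of an integral root lands in `qℤ`.**  If `A ∈ \bar ℤ` is a root
of `𝔇(·,1)` and `A ≡ a (mod 𝔓)` with `a ∈ ℤ`, then `𝔇(a,1) − 𝔇(A,1) ∈ (a − A) ⊆ 𝔓`
(`Polynomial.sub_dvd_eval_sub` on the univariate integer polynomial, mapped by `algebraMap ℤ \bar ℤ`;
`helper_map_D`), so `(𝔇(a,1) : \bar ℤ) ∈ 𝔓` and `𝔓 ∩ ℤ = qℤ` (`h𝔓.2.over`, `Ideal.mem_comap`,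
`Rat.intCast_mem_asIdeal_iff`, `Rat.HeightOneSpectrum.natGenerator` `= q` by `natGenerator_eq_of_mem`;
pattern of the tree's `Rat.natCast_not_mem_of_mem_primesAbove_of_not_dvd`). -/
theorem helper_dvd_D_of_sub_mem (c₄ c₆ : ℤ) {q : ℕ} (hq : q.Prime) {v : HeightOneSpectrum (𝓞 ℚ)}
    (hv : (q : 𝓞 ℚ) ∈ v.asIdeal) {𝔓 : Ideal (absIntegers (𝓞 ℚ) ℚ)} (h𝔓 : 𝔓 ∈ v.primesAbove)
    {A : absIntegers (𝓞 ℚ) ℚ}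
    (hA : D (c₄ : AlgebraicClosure ℚ) (c₆ : AlgebraicClosure ℚ) (A : AlgebraicClosure ℚ) 1 = 0)
    {a : ℤ} (ha : A - a ∈ 𝔓) : (q : ℤ) ∣ D c₄ c₆ a 1 :=
  StubSwitchK1G11.helper_dvd_D_of_sub_mem c₄ c₆ hq hv h𝔓 hA ha

/-- **B6 (gen-8 signature VERBATIM; `M−` in gen 8) — now PROVED GLUE from B6α + B6β + B5 + B6γ.**
The `Γ_ℚ`-action on `\bar ℤ` is the restriction of the action on `\bar ℚ` (`integralClosure.coe_smul`, `rfl`). -/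
theorem helper_D_root_mod_q (hcert : StubSwitchK1G12.CuspCertificate) (c₄ c₆ : ℤ) (hΔ : c₄ ^ 3 ≠ c₆ ^ 2) [(base (c₄ : ℚ) (c₆ : ℚ)).IsElliptic]
    {q : ℕ} (hq : q.Prime) (hq0 : ¬ (q : ℤ) ∣ 30 * (c₄ ^ 3 - c₆ ^ 2))
    {v : HeightOneSpectrum (𝓞 ℚ)} (hv : (q : 𝓞 ℚ) ∈ v.asIdeal)
    {𝔓 : Ideal (absIntegers (𝓞 ℚ) ℚ)} (h𝔓 : 𝔓 ∈ v.primesAbove)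
    {φ : absoluteGaloisGroup ℚ} (hφ : IsArithFrobAt (𝓞 ℚ) φ 𝔓)
    (hζ : modNCyclotomicCharacter ℚ 5 φ = 1)
    (hneg : ∀ P : (base (c₄ : ℚ) (c₆ : ℚ)).geomTorsion 5, φ • P = -P) :
    ∃ r : ℤ, (q : ℤ) ∣ D c₄ c₆ r 1 := by
  obtain ⟨ξ, hfix, hroot⟩ := helper_fixed_cusp_root hcert c₄ c₆ hΔ hζ hneg
  have hint : ξ ∈ absIntegers (𝓞 ℚ) ℚ := helper_mem_absIntegers_of_D_eq_zero c₄ c₆ hroot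
  obtain ⟨a, ha⟩ := helper_exists_int_congr_of_frob_fixed h𝔓 hφ ⟨ξ, hint⟩
    (Subtype.ext (by rw [integralClosure.coe_smul]; exact hfix))
  exact ⟨a, helper_dvd_D_of_sub_mem c₄ c₆ hq hv h𝔓 (A := ⟨ξ, hint⟩) hroot ha⟩

/-- **B7 = C1s′ + C2 (S): a root mod `q ∤ 30(c₄³−c₆²)` lifts to `l ∈ ℤ` with `v_q(𝔇(l,1)) = 1`.**
The root is SIMPLE by the PROVED Bézout certificate `bezout_D_Dl`
(`BU·𝔇 + BV·𝔇_λ = −2¹⁸3¹⁰5⁴(c₄³−c₆²)⁴`, `…_2g7_Sketch.lean`, `helper_simple_root_mod_q` PROVED there);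
then `𝔇(r+q) ≡ 𝔇(r) + q·𝔇_λ(r) (mod q²)`, so `l ∈ {r, r+q}` works. -/
theorem helper_lift_root {q : ℕ} (hq : q.Prime) (c₄ c₆ r : ℤ)
    (hq0 : ¬ (q : ℤ) ∣ 30 * (c₄ ^ 3 - c₆ ^ 2)) (hr : (q : ℤ) ∣ D c₄ c₆ r 1) :
    ∃ l : ℤ, padicValInt q (D c₄ c₆ l 1) = 1 :=
  StubSwitchK1G11.helper_lift_root hq c₄ c₆ r hq0 hr

/-! ### B8 RE-CUT (gen 9, RESHAPE technique 1 — LOCALISE onto the tree's minimal-model criteria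
`isMinimalAt_of_valuation_c₄_eq_one` (AEC VII Rem. 1.1), `hasMultiplicativeReductionAt_of_valuation_c₄_eq_one`
(AEC VII Prop. 5.1(b)), `valuation_Δ_eq_of_isMinimalAt_holds` (AEC VII Prop. 1.3); what remains OPEN is
`ℚ`-valuation arithmetic on Fisher's closed forms) -/

/-- the prime under a place of `ℚ` containing `q` is `q` (PROVED, XS; pattern of the tree's private
`primesEquiv_eq_of_natCast_mem`). -/
theorem natGenerator_eq_of_mem {q : ℕ} (hq : q.Prime) {v : HeightOneSpectrum (𝓞 ℚ)}
    (hv : (q : 𝓞 ℚ) ∈ v.asIdeal) : Rat.HeightOneSpectrum.natGenerator v = q := by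
  have h1 : Rat.HeightOneSpectrum.natGenerator v ∣ q := by
    rw [Rat.HeightOneSpectrum.natGenerator_dvd_iff]
    have h2 := Ideal.mem_map_of_mem (Rat.IsIntegralClosure.intEquiv (𝓞 ℚ)) hv
    rwa [map_natCast] at h2
  exact (Nat.prime_dvd_prime_iff_eq (Rat.HeightOneSpectrum.prime_natGenerator v) hq).mp h1

/-- **VAL0 (PROVED; the bridge `v(x) = exp(−ord_q x)` at the place `v ∋ q` — private in the tree as
`CPMuDescent.valuation_eq_exp_neg_padicValRat`, restated with `q` in place of `natGenerator v`).** -/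
theorem valuation_eq_exp_neg_padicValRat {q : ℕ} (hq : q.Prime) {v : HeightOneSpectrum (𝓞 ℚ)}
    (hv : (q : 𝓞 ℚ) ∈ v.asIdeal) {x : ℚ} (hx : x ≠ 0) :
    v.valuation ℚ x = WithZero.exp (-padicValRat q x) := by
  rw [← natGenerator_eq_of_mem hq hv]
  haveI hp : Fact (Rat.HeightOneSpectrum.natGenerator v).Prime :=
    ⟨Rat.HeightOneSpectrum.prime_natGenerator v⟩
  haveI hp' : Fact (Nat.Prime ((Rat.HeightOneSpectrum.primesEquiv v : Nat.Primes) : ℕ)) :=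
    ⟨(Rat.HeightOneSpectrum.primesEquiv v).2⟩
  have hequiv := Rat.HeightOneSpectrum.valuation_equiv_padicValuation v
  set n : ℤ := padicValRat (Rat.HeightOneSpectrum.natGenerator v) x with hn
  have h2x : Rat.padicValuation (Rat.HeightOneSpectrum.primesEquiv v) x = WithZero.exp (-n) := by
    change Rat.padicValuation (Rat.HeightOneSpectrum.natGenerator v) x = _
    simp [Rat.padicValuation, hx, hn]
  have h2p : Rat.padicValuation (Rat.HeightOneSpectrum.primesEquiv v)
      ((Rat.HeightOneSpectrum.natGenerator v : ℚ) ^ n) = WithZero.exp (-n) := by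
    change Rat.padicValuation (Rat.HeightOneSpectrum.natGenerator v) _ = _
    rw [map_zpow₀, Rat.padicValuation_self, ← WithZero.exp_zsmul]
    simp
  have h1p : v.valuation ℚ ((Rat.HeightOneSpectrum.natGenerator v : ℚ) ^ n) = WithZero.exp (-n) := by
    rw [map_zpow₀, Literature.NumberTheory.GaloisRepresentations.Rat.valuation_natGenerator,
      ← WithZero.exp_zsmul]
    simp
  rw [← h1p]
  exact (hequiv.eq_iff).mpr (h2x.trans h2p.symm)

/-- `c₄` of a member (PROVED, gen 5; `6⁴ = 1296`). -/
theorem member_c₄ (c₄ c₆ l m : ℚ) : (member c₄ c₆ l m).c₄ = 6 ^ 4 * C4 c₄ c₆ l m := by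
  simp only [WeierstrassCurve.c₄, WeierstrassCurve.b₂, WeierstrassCurve.b₄]; ring

/-- `Δ` of a member (PROVED, gen 5). With the gen-5 PROVED syzygy `hesse_syzygy_five_m1`
(`𝔠₄³ − 𝔠₆² = (c₄³ − c₆²)·𝔇(l,1)⁵`, `…_2g5_Sketch.lean`, ≈ 70 s `field_simp; ring`, not re-run here)
this is `Δ(E_{l,1}) = 2⁶3⁹(c₄³ − c₆²)𝔇(l,1)⁵`. -/
theorem member_Δ (c₄ c₆ l m : ℚ) :
    (member c₄ c₆ l m).Δ = 2 ^ 6 * 3 ^ 9 * (C4 c₄ c₆ l m ^ 3 - C6 c₄ c₆ l m ^ 2) := by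
  simp only [WeierstrassCurve.Δ, WeierstrassCurve.b₂, WeierstrassCurve.b₄, WeierstrassCurve.b₆,
    WeierstrassCurve.b₈]
  ring

/-- **B8a (XS, casts only): at integer arguments Fisher's `𝔠₄, 𝔠₆` have denominators `17424 = 2⁴3²11²` and
`17424·240 = 2⁸3³5·11²`** (read off `ModFiveCongruenceHessePolynomials.C4/C6/C4l/C4m`: the numerators are
integer polynomials; `push_cast [C4, C6, C4l, C4m, Dll, Dlm, Dmm, Dl, Dm, …]`, `ring`). -/
theorem helper_C4_C6_den (c₄ c₆ l : ℤ) :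
    (∃ z : ℤ, C4 (c₄ : ℚ) (c₆ : ℚ) (l : ℚ) 1 = (z : ℚ) / 17424) ∧
      ∃ z : ℤ, C6 (c₄ : ℚ) (c₆ : ℚ) (l : ℚ) 1 = (z : ℚ) / (17424 * 240) :=
  StubSwitchK1G11.helper_C4_C6_den c₄ c₆ l

/-- **B8b (S−, pure valuation arithmetic — the gen-5 "VAL" lemma, restated with both conclusions):
`q`-integral `x, y` with `ord_q(x³ − y²) = 5` force `x ≠ 0` and `ord_q x = 0`** (`ord(x³) = 3a` and
`ord(y²) = 2b` are never `5`; if unequal the difference has `ord = min ≠ 5`, if equal then `6 ∣ 3a`, so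
`a ≥ 2` and `ord ≥ 6`; `a = 0` is the only case; `padicValRat.pow`, `padicValRat.min_le_padicValRat_add`,
`padicValRat.add_eq_min`). -/
theorem helper_padicValRat_eq_zero_of_cube_sub_sq {q : ℕ} [Fact q.Prime] {x y : ℚ}
    (hx : x = 0 ∨ 0 ≤ padicValRat q x) (hy : y = 0 ∨ 0 ≤ padicValRat q y) (hxy : x ^ 3 - y ^ 2 ≠ 0)
    (h5 : padicValRat q (x ^ 3 - y ^ 2) = 5) : x ≠ 0 ∧ padicValRat q x = 0 :=
  StubSwitchK1G11.helper_padicValRat_eq_zero_of_cube_sub_sq hx hy hxy h5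

/-- **B8c (PROVED from the tree, the LOCALISED criterion): an integral equation with unit `c₄` and
`v(Δ) = exp(−n)`, `n > 0`, is multiplicative at `v` with `ord_v Δ_min = n`.** -/
theorem helper_mult_of_valuations (W : WeierstrassCurve ℚ) [W.IsElliptic]
    {v : HeightOneSpectrum (𝓞 ℚ)} (hW : W.IsIntegralAt v) (hc₄ : v.valuation ℚ W.c₄ = 1) {n : ℕ}
    (hn : 0 < n) (hΔ : v.valuation ℚ W.Δ = WithZero.exp (-(n : ℤ))) :
    W.HasMultiplicativeReductionAt v ∧ W.ordMinimalDiscriminant v = n := by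
  have hlt : v.valuation ℚ W.Δ < 1 := by
    rw [hΔ, ← WithZero.exp_zero, WithZero.exp_lt_exp]; omega
  refine ⟨hasMultiplicativeReductionAt_of_valuation_c₄_eq_one hW hc₄ hlt, ?_⟩
  have h := valuation_Δ_eq_of_isMinimalAt_holds v W (isMinimalAt_of_valuation_c₄_eq_one hW hc₄)
  rw [hΔ, WithZero.exp_inj] at h
  omega

/-- **B8d (S−, OPEN; bookkeeping valuations of the member at `v ∋ q`, `q ∤ 330(c₄³−c₆²)`, `v_q(𝔇(l,1)) = 1`):
`Δ ≠ 0`, the member is `v`-integral, `v(c₄) = 1`, `v(Δ) = exp(−5)`.**  Recipe: `x := 𝔠₄(l,1)`,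
`y := 𝔠₆(l,1)` are `q`-integral (B8a, `q ∤ 2·3·5·11`); `x³ − y² = (c₄³ − c₆²)𝔇(l,1)⁵` (gen-5 PROVED
`hesse_syzygy_five_m1`) has `ord_q = 0 + 5·1` (`padicValRat.mul/pow`, `padicValRat.of_int` + `hl`); so
`ord_q x = 0` (B8b); `member_c₄ = 6⁴x`, `member_Δ = 2⁶3⁹(x³ − y²)`; convert with VAL0
(`valuation_eq_exp_neg_padicValRat`) and `isIntegralAt_of_valuation_le_one` (`a₁ = a₂ = a₃ = 0`,
`a₄ = −27x`, `a₆ = −54y`). -/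
theorem helper_member_valuations (c₄ c₆ l : ℤ) (hΔ : c₄ ^ 3 ≠ c₆ ^ 2) {q : ℕ} (hq : q.Prime)
    (hq0 : ¬ (q : ℤ) ∣ 330 * (c₄ ^ 3 - c₆ ^ 2)) (hl : padicValInt q (D c₄ c₆ l 1) = 1)
    {v : HeightOneSpectrum (𝓞 ℚ)} (hv : (q : 𝓞 ℚ) ∈ v.asIdeal) :
    (member (c₄ : ℚ) (c₆ : ℚ) (l : ℚ) 1).Δ ≠ 0 ∧
      (member (c₄ : ℚ) (c₆ : ℚ) (l : ℚ) 1).IsIntegralAt v ∧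
      v.valuation ℚ (member (c₄ : ℚ) (c₆ : ℚ) (l : ℚ) 1).c₄ = 1 ∧
      v.valuation ℚ (member (c₄ : ℚ) (c₆ : ℚ) (l : ℚ) 1).Δ = WithZero.exp (-(5 : ℤ)) :=
  StubSwitchK1G11.helper_member_valuations_of_syzygy
    (fun a b c => StubSwitchK2G5x.hesse_syzygy_five_m1 a b c) c₄ c₆ l hΔ hq hq0 hl hv

/-- **B8 (gen-8 signature VERBATIM; `M−` in gen 8) — now PROVED GLUE from B8d + B8c.** -/
theorem helper_member_multiplicative (c₄ c₆ l : ℤ) (hΔ : c₄ ^ 3 ≠ c₆ ^ 2) {q : ℕ} (hq : q.Prime)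
    (hq0 : ¬ (q : ℤ) ∣ 330 * (c₄ ^ 3 - c₆ ^ 2)) (hl : padicValInt q (D c₄ c₆ l 1) = 1)
    {v : HeightOneSpectrum (𝓞 ℚ)} (hv : (q : 𝓞 ℚ) ∈ v.asIdeal) :
    ∃ (_ : (member (c₄ : ℚ) (c₆ : ℚ) (l : ℚ) 1).IsElliptic),
      (member (c₄ : ℚ) (c₆ : ℚ) (l : ℚ) 1).HasMultiplicativeReductionAt v ∧
      (member (c₄ : ℚ) (c₆ : ℚ) (l : ℚ) 1).ordMinimalDiscriminant v = 5 := by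
  obtain ⟨hΔ0, hint, hc4, hval⟩ := helper_member_valuations c₄ c₆ l hΔ hq hq0 hl hv
  haveI hE : (member (c₄ : ℚ) (c₆ : ℚ) (l : ℚ) 1).IsElliptic := ⟨isUnit_iff_ne_zero.mpr hΔ0⟩
  exact ⟨hE, helper_mult_of_valuations _ hint hc4 (n := 5) (by norm_num) (by rw [hval]; norm_cast)⟩

/-- **F1 (PROVED, 2 lines): Fisher's Theorem 13.2 (tree NAMED FACT) as a `Congr`.** -/
theorem congr_member_base (hF : thm132_geomTorsionFive_of_hesseFamily) (c₄ c₆ l : ℚ)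
    [hE : (base c₄ c₆).IsElliptic] [hE' : (member c₄ c₆ l 1).IsElliptic] :
    Congr (member c₄ c₆ l 1) (base c₄ c₆) := by
  obtain ⟨e, he⟩ := hF (base c₄ c₆) (member c₄ c₆ l 1) c₄ c₆ l 1 rfl rfl
  exact ⟨e, he⟩

/-- **B9 = N1′ (S, NOW TREE-BACKED): the member is semistable at every `w ∤ 30(c₄³−c₆²)`.**
`base` is an integral short model with `Δ = 2⁶3⁹(c₄³−c₆²)` a `w`-unit ⇒ good at `w`
(`hasGoodReductionAt_of_valuation_le_one_of_valuation_Δ_eq_one`) ⇒ the inertia group of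
`𝔓₀ = adicCompletionPrime ℚ w` acts trivially on `base[5]` (`smul_geomTorsion_eq_of_mem_inertia`, `w ∤ 5`)
⇒ via the equivariant `e` of `Congr` trivially on `member[5]` ⇒ not additive
(contrapositive of `exists_mem_inertia_smul_geomTorsion_ne_of_hasAdditiveReductionAt`, `m = 5 ≥ 3`,
`w ∤ 5`; bridge `GreenbergSelmer.inertia w = 𝔓₀.inertia Γ_ℚ` = `inertia_adicCompletionPrime_eq_map_absInertia`,
`adicCompletionPrime_mem_primesAbove`) ⇒ semistable (`isSemistableAt_iff_not_hasAdditiveReductionAt`). -/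
theorem helper_isSemistableAt_member (c₄ c₆ l : ℤ) (hΔ : c₄ ^ 3 ≠ c₆ ^ 2)
    [(base (c₄ : ℚ) (c₆ : ℚ)).IsElliptic] [(member (c₄ : ℚ) (c₆ : ℚ) (l : ℚ) 1).IsElliptic]
    (hc : Congr (member (c₄ : ℚ) (c₆ : ℚ) (l : ℚ) 1) (base (c₄ : ℚ) (c₆ : ℚ)))
    {w : HeightOneSpectrum (𝓞 ℚ)} (hw : ((30 * (c₄ ^ 3 - c₆ ^ 2).natAbs : ℕ) : 𝓞 ℚ) ∉ w.asIdeal) :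
    (member (c₄ : ℚ) (c₆ : ℚ) (l : ℚ) 1).IsSemistableAt w :=
  StubSwitchK1G11.helper_isSemistableAt_member c₄ c₆ l hΔ hc hw

/-! ## §C helpers for `SurjThreeOfCuspData` -/

/-! ### §T  THE TATE BLOCK — DISCHARGED (ideator k1, gen 9; copied VERBATIM from
`STUB_IDEAS_stub_switch_1g9_Sketch.lean`, namespace `…StubSwitchK1G9`, lines 108–388, sorry-free, axioms
`[propext, Classical.choice, Quot.sound]`; the only edit is the name `helper_frob_addOneSq_three'` ↦
`helper_frob_addOneSq_three` = gen-8 T2's name and signature, so §G consumes it unchanged; gen-8 T1 is deleted).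
Credit and maintenance: k1.  Included here because crux workfiles cannot be imported on the farm. -/

/-! #### §T.1 (k1) The eigenline re-cut of the Tate block (helpers E1–E7)

Notation: `K_v = v.adicCompletion K`, `K̄_v = AlgebraicClosure K_v`, `Ψ : K̄_vˣ → E(K̄_v)` a TWISTED Tate
parametrisation with kernel `q^ℤ` and sign `ε : Γ_{K_v} → {±1}` (`σ • Ψ(u) = ε σ • Ψ(σ u)`), as delivered by
`TateCurve.exists_twistedTateUniformisation_tateJ` with `ε σ = if σ t = t then 1 else -1`. -/

section Local

variable {K : Type} [Field K] [NumberField K] (W : WeierstrassCurve K) (v : HeightOneSpectrum (𝓞 K))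

/-- **E1 (PROVED here; pure import) — the Tate EIGENPOINT.** For a root of unity `u ∈ K̄_vˣ` of prime
order `p`, `L := Ψ(u)` is a non-zero `p`-torsion point, and every `σ ∈ Γ_{K_v}` FIXING `u` acts on `L`
by the sign `ε σ`.  (`map_ofMul_ne_zero_of_pow_eq_one`, `zsmul_map_ofMul_eq_zero_of_pow_eq_one`, `htw`.)
Replaces the "shape on ALL `p₁p₂`-torsion" of k2-g8 T1: only the eigenpoint is needed downstream. -/
theorem helper_tate_eigenpoint_local {q : v.adicCompletion K} (hq0 : q ≠ 0) (hq1 : Valued.v q < 1)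
    (Ψ : Additive (AlgebraicClosure (v.adicCompletion K))ˣ →+ localPoints W (v.adicCompletion K))
    (hker : ∀ u : (AlgebraicClosure (v.adicCompletion K))ˣ, Ψ (Additive.ofMul u) = 0 ↔
      ∃ n : ℤ, (u : AlgebraicClosure (v.adicCompletion K)) =
        algebraMap (v.adicCompletion K) (AlgebraicClosure (v.adicCompletion K)) q ^ n)
    (ε : absoluteGaloisGroup (v.adicCompletion K) → ℤ)
    (htw : ∀ (σ : absoluteGaloisGroup (v.adicCompletion K))
        (u : (AlgebraicClosure (v.adicCompletion K))ˣ),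
      σ • Ψ (Additive.ofMul u) = ε σ • Ψ (Additive.ofMul (Units.map
        (Field.absoluteGaloisGroup.toAlgEquiv (v.adicCompletion K) σ :
          AlgebraicClosure (v.adicCompletion K) →* AlgebraicClosure (v.adicCompletion K)) u)))
    {p : ℕ} [Fact p.Prime] {u : (AlgebraicClosure (v.adicCompletion K))ˣ} (hup : u ^ p = 1)
    (hu1 : u ≠ 1) :
    Ψ (Additive.ofMul u) ≠ 0 ∧ (p : ℤ) • Ψ (Additive.ofMul u) = 0 ∧
      ∀ σ : absoluteGaloisGroup (v.adicCompletion K),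
        Field.absoluteGaloisGroup.toAlgEquiv (v.adicCompletion K) σ u = u →
          σ • Ψ (Additive.ofMul u) = ε σ • Ψ (Additive.ofMul u) := by
  refine ⟨map_ofMul_ne_zero_of_pow_eq_one (W := W) (v := v) hq0 hq1 Ψ hker hup hu1,
    zsmul_map_ofMul_eq_zero_of_pow_eq_one (W := W) (v := v) Ψ hup, fun σ hσ ↦ ?_⟩
  have hfix : Units.map (Field.absoluteGaloisGroup.toAlgEquiv (v.adicCompletion K) σ :
      AlgebraicClosure (v.adicCompletion K) →* AlgebraicClosure (v.adicCompletion K)) u = u :=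
    Units.ext (by simpa using hσ)
  simpa only [hfix] using htw σ u

/-- **E1′ (PROVED here) — roots of unity of `K̄` give the units `u` of E1**, fixed by every
`σ ∈ Γ_{K_v}` whose restriction fixes them in `K̄` (IMPORT 6). -/
theorem helper_unit_of_closureEmb {p : ℕ} (hp : p.Prime) {ζ : AlgebraicClosure K} (hζp : ζ ^ p = 1)
    (hζ1 : ζ ≠ 1) :
    ∃ u : (AlgebraicClosure (v.adicCompletion K))ˣ,
      (u : AlgebraicClosure (v.adicCompletion K)) = closureEmb (K := K) (v.adicCompletion K) ζ ∧
      u ^ p = 1 ∧ u ≠ 1 ∧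
      ∀ σ : absoluteGaloisGroup (v.adicCompletion K), resGal (K := K) (v.adicCompletion K) σ • ζ = ζ →
        Field.absoluteGaloisGroup.toAlgEquiv (v.adicCompletion K) σ u = u := by
  have hζu : IsUnit (closureEmb (K := K) (v.adicCompletion K) ζ) :=
    (IsUnit.of_pow_eq_one hζp hp.ne_zero).map _
  refine ⟨hζu.unit, rfl, Units.ext ?_, fun h ↦ hζ1 ?_, fun σ hσ ↦ ?_⟩
  · rw [Units.val_pow_eq_pow_val, IsUnit.unit_spec, ← map_pow, hζp, map_one, Units.val_one]
  · have h' := congrArg Units.val h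
    rw [IsUnit.unit_spec, Units.val_one, ← map_one (closureEmb (K := K) (v.adicCompletion K))] at h'
    exact (closureEmb (K := K) (v.adicCompletion K)).injective h'
  · rw [IsUnit.unit_spec, ← Field.absoluteGaloisGroup.smul_def, ← closureEmb_resGal_smul, hσ]

end Local

section Global

variable {K : Type} [Field K] [NumberField K] (W : WeierstrassCurve K) [W.IsElliptic]
  {v : HeightOneSpectrum (𝓞 K)}

/-- **E2 (PROVED here from E1, E1′ and IMPORTS 1, 5) — the GLOBAL Tate eigenline with a COMMON sign.**  At a multiplicative place `v`
there is ONE sign function `ε : Γ_{K_v} → {±1}` (the unramified quadratic twist of Silverman V.5.3,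
trivial iff split) such that for EVERY prime `p` and every non-trivial `p`-th root of unity `ζ ∈ K̄`,
some non-zero `P ∈ E[p](K̄)` satisfies `σ|_{K̄} • P = ε σ • P` for all `σ ∈ Γ_{K_v}` with `σ|_{K̄} ζ = ζ`.
Proof plan (pattern of PROVED `exists_unipotent_of_hasMultiplicativeReductionAt`): IMPORT 1 → `ε`;
E1′ → `u`; E1 → `L = Ψ(u)`; IMPORT 5 → global `P` with `pointsMap P = L`; `pointsMap_smul` +
`pointsMapOfEmb_injective` transport the eigen-relation.  No `hζ`, no `p ∤ v`, uniform in `char k_v`. -/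
theorem helper_tate_eigenline_global (hmult : W.HasMultiplicativeReductionAt v) :
    ∃ ε : absoluteGaloisGroup (v.adicCompletion K) → ℤ,
      (∀ σ, ε σ = 1 ∨ ε σ = -1) ∧
      ∀ (p : ℕ), p.Prime → ∀ ζ : AlgebraicClosure K, ζ ^ p = 1 → ζ ≠ 1 →
        ∃ P : geomPoints W, P ≠ 0 ∧ p • P = 0 ∧
          ∀ σ : absoluteGaloisGroup (v.adicCompletion K),
            resGal (K := K) (v.adicCompletion K) σ • ζ = ζ →
              resGal (K := K) (v.adicCompletion K) σ • P = ε σ • P := by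
  obtain ⟨q, t, Ψ, hq0, hq1, -, -, -, -, -, hker, htw⟩ :=
    TateCurve.exists_twistedTateUniformisation_tateJ W v hmult
  refine ⟨fun σ ↦ if Field.absoluteGaloisGroup.toAlgEquiv (v.adicCompletion K) σ t = t then (1 : ℤ)
      else -1, fun σ ↦ ?_, fun p hp ζ hζp hζ1 ↦ ?_⟩
  · by_cases h : Field.absoluteGaloisGroup.toAlgEquiv (v.adicCompletion K) σ t = t
    · exact Or.inl (if_pos h)
    · exact Or.inr (if_neg h)
  haveI : Fact p.Prime := ⟨hp⟩
  -- E1′: the unit `u = ι(ζ) ∈ K̄_vˣ`; E1: the eigenpoint `L = Ψ(u)`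
  obtain ⟨u, hu, hup, hu1, hufix⟩ := helper_unit_of_closureEmb (K := K) v hp hζp hζ1
  obtain ⟨hL0, hpL, hLσ⟩ := helper_tate_eigenpoint_local W v hq0 hq1 Ψ hker
    (fun σ ↦ if Field.absoluteGaloisGroup.toAlgEquiv (v.adicCompletion K) σ t = t then (1 : ℤ)
      else -1) htw hup hu1
  -- IMPORT 5: the eigenpoint comes from `E(K̄)`
  have hpL' : p • Ψ (Additive.ofMul u) = 0 := by rw [← natCast_zsmul]; exact hpL
  obtain ⟨P, hpP, hPL⟩ := exists_pointsMapOfEmb_eq_of_nsmul_eq_zero W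
    (closureEmb (K := K) (v.adicCompletion K)) hp.ne_zero hpL'
  have hinj : Function.Injective (pointsMap W (v.adicCompletion K)) := pointsMapOfEmb_injective W _
  refine ⟨P, ?_, hpP, fun σ hσ ↦ hinj ?_⟩
  · rintro rfl
    exact hL0 (by rw [← hPL, map_zero])
  · have key := hLσ σ (hufix σ hσ)
    rw [← hPL] at key
    rw [pointsMap_smul, map_zsmul]
    exact key

/-- **E3 (PROVED here, pure algebra) — the sign is read off at an ODD level.** If `ε ∈ {±1}`,
`P ≠ 0` is `p`-torsion with `p` odd and `ε • P = -P`, then `ε = -1`. (Used with `p = 5`.) -/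
theorem helper_sign_eq_neg_one {A : Type*} [AddCommGroup A] {P : A} (hP : P ≠ 0) {p : ℕ}
    (hp : Odd p) (hpP : p • P = 0) {ε : ℤ} (hε : ε = 1 ∨ ε = -1) (h : ε • P = -P) : ε = -1 := by
  rcases hε with rfl | rfl
  · exfalso
    rw [one_zsmul] at h
    have h2 : 2 • P = 0 := by rw [two_nsmul]; nth_rw 1 [h]; exact neg_add_cancel P
    have hd : addOrderOf P ∣ 1 := by
      have := Nat.dvd_gcd (addOrderOf_dvd_of_nsmul_eq_zero h2) (addOrderOf_dvd_of_nsmul_eq_zero hpP)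
      rwa [Nat.Coprime.gcd_eq_one (Nat.coprime_two_left.mpr hp)] at this
    exact hP (AddMonoid.addOrderOf_eq_one_iff.mp (Nat.dvd_one.mp hd))
  · rfl

/-- **E4 (PROVED here; pure import) — conjugating a decomposition-group element onto `Γ_{K_v}`.**  If `φ ∈ D_𝔓` for a
prime `𝔓` above `v`, then `φ = g · σ|_{K̄} · g⁻¹` for some `g ∈ Γ_K`, `σ ∈ Γ_{K_v}`
(IMPORT 4: `g • 𝔓₀ = 𝔓`; IMPORT 2: `D_{𝔓₀} = range resGal`; `MulAction.stabilizer_smul_eq_stabilizer_map_conj`). -/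
theorem helper_conj_resGal_of_mem_decompositionSubgroup {𝔓 : Ideal (absIntegers (𝓞 K) K)}
    (h𝔓 : 𝔓 ∈ v.primesAbove) {φ : absoluteGaloisGroup K}
    (hφ : φ ∈ 𝔓.decompositionSubgroup (absoluteGaloisGroup K)) :
    ∃ (g : absoluteGaloisGroup K) (σ : absoluteGaloisGroup (v.adicCompletion K)),
      φ = g * resGal (K := K) (v.adicCompletion K) σ * g⁻¹ := by
  obtain ⟨g, hg⟩ := HeightOneSpectrum.exists_smul_eq_of_mem_primesAbove_holds
    (adicCompletionPrime_mem_primesAbove K v) h𝔓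
  subst hg
  rw [Ideal.decompositionSubgroup_smul, Subgroup.mem_pointwise_smul_iff_inv_smul_mem,
    decompositionSubgroup_adicCompletionPrime_eq_range] at hφ
  obtain ⟨σ, hσ⟩ := MonoidHom.mem_range.mp hφ
  refine ⟨g, σ, ?_⟩
  rw [resGal_eq_absGaloisRestrict]
  change φ = g * (absGaloisRestrict K (v.adicCompletion K)).toMonoidHom σ * g⁻¹
  rw [hσ, MulAut.smul_def, MulAut.conj_inv_apply]
  group

/-- **E5 (PROVED here) — `χ̄_N(σ) = 1` means `σ` fixes the `N`-th roots of unity of `K̄`**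
(`modNCyclotomicCharacter_spec`).  Turns k2-g8's hypotheses `h3`/`h5` into the fixing hypotheses of E2,
conjugation-invariantly (`χ̄_N` is a homomorphism to an abelian group). -/
theorem helper_smul_eq_self_of_modNCyclotomicCharacter_eq_one {N : ℕ} [NeZero N]
    {σ : absoluteGaloisGroup K} (hσ : modNCyclotomicCharacter K N σ = 1) {ζ : AlgebraicClosure K}
    (hζ : ζ ^ N = 1) : σ • ζ = ζ := by
  have h := modNCyclotomicCharacter_spec K N σ ζ hζ
  rw [hσ, Units.val_one] at h
  rcases Nat.lt_or_ge 1 N with hN | hN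
  · haveI : Fact (1 < N) := ⟨hN⟩
    rwa [ZMod.val_one, pow_one] at h
  · have hN1 : N = 1 := le_antisymm hN (Nat.pos_of_ne_zero (NeZero.ne N))
    subst hN1
    rw [pow_one] at hζ
    rw [hζ, smul_one]

omit [NumberField K] [W.IsElliptic] in
/-- **E5′ (PROVED here) — `φ = -1` on `E[n]` is conjugation-invariant.** -/
theorem helper_neg_conj {n : ℤ} {φ g : absoluteGaloisGroup K}
    (hneg : ∀ P : W.geomTorsion n, φ • P = -P) (P : W.geomTorsion n) :
    (g⁻¹ * φ * g) • P = -P := by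
  rw [mul_smul, mul_smul, hneg, smul_neg, inv_smul_smul]

end Global

/-! #### §T.2 (k1) The road-facing outputs (currency of Piece C `SurjThreeOfCuspData`) -/

/-- **E6 = N1e (PROVED here from E2–E5; only E2 is open) — a `-1`-EIGENVECTOR of `Frob_q` on `E[3]`.**  `E/ℚ` multiplicative
at `v`, `φ` a Frobenius at `𝔓 ∣ v` with `χ̄₃(φ) = χ̄₅(φ) = 1` acting as `-1` on `E[5]` ⇒ some
`P ∈ E[3] ∖ 0` has `φ • P = -P`.  Assembly: IMPORT 3 + E4 (`φ = g σ|_{K̄} g⁻¹`), E5 (`σ|_{K̄}` fixes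
`ζ₃, ζ₅`), E2 at `p = 5` with E5′ + E3 (`ε σ = -1`), E2 at `p = 3` (`σ|_{K̄} • P₃ = -P₃`), `P := g • P₃`.
SAME hypotheses as k2-g8 T2; no `q`, valid also for `v ∣ 15`. -/
theorem helper_frob_neg_eigenvector_three (E : WeierstrassCurve ℚ) [E.IsElliptic]
    {v : HeightOneSpectrum (𝓞 ℚ)} (hmult : E.HasMultiplicativeReductionAt v)
    {𝔓 : Ideal (absIntegers (𝓞 ℚ) ℚ)} (h𝔓 : 𝔓 ∈ v.primesAbove) {φ : absoluteGaloisGroup ℚ}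
    (hφ : IsArithFrobAt (𝓞 ℚ) φ 𝔓) (h3 : modNCyclotomicCharacter ℚ 3 φ = 1)
    (h5 : modNCyclotomicCharacter ℚ 5 φ = 1) (hneg : ∀ P : E.geomTorsion 5, φ • P = -P) :
    ∃ P : E.geomTorsion 3, P ≠ 0 ∧ φ • P = -P := by
  haveI := h𝔓.1
  -- E4: `φ = g σ|_{K̄} g⁻¹`
  obtain ⟨g, σ, hφg⟩ :=
    helper_conj_resGal_of_mem_decompositionSubgroup (K := ℚ) h𝔓 hφ.mem_stabilizer
  have hφ' : resGal (K := ℚ) (v.adicCompletion ℚ) σ = g⁻¹ * φ * g := by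
    rw [hφg]; group
  -- E2: the global eigenline with its common sign `ε`
  obtain ⟨ε, hε, hline⟩ := helper_tate_eigenline_global E hmult
  -- E5: `σ|_{K̄}` fixes `ζ₃`, `ζ₅` (cyclotomic characters are conjugation-invariant)
  have hfix : ∀ (N : ℕ) [NeZero N], modNCyclotomicCharacter ℚ N φ = 1 →
      ∀ ζ : AlgebraicClosure ℚ, ζ ^ N = 1 → resGal (K := ℚ) (v.adicCompletion ℚ) σ • ζ = ζ := by
    intro N _ hN ζ hζ
    refine helper_smul_eq_self_of_modNCyclotomicCharacter_eq_one ?_ hζ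
    rw [hφ', map_mul, map_mul, hN, mul_one, map_inv, inv_mul_cancel]
  -- E5′: `g⁻¹ φ g = -1` on `E[5]`, read in `E(K̄)`
  have hconj : ∀ (P : geomPoints E) (hP : P ∈ E.geomTorsion 5), (g⁻¹ * φ * g) • P = -P :=
    fun P hP ↦ congrArg Subtype.val (helper_neg_conj E (g := g) hneg ⟨P, hP⟩)
  have hmem : ∀ (n : ℕ) (P : geomPoints E), n • P = 0 → P ∈ E.geomTorsion n := by
    intro n P h
    refine (Submodule.mem_torsionBy_iff _ _).mpr ?_
    change ((n : ℕ) : ℤ) • P = 0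
    rw [natCast_zsmul, h]
  -- level 5: the sign `ε σ = -1` (E3)
  obtain ⟨ζ₅, hζ₅⟩ := HasEnoughRootsOfUnity.prim (M := AlgebraicClosure ℚ) (n := 5)
  obtain ⟨P₅, hP₅0, h5P₅, hP₅⟩ :=
    hline 5 (by norm_num) ζ₅ hζ₅.pow_eq_one (hζ₅.ne_one (by norm_num))
  have hεσ : ε σ = -1 := by
    have h1 := hP₅ σ (hfix 5 h5 ζ₅ hζ₅.pow_eq_one)
    have h2 : resGal (K := ℚ) (v.adicCompletion ℚ) σ • P₅ = -P₅ := by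
      rw [hφ']; exact hconj P₅ (hmem 5 P₅ h5P₅)
    exact helper_sign_eq_neg_one hP₅0 ⟨2, by norm_num⟩ h5P₅ (hε σ) (h1.symm.trans h2)
  -- level 3: the `-1`-eigenvector, conjugated back by `g`
  obtain ⟨ζ₃, hζ₃⟩ := HasEnoughRootsOfUnity.prim (M := AlgebraicClosure ℚ) (n := 3)
  obtain ⟨P₃, hP₃0, h3P₃, hP₃⟩ :=
    hline 3 (by norm_num) ζ₃ hζ₃.pow_eq_one (hζ₃.ne_one (by norm_num))
  have h3' : (g⁻¹ * φ * g) • P₃ = -P₃ := by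
    rw [← hφ', hP₃ σ (hfix 3 h3 ζ₃ hζ₃.pow_eq_one), hεσ, neg_one_zsmul]
  refine ⟨⟨g • P₃, smul_mem_torsionBy g (hmem 3 P₃ h3P₃)⟩, fun h0 ↦ hP₃0 ?_, Subtype.ext ?_⟩
  · have h0' : g • P₃ = 0 := by simpa using congrArg Subtype.val h0
    exact (smul_eq_zero_iff_eq g).mp h0'
  · show φ • g • P₃ = -(g • P₃)
    have h4 := congrArg (g • ·) h3'
    simp only [smul_smul, smul_neg] at h4
    rwa [show g * (g⁻¹ * φ * g) = φ * g by group, mul_smul] at h4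

/-- **E7 = T2′ (PROVED here; IMPORTS 7–8) — Cayley–Hamilton closes k2-g8 T2 VERBATIM.**  A `-1`-eigenvector on `E[3]` plus
`det ρ̄₃(φ) = χ̄₃(φ) = 1` give `(φ + 1)² = 0` on `E[3]`: in the frame `exists_frame_galoisRepTorsion_rat`
(IMPORT 7 / `det Φ = χ̄`), apply IMPORT 8 to `-M` (`det (-M) = det M` for `2 × 2`).
Honours `Disproof.switch_false_without_det` (the determinant is used). -/
theorem helper_addOneSq_of_neg_eigenvector (E : WeierstrassCurve ℚ) [E.IsElliptic]
    {φ : absoluteGaloisGroup ℚ} (h3 : modNCyclotomicCharacter ℚ 3 φ = 1)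
    {P : E.geomTorsion 3} (hP : P ≠ 0) (hφP : φ • P = -P) :
    ∀ Q : E.geomTorsion 3, φ • (φ • Q + Q) + (φ • Q + Q) = 0 := by
  haveI : Fact (Nat.Prime 3) := ⟨by norm_num⟩
  obtain ⟨e, Φ, he, -, hdet, -⟩ := exists_frame_galoisRepTorsion_rat E 3
  set M : Matrix (Fin 2) (Fin 2) (ZMod 3) :=
    ((Φ (galoisRepTorsion E ((3 : ℕ) : ℤ) φ) : GL (Fin 2) (ZMod 3)) : Matrix (Fin 2) (Fin 2) (ZMod 3))
    with hM
  -- the frame: `e (φ • Q) = M e(Q)`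
  have hMv : ∀ Q : E.geomTorsion 3, e (φ • Q) = M *ᵥ e Q := fun Q ↦ by
    rw [← galoisRepTorsion_apply]; exact he _ Q
  -- `det M = χ̄₃(φ) = 1` (this is where the determinant is used: `Disproof.switch_false_without_det`)
  have hdetM : M.det = 1 := by
    have h := hdet φ
    rw [modPCyclotomicCharacterZMod_eq_modNCyclotomicCharacter, h3] at h
    rw [hM, ← Matrix.GeneralLinearGroup.val_det_apply, h, Units.val_one]
  -- the `-1`-eigenvector in coordinates
  have hc : M *ᵥ e P = -(e P) := by rw [← hMv, hφP, map_neg]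
  have hc0 : e P ≠ 0 := fun h ↦ hP (by simpa using congrArg e.symm h)
  have hunit : IsUnit (e P 0) ∨ IsUnit (e P 1) := by
    by_contra hcon
    simp only [not_or, isUnit_iff_ne_zero, ne_eq, not_not] at hcon
    apply hc0
    funext i
    fin_cases i
    · simpa using hcon.1
    · simpa using hcon.2
  -- Cayley–Hamilton for `-M` (IMPORT 8): `(-M - 1)² = 0`, i.e. `(M + 1)² = 0`
  have hneg : (-M) *ᵥ e P = e P := by rw [Matrix.neg_mulVec, hc, neg_neg]
  have hdet' : (-M).det = 1 := by
    rw [Matrix.det_fin_two] at hdetM ⊢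
    simp only [Matrix.neg_apply]
    linear_combination hdetM
  have hsq := mul_self_sub_one_eq_zero_of_mulVec_eq_of_det_eq_one (-M) (e P) hunit hneg hdet'
  have hsq' : (M + 1) * (M + 1) = 0 := by
    rw [show -M - 1 = -(M + 1) by abel, neg_mul_neg] at hsq
    exact hsq
  intro Q
  apply e.injective
  simp only [map_add, map_zero, hMv]
  have h : ((M + 1) * (M + 1)) *ᵥ e Q = 0 := by rw [hsq', Matrix.zero_mulVec]
  rwa [← Matrix.mulVec_mulVec, Matrix.add_mulVec, Matrix.one_mulVec, Matrix.add_mulVec,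
    Matrix.one_mulVec] at h

/-- **k2-g8 T2, DISCHARGED (sorry-free composition of E6 + E7)**: exactly the signature of
`StubSwitchK2G8.helper_frob_addOneSq_three`, so k2-g8's PROVED `surjThreeOfCuspData_of_helpers` is untouched and
its T1 (`helper_twistedTate_addOneSq_local`) is no longer needed. -/
theorem helper_frob_addOneSq_three (E : WeierstrassCurve ℚ) [E.IsElliptic]
    {v : HeightOneSpectrum (𝓞 ℚ)} (hmult : E.HasMultiplicativeReductionAt v)
    {𝔓 : Ideal (absIntegers (𝓞 ℚ) ℚ)} (h𝔓 : 𝔓 ∈ v.primesAbove) {φ : absoluteGaloisGroup ℚ}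
    (hφ : IsArithFrobAt (𝓞 ℚ) φ 𝔓) (h3 : modNCyclotomicCharacter ℚ 3 φ = 1)
    (h5 : modNCyclotomicCharacter ℚ 5 φ = 1) (hneg : ∀ P : E.geomTorsion 5, φ • P = -P) :
    ∀ Q : E.geomTorsion 3, φ • (φ • Q + Q) + (φ • Q + Q) = 0 := by
  obtain ⟨P, hP, hφP⟩ := helper_frob_neg_eigenvector_three E hmult h𝔓 hφ h3 h5 hneg
  exact helper_addOneSq_of_neg_eigenvector E h3 hP hφP


/- §C helpers (11, k2-g9 lines 822–913) DELETED in this merge: superseded by k1-g10 `surjThreeOfCuspData`. -/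

/-! ## §G PROVED GLUE: the helpers give Pieces B and C (every helper conclusion consumed by name) -/

/-- coprimality plumbing (PROVED): a place containing the prime `q ≠ 3` does not contain `3`. -/
theorem helper_three_not_mem {q : ℕ} (hq : q.Prime) (hq3 : q ≠ 3) {v : HeightOneSpectrum (𝓞 ℚ)}
    (hv : (q : 𝓞 ℚ) ∈ v.asIdeal) : ((3 : ℕ) : 𝓞 ℚ) ∉ v.asIdeal := by
  intro h3
  have hcop : Nat.Coprime 3 q := (Nat.coprime_primes Nat.prime_three hq).mpr hq3.symm
  obtain ⟨a, b, hab⟩ := Nat.isCoprime_iff_coprime.mpr hcop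
  have hab' : (a : 𝓞 ℚ) * ((3 : ℕ) : 𝓞 ℚ) + (b : 𝓞 ℚ) * (q : 𝓞 ℚ) = 1 := by
    have h := congrArg (Int.cast : ℤ → 𝓞 ℚ) hab
    simpa using h
  apply v.isPrime.ne_top
  rw [Ideal.eq_top_iff_one, ← hab']
  exact v.asIdeal.add_mem (v.asIdeal.mul_mem_left _ h3) (v.asIdeal.mul_mem_left _ hv)

/-- **Piece B from its helpers, the tree's Chebotarev fact and Fisher's named fact (PROVED GLUE).** -/
theorem cuspMemberSource_of_helpers (hcert : StubSwitchK1G12.CuspCertificate) 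
    (hF : thm132_geomTorsionFive_of_hesseFamily) :
    CuspMemberSource := by
  intro c₄ c₆ hΔ _ M _ τ hMdvd hτ hχ5
  have hM0 : M ≠ 0 := NeZero.ne M
  have h30M : 30 * (c₄ ^ 3 - c₆ ^ 2).natAbs ∣ M :=
    dvd_trans (mul_dvd_mul_right (by norm_num) _) hMdvd
  have h330M : 330 * (c₄ ^ 3 - c₆ ^ 2).natAbs ∣ M :=
    dvd_trans (mul_dvd_mul_right (by norm_num) _) hMdvd
  have h5M : 5 ∣ M := dvd_trans (dvd_mul_of_dvd_left (by norm_num) _) hMdvd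
  have h3M : 3 ∣ M := dvd_trans (dvd_mul_of_dvd_left (by norm_num) _) hMdvd
  have h8M : 8 ∣ M := dvd_trans (dvd_mul_of_dvd_left (by norm_num) _) hMdvd
  have h2M : 2 ≤ M := by obtain ⟨k, hk⟩ := h8M; omega
  -- B1: Chebotarev for `base[M]`, `σ = τ²`, avoiding the primes dividing `M`
  obtain ⟨q, v, 𝔓, φ, hq, hqS, hv, h𝔓, hφ, hφτ⟩ :=
    chebotarev_geomTorsion_holds (base (c₄ : ℚ) (c₆ : ℚ)) (M : ℤ) (by exact_mod_cast hM0)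
      (↑(Nat.divisors M)) (Finset.finite_toSet _) (τ * τ)
  have hqM : ¬ q ∣ M := fun h => hqS (Finset.mem_coe.mpr (Nat.mem_divisors.mpr ⟨h, hM0⟩))
  have hq30 : ¬ (q : ℤ) ∣ 30 * (c₄ ^ 3 - c₆ ^ 2) := by
    intro h
    have h1 := Int.natCast_dvd.mp h
    rw [Int.natAbs_mul, show (30 : ℤ).natAbs = 30 from rfl] at h1
    exact hqM (dvd_trans h1 h30M)
  have hq330 : ¬ (q : ℤ) ∣ 330 * (c₄ ^ 3 - c₆ ^ 2) := by
    intro h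
    have h1 := Int.natCast_dvd.mp h
    rw [Int.natAbs_mul, show (330 : ℤ).natAbs = 330 from rfl] at h1
    exact hqM (dvd_trans h1 h330M)
  -- B2/B3/B4: `φ = −1` on `base[5]`, `χ̄₅(φ) = χ̄₃(φ) = 1`, `χ̄_M(φ) = χ̄_M(τ²)`
  have h5' : ∀ P : (base (c₄ : ℚ) (c₆ : ℚ)).geomTorsion ((5 : ℕ) : ℤ), φ • P = (τ * τ) • P :=
    fun P => helper_smul_eq_of_dvd _ (by exact_mod_cast h5M) hφτ P
  have h3' : ∀ P : (base (c₄ : ℚ) (c₆ : ℚ)).geomTorsion ((3 : ℕ) : ℤ), φ • P = (τ * τ) • P :=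
    fun P => helper_smul_eq_of_dvd _ (by exact_mod_cast h3M) hφτ P
  have hnegB : ∀ P : (base (c₄ : ℚ) (c₆ : ℚ)).geomTorsion 5, φ • P = -P := fun P => by
    rw [h5' P, mul_smul, hτ P]
  have hχ5φ : modNCyclotomicCharacter ℚ 5 φ = 1 := by
    rw [helper_cyclotomic_eq_of_smul_eq (n := 5) (base (c₄ : ℚ) (c₆ : ℚ)) (by norm_num) h5', hχ5]
  have hχ3φ : modNCyclotomicCharacter ℚ 3 φ = 1 := by
    rw [helper_cyclotomic_eq_of_smul_eq (n := 3) (base (c₄ : ℚ) (c₆ : ℚ)) (by norm_num) h3',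
      helper_chi3_sq]
  have hχM : modNCyclotomicCharacter ℚ M φ = modNCyclotomicCharacter ℚ M (τ * τ) :=
    helper_cyclotomic_eq_of_smul_eq (base (c₄ : ℚ) (c₆ : ℚ)) h2M hφτ
  -- B6/B7: the cusp-adjacent parameter `l`
  obtain ⟨r, hr⟩ := helper_D_root_mod_q hcert c₄ c₆ hΔ hq hq30 hv h𝔓 hφ hχ5φ hnegB
  obtain ⟨l, hl⟩ := helper_lift_root hq c₄ c₆ r hq30 hr
  -- B8: elliptic, multiplicative at `q`, `v_q(Δ_min) = 5`
  obtain ⟨hEll, hmult, hord⟩ := helper_member_multiplicative c₄ c₆ l hΔ hq hq330 hl hv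
  haveI := hEll
  -- F1: the `5`-congruence (Fisher Thm 13.2, named fact)
  have hcongr : Congr (member (c₄ : ℚ) (c₆ : ℚ) (l : ℚ) 1) (base (c₄ : ℚ) (c₆ : ℚ)) :=
    congr_member_base hF (c₄ : ℚ) (c₆ : ℚ) (l : ℚ)
  refine ⟨l, hEll, q, v, 𝔓, φ, hq, hqM, hv, h𝔓, hφ, hcongr, ?_, hmult, hord, ?_, hχ3φ, hχ5φ, hχM⟩
  · -- B9: semistable away from `M`
    intro w hw
    refine helper_isSemistableAt_member c₄ c₆ l hΔ hcongr fun h => hw ?_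
    obtain ⟨k, hk⟩ := h30M
    rw [hk, Nat.cast_mul]
    exact Ideal.mul_mem_right _ _ h
  · -- `φ = −1` on `member[5]` through the equivariant `e`
    obtain ⟨e, he⟩ := hcongr
    intro P
    apply e.injective
    rw [he, hnegB, map_neg]


/-- **EVERYTHING ⇒ the registered stub (PROVED modulo the `sorry`'d helpers and the two named facts
`chebotarev_geomTorsion` (PROVED in the tree) and `thm132_geomTorsionFive_of_hesseFamily` (OPEN)).** -/
theorem stubSwitch_of_helpers (hcert : StubSwitchK1G12.CuspCertificate) 
    (hF : thm132_geomTorsionFive_of_hesseFamily) : StubSwitch :=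
  stubSwitch_of_pieces (squareSource_of negOneIsSquare) integralModel
    (cuspMemberSource_of_helpers hcert hF) StubSwitchK1G10.surjThreeOfCuspData


/-- **THE ROAD, ASSEMBLED (k1 gen 12): `CuspCertificate ⇒ F1 ⇒ stub_switch`** — `CDT_three_five_switch`
(≡ the registered `Sketch.stub_switch` by `Iff.rfl`) from (i) the k2 gen-6 KERNEL CERTIFICATE
`CuspCertificate` (= `StubSwitchK2G6.D_LL_MM_eq_zero`, PROVED, `STUB_IDEAS_stub_switch_2g6_Cert.lean`;
the fully merged file with the certificate inlined is kernel-checked: `scratch/ROAD_merged.lean`, rc 0,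
0 `sorry`, 486 s, axioms `propext, Classical.choice, Quot.sound` — too large (374 KB) for one workfile) and
(ii) the tree NAMED FACT `thm132_geomTorsionFive_of_hesseFamily` [Fisher2012Hessian, Thm 13.2(i)].
NO `sorry` anywhere in this file. -/
theorem CDT_three_five_switch_of_cert_of_thm132 (hcert : StubSwitchK1G12.CuspCertificate)
    (hF : thm132_geomTorsionFive_of_hesseFamily) : CDT_three_five_switch :=
  stubSwitch_iff_CDT_three_five_switch.mp (stubSwitch_of_helpers hcert hF)

end Summit.ABC.ABC.Cruxes.FreyModularity.StubSwitchK2G9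

end
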